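import Literature.NumberTheory.LFunctions.RodgersTaoModeratelySizedProofs
import Literature.NumberTheory.LFunctions.RodgersTaoNearbySumsProofs
import Literature.NumberTheory.LFunctions.RodgersTaoRenormHamiltonianDecayProofs
import Literature.NumberTheory.LFunctions.RodgersTaoTruncEnergyLemma18Proofs
import Mathlib.Analysis.SpecialFunctions.Pow.Asymptotics
import Mathlib.NumberTheory.Harmonic.Bounds
import HarnessLib

/-!
# Rodgers–Tao 2020, Lemma 21 (iii)–(iv) — RH-FREE CONTENT twins: the restricted reciprocal-gap sums
# `(log^C T) Σ ψ_T(j)ψ_T(k)/|x_j(t) − x_k(t)|` over `|j|,|k| ≤ T^{1−c}` and over `|j|,|k| ≥ T^{1+c}`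
# (also with `ξ_i` in place of `x_i(t)`) are «negligible»

RH-FREE literature proofs (no definitions, no named facts, no `sorry`). Trunk T-ANT
(`Literature/NumberTheory/LFunctions`); companion of `RodgersTaoHamiltonian.lean` (the typed,
VACUOUS-AS-PRINTED / EX-FALSO fact `Literature.NumberTheory.LFunctions.rodgers_tao_moderatelySized`,
Rodgers–Tao 2020 Lemma 21 = arXiv v4 Lemma 7.6, whose conjuncts (iii) and (iv) this file proves WITH
CONTENT, above a real-rooted time) and of `RodgersTaoModeratelySizedProofs.lean` (conjunct (i) with content,
`tsum_truncWeight_interactionEnergy_le`, consumed here BY NAME). C3 cell, CONTENT-TWIN programme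
(rt-lead standing ruling: content twins are 0-fact new modules; free row «L21 remainder» of
RULING (63)(f)).

> B. Rodgers, T. Tao, *The de Bruijn–Newman constant is non-negative*, Forum Math. Pi 8 (2020)
> e6 (= arXiv:1801.05914v4 §7), **Lemma 21 (iii)** (FMP p. 47; v4 Lemma 7.6 (iii), v5 TeX
> l. 1177–1196): "Let `t` be in the range `Λ/2 ≤ t ≤ 0`. … (iii) For any absolute constants
> `C, c > 0`, the expression
> `(log^C_+ T) Σ_{j,k ∈ ℤ^*: |j|, |k| ≤ T^{1-c}} ψ_T(j) ψ_T(k)/|x_j(t)-x_k(t)|` is negligible. (iv) For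
> any absolute constants `C, c>0`, the expression
> `(log^C_+ T) Σ_{j,k ∈ ℤ^*: |j|, |k| ≥ T^{1+c}} ψ_T(j) ψ_T(k)/|x_j(t)-x_k(t)|` is negligible." —
> where (p. 47) "negligible if it is of the form `o_{T→∞}(T log³₊ T + Ẽ_T(t))`"; printed proof
> (p. 48): "If instead we use `log^C_+ T/|x_j(t)−x_k(t)| ≤ (1/log₊ T)|x_j(t)−x_k(t)|^{−2} + log^{2C+1}_+ T`
> we obtain (iii) and (iv)."

## What is proved, and the road taken (a declared PROOF-ROUTE divergence)

The statement (iii) is proved for ALL `C, c > 0`, in the tree's `IsNegligible t₀` rendering, above a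
real-rooted time and under the location law (50) on the window `[t₀/2, 0]`:

* `rodgers_tao_negligible_iii_of_location` — for `t₀` with some `t₁ < t₀/2` real-rooted and the
  location law `|x_n(t) − ξ_n| ≤ B log₊ ξ_n` (`n ≥ 1`, `t ∈ [t₀/2, 0]`; the INNER shape of
  `RodgersTao2020.cor33_location`, verbatim the binder `H2` of `rodgers_tao_weak_energy_bound_block_of`),
  conjunct (iii) of `rodgers_tao_moderatelySized t₀` holds;
* `rodgers_tao_negligible_iii_of_cor33_location` — the printed witness form from the as-printed
  location law: `RodgersTao2020.cor33_location → ∀ t₀ < 0, H_{t₀} real-rooted → conjunct (iii)`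
  (the tree proves `RodgersTao2020.cor33_location` with content as `cor33_location_content`).

PROOF ROUTE (why not the printed one-liner). Summing the constant term `ψψ·log^{2C+1}_+ T` of the
printed split over all pairs `|j|,|k| ≤ T^{1−c}` gives `≍ T^{2−2c} log^{2C+1} T` (with `ψ_T ≤ 1`),
which is `o(T log³ T)` only for `c > 1/2`, while Prop. 22 uses (iii) at `c = 0.1` (p. 50, «those `k`
for which `|k| ≤ T^{0.9}`»); cf. the cell's erratum E-d («proofs of (ii)–(iv) from (i) lossy as
printed»; (iii) itself is not in doubt). The proof here is the honest near/far argument, RH-free and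
with in-paper tools only:
* NEAR pairs `|j − k| < D·log₊²(2T)` (`D = 4B'C_ξC₁`): the `AM–GM` split with a free parameter,
  `1/|x_j − x_k| ≤ η E_{jk} + 1/(4η)` (`one_div_abs_le_eta`), `η = ε/(2(1 + C_i) log^{⌈C⌉} T)`; the
  `E`-part is Lemma 21 (i) with content (`tsum_truncWeight_interactionEnergy_le`:
  `Σ ψψE ≤ Ẽ_T(t) + C_i T log³ T`), the `1/(4η)`-part is counted (`sum_ite_abs_sub_lt_le`:
  `≤ 3T^{1−c}·(8D+1) log² T · 2(1+C_i) log^{2⌈C⌉} T/(4ε)`);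
* FAR pairs: the location law over `ℤ*` (`location_zstar_of_nat`), `log₊ ξ_j ≤ C_ξ log₊ j` (43)
  (`exists_logPlus_classicalLocationZ_le`) and the gap bound (44)
  (`exists_inv_abs_sub_classicalLocationZ_le`) give `|x_j − x_k| ≥ |ξ_j − ξ_k|/2`, hence
  `1/|x_j − x_k| ≤ 2C₁ log₊(2T)/|j − k|` (`one_div_abs_sub_deBruijnZeroZ_le_of_far`), summed with
  the two-sided harmonic bound (`sum_one_div_abs_sub_le`, Mathlib `harmonic_le_one_add_log`):
  `≤ 72 C₁ T^{1−c} log^{⌈C⌉+2} T`;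
* thresholds: `log^m T ≤ κ T^c` for `T` large (`exists_forall_log_pow_le`, from Mathlib
  `isLittleO_log_rpow_rpow_atTop`), so both counted terms are `≤ (ε/4)·T ≤ (ε/4)(T log³ T + Ẽ_T(t))`.
The restricted sum has finite support, so its `tsum` is a finite sum over the box
`[−⌊T^{1−c}⌋, ⌊T^{1−c}⌋]²` (`tsum_eq_sum`, `Summable.tsum_subtype_le`). `log^C T` with real `C` is
`Real.rpow`, bounded by `log^{⌈C⌉₊} T` for `log T ≥ 1`.

The `ξ`-CLAUSE of item (iii) («similarly if the `x_i(t)` are replaced by `ξ_i` throughout»; conjunct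
(iii) of `rodgers_tao_moderatelySized_xi`) is proved the same way without the near/far split (the
`ξ`-sum is `t`-free; only (44) and the harmonic sum enter): `rodgers_tao_negligible_xi_iii`,
`rodgers_tao_negligible_xi_iii_of_neg`.

ITEM (iv) (`|j|, |k| ≥ T^{1+c}`; conjunct (iv) of `rodgers_tao_moderatelySized`) is proved by the same
near/far road over the INFINITE index set (`rodgers_tao_negligible_iv_of_location`,
`rodgers_tao_negligible_iv_of_cor33_location`): near pairs `|k| ≤ 2|j|`, `|j − k| < D log₊²(3|j|)`
by the `η`-split keeping `ψ_T(j)` (count `tsum_nearInd_le`); all other pairs are far (for `|k| > 2|j|`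
because `D log₊²(2|k|) ≤ |k|/2 ≤ |j − k|` once `|k| ≥ T` is large) and are summed row by row with
the harmonic kernel (`tsum_truncWeight_logPlus_pow_div_le`: split at `|k − j| ≤ |j|`); the majorant
on `ℤ × ℤ` is summed with Mathlib `summable_prod_of_nonneg` / `Summable.tsum_prod'`, each row being
`≤ log^{⌈C⌉} T·((2D+1)/η + 136 C₁)·ψ_T(j) log₊² j·1_{|j| ≥ T^{1+c}}`, and the gain is the `ψ_T`-tail
`Σ_{|j| ≥ T^{1+c}} ψ_T(j) log₊² j ≤ (log(2 + T log T) + 1)²·(1 + T^c/log T)^{−96}·10 T log T` (house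
copies of the private profile toolkit of `RodgersTaoTruncEnergyLemma18Proofs`: `summable_psiZq`,
`truncWeight_mul_logPlus_pow_le`), i.e. `≲ log^{2⌈C⌉+99} T · T^{1−96c} = o(T)`. The printed
one-liner's constant term here is `log^{2C+1}_+T·(Σ_{|j|≥T^{1+c}} ψ_T(j))² ≍ T^{2−198c}·polylog`, which
proves (iv) only for `c > 1/198`; the road above gives all `c > 0` (Prop. 22 uses `c = 0.1`).

The `ξ`-CLAUSE of item (iv) (conjunct (iv) of `rodgers_tao_moderatelySized_xi`) is proved by the same
row-sum / `ψ_T`-tail road without the near/far split and without the location law (only (44) enters,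
for all pairs; rows `≤ 68 C₁ log^{⌈C⌉} T·ψ_T(j) log₊² j·1_{|j| ≥ T^{1+c}}`): `rodgers_tao_negligible_xi_iv`,
`rodgers_tao_negligible_xi_iv_of_neg`.

ITEM (ii) of Lemma 21 AS PRINTED (prefactor `log₊ T`) is the cell's CONFIRMED statement-level
erratum E-d — false as stated, short by exactly one logarithm at the generic spacing — and no form of
it is typed here. Its TRUE LOG-FREE PART, `ξ`-version, is proved: `Σ_{j ≠ k ∈ ℤ*} ψ_T(j)ψ_T(k)/|ξ_j − ξ_k|
≤ 2740 C₁ T log³ T` (`T ≥ 3`), i.e. `IsModeratelySized t₀ (fun T _ p ↦ ψψ/|ξ_j − ξ_k|)` above a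
real-rooted time (`rodgers_tao_moderatelySized_xi_ii_logFree`, `…_of_neg`; (44), the row sums and the
profile sums `Σ ψ_T log₊²`, `Σ ψ_T log₊^a/|j|` of `RodgersTaoTruncEnergyLemma18Proofs`); and so is
its `x_i(t)`-version under the location law (50): `Σ_{j ≠ k} ψ_T(j)ψ_T(k)/|x_j(t) − x_k(t)| ≤ Ẽ_T(t) +
(C_i + K) T log³ T`, i.e. `IsModeratelySized t₀ (fun T t p ↦ ψψ/|x_j(t) − x_k(t)|)`
(`rodgers_tao_moderatelySized_ii_logFree_of_location`, `…_of_cor33_location`; the near/far road of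
(iv) over all pairs with `η = 1` and Lemma 21 (i), the near pairs with `|k| > 2|j|` being confined to
`|k| < T_D`, a constant; counts `tsum_nearInd_le`, `tsum_ite_abs_lt_le`).

bears_on: N-C/N-P (COLUMN 3 DBN). WHAT THIS IS NOT: weighted reciprocal-gap sums over the real zeros
of `H_t` above a real-rooted time — RH-free dynamics bookkeeping; the printed `Λ/2 ≤ t ≤ 0`
instance (conjunct (iii) of `rodgers_tao_moderatelySized`) stays VACUOUS-AS-PRINTED as a record
(`Λ ≥ 0` is a tree theorem); nothing here bears on the truth of RH.

## References

* B. Rodgers, T. Tao, Forum Math. Pi 8 (2020) e6, §7: Lemma 21 p. 47 and its proof p. 48,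
  (66)–(67) p. 42, «negligible» p. 47; Cor. 10 (50) p. 23; Lemma 8 (43)–(44) p. 21; Prop. 22 proof
  p. 50 (the use of (iii) at `c = 0.1`) (= arXiv:1801.05914v4 Lemma 7.6, v5 TeX l. 1177–1210).
-/

noncomputable section

open Set Filter Topology Asymptotics

namespace Literature.NumberTheory.LFunctions

namespace RodgersTaoNegligibleSums

/-! ## §1 Elementary inequalities -/

/-- The `AM–GM` split behind the printed «`log₊ T/|x| ≤ 1/|x|² + log²₊ T`», with a free parameter:
`1/|g| ≤ η/g² + 1/(4η)` for every real `g` and `η > 0` (junk-safe at `g = 0`).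
[cite: RodgersTaoFMP2020, Lemma 21 proof p. 48 (second display)] -/
theorem one_div_abs_le_eta (g : ℝ) {η : ℝ} (hη : 0 < η) :
    1 / |g| ≤ η * (1 / g ^ 2) + 1 / (4 * η) := by
  rcases eq_or_ne g 0 with rfl | hg
  · simp [hη.le]
  have hg' : 0 < |g| := abs_pos.2 hg
  have e : η * (1 / g ^ 2) + 1 / (4 * η) = (4 * η ^ 2 + g ^ 2) / (4 * η * g ^ 2) := by
    field_simp
  rw [e, div_le_div_iff₀ hg' (by positivity)]
  have hsq : g ^ 2 = |g| ^ 2 := (sq_abs g).symm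
  rw [hsq]
  nlinarith [sq_nonneg (|g| - 2 * η), hg', hη]

/-- `log^n T ≤ κ T^c` for all large `T` (`n : ℕ`, `c, κ > 0`): the threshold form of
`log^n = o(T^c)` (Mathlib `isLittleO_log_rpow_rpow_atTop`). [folklore] -/
private theorem exists_forall_log_pow_le (n : ℕ) {c κ : ℝ} (hc : 0 < c) (hκ : 0 < κ) :
    ∃ T₀ : ℝ, ∀ T : ℝ, T₀ ≤ T → Real.log T ^ n ≤ κ * T ^ c := by
  have h := (isLittleO_log_rpow_rpow_atTop (n : ℝ) hc).bound hκ
  obtain ⟨a, ha⟩ := Filter.eventually_atTop.1 h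
  refine ⟨max a 1, fun T hT ↦ ?_⟩
  have hT1 : 1 ≤ T := le_trans (le_max_right _ _) hT
  have h1 := ha T (le_trans (le_max_left _ _) hT)
  have hlog : 0 ≤ Real.log T := Real.log_nonneg hT1
  rw [Real.norm_of_nonneg (Real.rpow_nonneg hlog _),
    Real.norm_of_nonneg (Real.rpow_nonneg (by linarith) _), Real.rpow_natCast] at h1
  exact h1

/-- `log 3 ≥ 1`. [folklore] -/
private theorem one_le_log_three : (1 : ℝ) ≤ Real.log 3 := by
  rw [← Real.log_exp 1]
  exact Real.log_le_log (Real.exp_pos 1) (by have := Real.exp_one_lt_d9; linarith)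

/-- The harmonic bound `Σ_{n=1}^{K} 1/n ≤ 1 + log K`. [folklore] -/
private theorem sum_Icc_one_div_le_log (K : ℕ) :
    ∑ n ∈ Finset.Icc 1 K, 1 / ((n : ℕ) : ℝ) ≤ 1 + Real.log K := by
  have h := harmonic_le_one_add_log K
  rw [harmonic_eq_sum_Icc] at h
  push_cast at h
  simpa [one_div] using h

/-- **Two-sided harmonic bound on `ℤ`**: for a finite set `S` of integers `k ≠ j` with
`|k − j| ≤ N`, `Σ_{k ∈ S} 1/|j − k| ≤ 2(1 + log N)`. [folklore] -/
private theorem sum_one_div_abs_sub_le (S : Finset ℤ) (j : ℤ) (N : ℕ)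
    (hS : ∀ k ∈ S, k ≠ j ∧ |k - j| ≤ N) :
    ∑ k ∈ S, 1 / |(j : ℝ) - k| ≤ 2 * (1 + Real.log N) := by
  classical
  have hH := sum_Icc_one_div_le_log N
  -- right half
  have hR : ∑ k ∈ S.filter (fun k ↦ j < k), 1 / |(j : ℝ) - k| ≤ 1 + Real.log N := by
    set g : ℤ → ℕ := fun k ↦ (k - j).toNat with hg
    have hinj : ∀ x ∈ S.filter (fun k ↦ j < k), ∀ y ∈ S.filter (fun k ↦ j < k), g x = g y → x = y := by
      intro x hx y hy hxy
      rw [Finset.mem_filter] at hx hy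
      simp only [hg] at hxy
      have := congrArg (fun m : ℕ ↦ (m : ℤ)) hxy
      simp only [Int.toNat_of_nonneg (by omega : (0:ℤ) ≤ x - j),
        Int.toNat_of_nonneg (by omega : (0:ℤ) ≤ y - j)] at this
      omega
    have hterm : ∀ k ∈ S.filter (fun k ↦ j < k), 1 / |(j : ℝ) - k| = 1 / ((g k : ℕ) : ℝ) := by
      intro k hk
      rw [Finset.mem_filter] at hk
      have h0 : (0 : ℤ) ≤ k - j := by omega
      have e : ((g k : ℕ) : ℝ) = (k : ℝ) - j := by
        simp only [hg]
        have : ((k - j).toNat : ℤ) = k - j := Int.toNat_of_nonneg h0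
        exact_mod_cast this
      have hlt : (j : ℝ) < k := by exact_mod_cast hk.2
      rw [e, abs_sub_comm, abs_of_nonneg (by linarith)]
    rw [Finset.sum_congr rfl hterm,
      show ∑ x ∈ S.filter (fun k ↦ j < k), 1 / ((g x : ℕ) : ℝ) =
        ∑ m ∈ (S.filter (fun k ↦ j < k)).image g, 1 / ((m : ℕ) : ℝ) from
        (Finset.sum_image (f := fun m : ℕ ↦ 1 / ((m : ℕ) : ℝ)) hinj).symm]
    refine le_trans (Finset.sum_le_sum_of_subset_of_nonneg ?_ fun _ _ _ ↦ by positivity) hH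
    intro m hm
    rw [Finset.mem_image] at hm
    obtain ⟨k, hk, rfl⟩ := hm
    rw [Finset.mem_filter] at hk
    have h1 := hS k hk.1
    rw [Finset.mem_Icc]
    simp only [hg]
    have h0 : (0 : ℤ) ≤ k - j := by omega
    have e : ((k - j).toNat : ℤ) = k - j := Int.toNat_of_nonneg h0
    have h2 : |k - j| = k - j := abs_of_nonneg h0
    constructor <;> omega
  -- left half
  have hL : ∑ k ∈ S.filter (fun k ↦ ¬ j < k), 1 / |(j : ℝ) - k| ≤ 1 + Real.log N := by
    set g : ℤ → ℕ := fun k ↦ (j - k).toNat with hg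
    have hinj : ∀ x ∈ S.filter (fun k ↦ ¬ j < k), ∀ y ∈ S.filter (fun k ↦ ¬ j < k),
        g x = g y → x = y := by
      intro x hx y hy hxy
      rw [Finset.mem_filter] at hx hy
      simp only [hg] at hxy
      have := congrArg (fun m : ℕ ↦ (m : ℤ)) hxy
      simp only [Int.toNat_of_nonneg (by omega : (0:ℤ) ≤ j - x),
        Int.toNat_of_nonneg (by omega : (0:ℤ) ≤ j - y)] at this
      omega
    have hterm : ∀ k ∈ S.filter (fun k ↦ ¬ j < k), 1 / |(j : ℝ) - k| = 1 / ((g k : ℕ) : ℝ) := by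
      intro k hk
      rw [Finset.mem_filter] at hk
      have h0 : (0 : ℤ) ≤ j - k := by omega
      have e : ((g k : ℕ) : ℝ) = (j : ℝ) - k := by
        simp only [hg]
        have : ((j - k).toNat : ℤ) = j - k := Int.toNat_of_nonneg h0
        exact_mod_cast this
      have hle : (k : ℝ) ≤ j := by exact_mod_cast (not_lt.1 hk.2)
      rw [e, abs_of_nonneg (by linarith)]
    rw [Finset.sum_congr rfl hterm,
      show ∑ x ∈ S.filter (fun k ↦ ¬ j < k), 1 / ((g x : ℕ) : ℝ) =
        ∑ m ∈ (S.filter (fun k ↦ ¬ j < k)).image g, 1 / ((m : ℕ) : ℝ) from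
        (Finset.sum_image (f := fun m : ℕ ↦ 1 / ((m : ℕ) : ℝ)) hinj).symm]
    refine le_trans (Finset.sum_le_sum_of_subset_of_nonneg ?_ fun _ _ _ ↦ by positivity) hH
    intro m hm
    rw [Finset.mem_image] at hm
    obtain ⟨k, hk, rfl⟩ := hm
    rw [Finset.mem_filter] at hk
    have h1 := hS k hk.1
    rw [Finset.mem_Icc]
    simp only [hg]
    have h0 : (0 : ℤ) ≤ j - k := by omega
    have e : ((j - k).toNat : ℤ) = j - k := Int.toNat_of_nonneg h0
    have h2 : |k - j| = j - k := by rw [abs_sub_comm]; exact abs_of_nonneg h0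
    constructor <;> omega
  rw [← Finset.sum_filter_add_sum_filter_not S (fun k ↦ j < k)]
  linarith

/-- **Near count**: for `L ≥ 0`, at most `2L + 1` integers `k` satisfy `|j − k| < L`.
[folklore] -/
private theorem sum_ite_abs_sub_lt_le (I : Finset ℤ) (j : ℤ) {L : ℝ} (hL : 0 ≤ L) :
    ∑ k ∈ I, (if |(j : ℝ) - k| < L then (1 : ℝ) else 0) ≤ 2 * L + 1 := by
  classical
  rw [Finset.sum_ite, Finset.sum_const_zero, add_zero, Finset.sum_const, nsmul_eq_mul, mul_one]
  have hsub : I.filter (fun k : ℤ ↦ |(j : ℝ) - k| < L) ⊆ Finset.Ioo (j - ⌈L⌉ : ℤ) (j + ⌈L⌉ : ℤ) := by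
    intro k hk
    rw [Finset.mem_filter] at hk
    rw [Finset.mem_Ioo]
    have h1 := abs_lt.1 hk.2
    have hc : L ≤ ⌈L⌉ := Int.le_ceil L
    have h2 : (j : ℝ) - k < ⌈L⌉ := by linarith [h1.2]
    have h3 : (k : ℝ) - j < ⌈L⌉ := by linarith [h1.1]
    constructor
    · have : (j : ℝ) - ⌈L⌉ < k := by linarith
      exact_mod_cast this
    · have : (k : ℝ) < j + ⌈L⌉ := by linarith
      exact_mod_cast this
  have hcard := Finset.card_le_card hsub
  rw [Int.card_Ioo] at hcard
  have hc2 : (⌈L⌉ : ℝ) < L + 1 := Int.ceil_lt_add_one L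
  have h0 : (0 : ℤ) ≤ ⌈L⌉ := Int.ceil_nonneg hL
  have : ((I.filter (fun k : ℤ ↦ |(j : ℝ) - k| < L)).card : ℝ) ≤ ((j + ⌈L⌉ - (j - ⌈L⌉) - 1).toNat : ℝ) := by
    exact_mod_cast hcard
  refine this.trans ?_
  rcases eq_or_lt_of_le h0 with h | h
  · rw [← h]; norm_num; linarith
  · have e : ((j + ⌈L⌉ - (j - ⌈L⌉) - 1).toNat : ℤ) = 2 * ⌈L⌉ - 1 := by
      rw [Int.toNat_of_nonneg (by omega)]; ring
    have e' : (((j + ⌈L⌉ - (j - ⌈L⌉) - 1).toNat : ℕ) : ℝ) = 2 * (⌈L⌉ : ℝ) - 1 := by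
      exact_mod_cast e
    rw [e']
    linarith

/-- Bookkeeping identity for the near count (clearing the `η`-denominator). [folklore] -/
private theorem alg_one {c Ln L A ε : ℝ} (hA : A ≠ 0) (hLn : Ln ≠ 0) (hε : ε ≠ 0) :
    c * (Ln * ((2 * L + 1) / (4 * (ε / (A * Ln))))) = c * (Ln ^ 2 * (2 * L + 1)) * A / (4 * ε) := by
  field_simp

/-- Bookkeeping identity. [folklore] -/
private theorem alg_two {ε T A : ℝ} (hA : A ≠ 0) (hε : ε ≠ 0) :
    ε ^ 2 * T / A * A / (4 * ε) = ε / 4 * T := by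
  field_simp

/-- Bookkeeping identity. [folklore] -/
private theorem alg_three {N ε A D Tc : ℝ} (hA : A ≠ 0) (hD : 8 * D + 1 ≠ 0) :
    3 * N * ((ε ^ 2 / (3 * A * (8 * D + 1)) * Tc) * (8 * D + 1)) = ε ^ 2 * (N * Tc) / A := by
  field_simp

/-- Bookkeeping identity. [folklore] -/
private theorem alg_four {N ε C₁ Tc : ℝ} (hC : C₁ ≠ 0) :
    72 * C₁ * N * (ε / (288 * C₁) * Tc) = ε / 4 * (N * Tc) := by
  field_simp
  ring

/-! ## §2 Far pairs: the zero gap is comparable to the classical gap under the location law -/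

/-- **Far-pair comparison.** Under the location law (50) over `ℤ*` at time `t` with constant
`B' ≥ 0`, the comparison `log₊ ξ_j ≤ C_ξ log₊ j` (43) and the gap bound
`1/|ξ_j − ξ_k| ≤ C₁ log₊(|j|+|k|)/|j − k|` (44): if `4 B' C_ξ C₁ log₊²(|j|+|k|) ≤ |j − k|` then
`|x_j(t) − x_k(t)| ≥ |ξ_j − ξ_k|/2`, whence `1/|x_j(t) − x_k(t)| ≤ 2 C₁ log₊(|j|+|k|)/|j − k|`.
(The printed proof of Lemma 21 does not need this — it is the honest replacement of the lossy
one-line split, cf. the module docstring.) [cite: RodgersTaoFMP2020, Lemma 21 p. 47; (50) p. 23; (43)–(44) p. 21] -/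
theorem one_div_abs_sub_deBruijnZeroZ_le_of_far {t B' Cξ C₁ : ℝ} (hB' : 0 ≤ B') (hCξ : 0 ≤ Cξ)
    (hC₁ : 0 < C₁)
    (h50 : ∀ j : ℤ, j ≠ 0 →
      |deBruijnZeroZ t j - classicalLocationZ j| ≤ B' * logPlus (classicalLocationZ j))
    (hξlog : ∀ j : ℤ, logPlus (classicalLocationZ j) ≤ Cξ * logPlus j)
    (hgap : ∀ j k : ℤ, j ≠ 0 → k ≠ 0 →
      1 / |classicalLocationZ j - classicalLocationZ k| ≤
        C₁ * (logPlus (|(j : ℝ)| + |(k : ℝ)|) / |(j : ℝ) - k|))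
    {j k : ℤ} (hj : j ≠ 0) (hk : k ≠ 0) (hjk : j ≠ k)
    (hfar : 4 * B' * Cξ * C₁ * logPlus (|(j : ℝ)| + |(k : ℝ)|) ^ 2 ≤ |(j : ℝ) - k|) :
    1 / |deBruijnZeroZ t j - deBruijnZeroZ t k| ≤
      2 * C₁ * logPlus (|(j : ℝ)| + |(k : ℝ)|) / |(j : ℝ) - k| := by
  set Λ : ℝ := logPlus (|(j : ℝ)| + |(k : ℝ)|) with hΛ
  have hΛ0 : 0 < Λ := logPlus_pos _
  set δ : ℝ := classicalLocationZ j - classicalLocationZ k with hδ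
  set g : ℝ := deBruijnZeroZ t j - deBruijnZeroZ t k with hg
  have hδ0 : δ ≠ 0 := classicalLocationZ_sub_ne_zero hjk.symm
  have hδpos : 0 < |δ| := abs_pos.2 hδ0
  have hjk0 : 0 < |(j : ℝ) - k| := abs_pos.2 (sub_ne_zero.2 (by exact_mod_cast hjk))
  -- |g − δ| ≤ 2 B' C_ξ Λ
  have h1 : |g - δ| ≤ 2 * B' * Cξ * Λ := by
    have e : g - δ = (deBruijnZeroZ t j - classicalLocationZ j) -
        (deBruijnZeroZ t k - classicalLocationZ k) := by rw [hg, hδ]; ring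
    rw [e]
    refine (abs_sub _ _).trans ?_
    have hj' := (h50 j hj).trans (mul_le_mul_of_nonneg_left (hξlog j) hB')
    have hk' := (h50 k hk).trans (mul_le_mul_of_nonneg_left (hξlog k) hB')
    have hsum := logPlus_add_logPlus_le (j : ℝ) (k : ℝ)
    rw [← hΛ] at hsum
    nlinarith [mul_nonneg hB' hCξ, logPlus_nonneg (j : ℝ), logPlus_nonneg (k : ℝ)]
  -- |δ| ≥ |j − k|/(C₁ Λ) ≥ 4 B' C_ξ Λ
  have h2 : |(j : ℝ) - k| / (C₁ * Λ) ≤ |δ| := by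
    have h := hgap j k hj hk
    rw [← hδ, ← hΛ] at h
    have hb : 0 < C₁ * (Λ / |(j : ℝ) - k|) := by positivity
    have h' := (one_div_le hδpos hb).1 h
    have e : 1 / (C₁ * (Λ / |(j : ℝ) - k|)) = |(j : ℝ) - k| / (C₁ * Λ) := by
      field_simp
    rwa [e] at h'
  have h3 : 4 * B' * Cξ * Λ ≤ |δ| := by
    refine le_trans ?_ h2
    rw [le_div_iff₀ (by positivity)]
    nlinarith [hfar, hC₁, hΛ0]
  have h4 : |δ| / 2 ≤ |g| := by
    have := abs_sub_abs_le_abs_sub δ g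
    rw [abs_sub_comm δ g] at this
    linarith
  have hgpos : 0 < |g| := by linarith
  calc 1 / |g| ≤ 1 / (|δ| / 2) := one_div_le_one_div_of_le (by positivity) h4
    _ = 2 * (1 / |δ|) := by field_simp
    _ ≤ 2 * (C₁ * (Λ / |(j : ℝ) - k|)) := by
        have h := hgap j k hj hk
        rw [← hδ, ← hΛ] at h
        exact mul_le_mul_of_nonneg_left h (by norm_num)
    _ = 2 * C₁ * Λ / |(j : ℝ) - k| := by ring

end RodgersTaoNegligibleSums

open RodgersTaoNegligibleSums in
/-- **Rodgers–Tao 2020, Lemma 21 (iii) — RH-FREE CONTENT twin** (location-law form). Above a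
real-rooted time `t₁ < t₀/2`, under the location law (50) on the window `[t₀/2, 0]` (the INNER shape
of `RodgersTao2020.cor33_location`, verbatim the binder `H2` of `rodgers_tao_weak_energy_bound_block_of`),
for all `C, c > 0` the restricted sum `(log^C T) Σ_{|j|,|k| ≤ T^{1−c}, j ≠ k} ψ_T(j)ψ_T(k)/|x_j(t) − x_k(t)|`
is negligible (`IsNegligible t₀`, i.e. `o_{T→∞}(T log³ T + Ẽ_T(t))` uniformly in `t₀/2 ≤ t ≤ 0` with
`Ẽ_T(t)` finite) — conjunct (iii) of `rodgers_tao_moderatelySized t₀` BY CONTENT. Road (module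
docstring): near pairs `|j − k| < D log₊²(2T)` by `1/|x_j − x_k| ≤ η E_{jk} + 1/(4η)` and Lemma 21 (i)
(`tsum_truncWeight_interactionEnergy_le`), far pairs by the location law and (44)
(`one_div_abs_sub_deBruijnZeroZ_le_of_far`) and the harmonic sum; valid for ALL `c > 0` (the printed
one-line split gives (iii) only for `c > 1/2`).
[cite: RodgersTaoFMP2020, Lemma 21 (iii) p. 47 (= arXiv:1801.05914v4 Lemma 7.6 (iii)); proof p. 48] -/
theorem rodgers_tao_negligible_iii_of_location {t₀ B : ℝ}
    (hreal : ∃ t₁ : ℝ, t₁ < t₀ / 2 ∧ HasOnlyRealZeros (deBruijnH t₁))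
    (H2 : ∀ t ∈ Icc (t₀ / 2) 0, ∀ n : ℕ, 1 ≤ n →
      |deBruijnZero t n - classicalLocation (n : ℝ)| ≤ B * logPlus (classicalLocation (n : ℝ)))
    {C c : ℝ} (hc : 0 < c) :
    IsNegligible t₀ (fun T t p ↦
      if |(p.1.1 : ℝ)| ≤ T ^ (1 - c) ∧ |(p.1.2 : ℝ)| ≤ T ^ (1 - c) then Real.log T ^ C *
        (truncWeight T p.1.1 * truncWeight T p.1.2 / |deBruijnZeroZ t p.1.1 - deBruijnZeroZ t p.1.2|)
      else 0) := by
  classical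
  obtain ⟨t₁, ht₁, hreal₁⟩ := hreal
  obtain ⟨Ci, Ti, hCi0, hEi⟩ := tsum_truncWeight_interactionEnergy_le
  obtain ⟨Cξ, hCξ1, hCξ⟩ := exists_logPlus_classicalLocationZ_le
  obtain ⟨C₁, hC₁, hgap⟩ := exists_inv_abs_sub_classicalLocationZ_le
  have hCξ0 : 0 ≤ Cξ := by linarith only [hCξ1]
  obtain ⟨B', hB'⟩ : ∃ B' : ℝ, B' = max B 0 := ⟨_, rfl⟩
  have hB'0 : 0 ≤ B' := by rw [hB']; exact le_max_right _ _
  have hBB' : B ≤ B' := by rw [hB']; exact le_max_left _ _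
  obtain ⟨D, hD⟩ : ∃ D : ℝ, D = 4 * B' * Cξ * C₁ := ⟨_, rfl⟩
  have hD0 : 0 ≤ D := by rw [hD]; positivity
  obtain ⟨n, hn⟩ : ∃ n : ℕ, n = ⌈C⌉₊ := ⟨_, rfl⟩
  obtain ⟨A, hA⟩ : ∃ A : ℝ, A = 2 * (1 + Ci) := ⟨_, rfl⟩
  have hA0 : 0 < A := by rw [hA]; positivity
  intro ε hε
  obtain ⟨Ta, hTa⟩ := exists_forall_log_pow_le (2 * n + 2) hc
    (show 0 < ε ^ 2 / (3 * A * (8 * D + 1)) by positivity)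
  obtain ⟨Tb, hTb⟩ := exists_forall_log_pow_le (n + 2) hc
    (show 0 < ε / (288 * C₁) by positivity)
  refine ⟨max (max 3 Ti) (max Ta Tb), fun T hT t ht1 ht2 hs ↦ ?_⟩
  have hT3 : 3 ≤ T := le_trans (le_max_left _ _) (le_trans (le_max_left _ _) hT)
  have hTi : Ti ≤ T := le_trans (le_max_right _ _) (le_trans (le_max_left _ _) hT)
  have hTa' : Ta ≤ T := le_trans (le_max_left _ _) (le_trans (le_max_right _ _) hT)
  have hTb' : Tb ≤ T := le_trans (le_max_right _ _) (le_trans (le_max_right _ _) hT)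
  have hT0 : 0 < T := by linarith only [hT3]
  have hlog1 : 1 ≤ Real.log T := one_le_log_three.trans (Real.log_le_log (by norm_num) hT3)
  have hlog0 : 0 < Real.log T := by linarith only [hlog1]
  have hTlog : 0 < T * Real.log T := mul_pos hT0 hlog0
  have hΛt : ∃ t₁' : ℝ, t₁' < t ∧ HasOnlyRealZeros (deBruijnH t₁') :=
    ⟨t₁, by linarith only [ht₁, ht1], hreal₁⟩
  have hmono := strictMono_deBruijnZeroZ hΛt
  have hE0 : 0 ≤ truncEnergy T t := truncEnergy_nonneg hTlog hmono
  set X : ℝ := T * Real.log T ^ 3 + truncEnergy T t with hX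
  have hTX : T ≤ X := by
    have : T * 1 ≤ T * Real.log T ^ 3 := mul_le_mul_of_nonneg_left (one_le_pow₀ hlog1) hT0.le
    linarith only [this, hE0, hX]
  have hX0 : 0 ≤ X := by linarith only [hTX, hT0]
  set N : ℝ := T ^ (1 - c) with hN
  have hN0 : 0 ≤ N := Real.rpow_nonneg hT0.le _
  have hNT : N ≤ T := by
    rw [hN]
    conv_rhs => rw [← Real.rpow_one T]
    exact Real.rpow_le_rpow_of_exponent_le (by linarith only [hT3]) (by linarith only [hc])
  have hNTc : N * T ^ c = T := by
    rw [hN, ← Real.rpow_add hT0]; norm_num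
  set Lc : ℝ := Real.log T ^ C with hLc
  obtain ⟨Ln, hLn⟩ : ∃ Ln : ℝ, Ln = Real.log T ^ n := ⟨_, rfl⟩
  have hLc0 : 0 ≤ Lc := Real.rpow_nonneg hlog0.le _
  have hLcLn : Lc ≤ Ln := by
    rw [hLc, hLn, ← Real.rpow_natCast, hn]
    exact Real.rpow_le_rpow_of_exponent_le hlog1 (Nat.le_ceil C)
  have hLn1 : 1 ≤ Ln := by rw [hLn]; exact one_le_pow₀ hlog1
  have hLn0 : 0 < Ln := by linarith only [hLn1]
  set F : zstarOffDiag → ℝ := fun p ↦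
    if |(p.1.1 : ℝ)| ≤ N ∧ |(p.1.2 : ℝ)| ≤ N then Lc *
      (truncWeight T p.1.1 * truncWeight T p.1.2 / |deBruijnZeroZ t p.1.1 - deBruijnZeroZ t p.1.2|)
    else 0 with hF
  show Summable F ∧ |∑' p, F p| ≤ ε * X
  have hψ0 : ∀ j : ℤ, 0 ≤ truncWeight T j := fun j ↦ (truncWeight_pos hTlog j).le
  have hψ1 : ∀ j : ℤ, truncWeight T j ≤ 1 := fun j ↦ truncWeight_le_one hTlog j
  have hF0 : ∀ p, 0 ≤ F p := fun p ↦ by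
    simp only [hF]
    split_ifs
    · exact mul_nonneg hLc0 (div_nonneg (mul_nonneg (hψ0 _) (hψ0 _)) (abs_nonneg _))
    · exact le_rfl
  -- trivial case `N < 1`: the restricted sum is empty
  rcases lt_or_ge N 1 with hN1 | hN1
  · have hFz : ∀ p, F p = 0 := fun p ↦ by
      simp only [hF]
      rw [if_neg]
      intro h
      have hj : (1 : ℝ) ≤ |(p.1.1 : ℝ)| := by
        have := Int.one_le_abs (mem_zstarOffDiag.1 p.2).1
        rw [← Int.cast_abs]; exact_mod_cast this
      linarith only [h.1, hj, hN1]
    refine ⟨summable_zero.congr fun p ↦ (hFz p).symm, ?_⟩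
    rw [tsum_congr hFz, tsum_zero, abs_zero]
    positivity
  -- main case `1 ≤ N`
  have h50Z : ∀ j : ℤ, j ≠ 0 →
      |deBruijnZeroZ t j - classicalLocationZ j| ≤ B' * logPlus (classicalLocationZ j) := by
    refine fun j hj ↦ location_zstar_of_nat (fun m hm ↦ ?_) hj
    exact (H2 t ⟨ht1, ht2⟩ m hm).trans
      (mul_le_mul_of_nonneg_right hBB' (logPlus_nonneg _))
  obtain ⟨η, hη⟩ : ∃ η : ℝ, η = ε / (A * Ln) := ⟨_, rfl⟩
  have hη0 : 0 < η := by rw [hη]; positivity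
  have hLnη : Ln * η = ε / A := by
    rw [hη, mul_div_assoc', mul_comm A Ln, mul_div_mul_left _ _ hLn0.ne']
  obtain ⟨ℓ, hℓ⟩ : ∃ ℓ : ℝ, ℓ = logPlus (2 * T) := ⟨_, rfl⟩
  have hℓ0 : 0 < ℓ := by rw [hℓ]; exact logPlus_pos _
  have hℓle : ℓ ≤ 2 * Real.log T := by
    rw [hℓ, logPlus_eq, abs_of_nonneg (by linarith only [hT0]), ← Real.log_rpow hT0, Real.rpow_two]
    exact Real.log_le_log (by linarith only [hT0]) (by nlinarith only [hT3])
  obtain ⟨L, hL⟩ : ∃ L : ℝ, L = D * ℓ ^ 2 := ⟨_, rfl⟩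
  have hL0 : 0 ≤ L := by rw [hL]; positivity
  have hLle : 2 * L + 1 ≤ (8 * D + 1) * Real.log T ^ 2 := by
    have h1 : ℓ ^ 2 ≤ (2 * Real.log T) ^ 2 := pow_le_pow_left₀ hℓ0.le hℓle 2
    have h2 : (1 : ℝ) ≤ Real.log T ^ 2 := one_le_pow₀ hlog1
    nlinarith only [hL, mul_le_mul_of_nonneg_left h1 hD0, h2, hD0]
  obtain ⟨Nz, hNz⟩ : ∃ Nz : ℕ, Nz = ⌊N⌋₊ := ⟨_, rfl⟩
  have hNz1 : 1 ≤ Nz := by rw [hNz]; exact Nat.le_floor (by exact_mod_cast hN1)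
  have hNzN : (Nz : ℝ) ≤ N := by rw [hNz]; exact Nat.floor_le hN0
  obtain ⟨I, hI⟩ : ∃ I : Finset ℤ, I = Finset.Icc (-(Nz : ℤ)) Nz := ⟨_, rfl⟩
  have hmemI : ∀ j : ℤ, |(j : ℝ)| ≤ N → j ∈ I := by
    intro j hj
    have h1 : ((j.natAbs : ℕ) : ℝ) ≤ N := by rw [Nat.cast_natAbs]; exact_mod_cast hj
    have h2 : j.natAbs ≤ Nz := by rw [hNz]; exact Nat.le_floor h1
    rw [hI, Finset.mem_Icc]
    omega
  have hIabs : ∀ k ∈ I, |k| ≤ (Nz : ℤ) := by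
    intro k hk
    rw [hI, Finset.mem_Icc] at hk
    exact abs_le.2 ⟨hk.1, hk.2⟩
  have hcardI : (I.card : ℝ) ≤ 3 * N := by
    have : I.card = 2 * Nz + 1 := by
      rw [hI, Int.card_Icc]; omega
    rw [this]; push_cast; linarith only [hNzN, hN1]
  -- the two majorants
  obtain ⟨hWs, hWle⟩ := hEi T hTi t hs
  obtain ⟨r, hr⟩ : ∃ r : ℤ × ℤ → ℝ, r = fun q ↦ if q.1 ∈ I ∧ q.2 ∈ I then
      Ln * ((if |(q.1 : ℝ) - q.2| < L then (1 : ℝ) else 0) / (4 * η) +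
        2 * C₁ * ℓ / |(q.1 : ℝ) - q.2|) else 0 := ⟨_, rfl⟩
  have hr0 : ∀ q, 0 ≤ r q := fun q ↦ by
    rw [hr]; dsimp only
    split_ifs <;> positivity
  have hrsupp : ∀ q ∉ I ×ˢ I, r q = 0 := fun q hq ↦ by
    rw [hr]; dsimp only
    rw [if_neg]
    rwa [Finset.mem_product] at hq
  have hrS : Summable r := summable_of_ne_finset_zero hrsupp
  -- pointwise comparison
  have hpt : ∀ p : zstarOffDiag, F p ≤
      Ln * η * (truncWeight T p.1.1 * truncWeight T p.1.2 * interactionEnergy t p.1.1 p.1.2) +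
        r p.1 := by
    intro p
    obtain ⟨hj, hk, hjk⟩ := mem_zstarOffDiag.1 p.2
    have hW0 : 0 ≤ Ln * η *
        (truncWeight T p.1.1 * truncWeight T p.1.2 * interactionEnergy t p.1.1 p.1.2) :=
      mul_nonneg (by positivity) (mul_nonneg (mul_nonneg (hψ0 _) (hψ0 _)) (interactionEnergy_nonneg _ _ _))
    simp only [hF]
    split_ifs with hbox
    · have hjI : p.1.1 ∈ I := hmemI _ hbox.1
      have hkI : p.1.2 ∈ I := hmemI _ hbox.2
      have hrp : r p.1 = Ln * ((if |(p.1.1 : ℝ) - p.1.2| < L then (1 : ℝ) else 0) / (4 * η) +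
          2 * C₁ * ℓ / |(p.1.1 : ℝ) - p.1.2|) := by
        rw [hr]; dsimp only; rw [if_pos (And.intro hjI hkI)]
      rw [hrp]
      obtain ⟨g, hg⟩ : ∃ g : ℝ, g = deBruijnZeroZ t p.1.1 - deBruijnZeroZ t p.1.2 := ⟨_, rfl⟩
      rw [← hg]
      have hψψ1 : truncWeight T p.1.1 * truncWeight T p.1.2 ≤ 1 := by
        calc truncWeight T p.1.1 * truncWeight T p.1.2 ≤ 1 * 1 :=
              mul_le_mul (hψ1 _) (hψ1 _) (hψ0 _) zero_le_one
          _ = 1 := by ring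
      have hψψ0 : 0 ≤ truncWeight T p.1.1 * truncWeight T p.1.2 := mul_nonneg (hψ0 _) (hψ0 _)
      have hEg : interactionEnergy t p.1.1 p.1.2 = 1 / g ^ 2 := by rw [interactionEnergy_eq, hg]
      by_cases hnear : |(p.1.1 : ℝ) - p.1.2| < L
      · -- near pair: the `η`-split
        rw [if_pos hnear]
        have h1 := one_div_abs_le_eta g hη0
        have h2 : truncWeight T p.1.1 * truncWeight T p.1.2 / |g| ≤
            η * (truncWeight T p.1.1 * truncWeight T p.1.2 * (1 / g ^ 2)) + 1 / (4 * η) := by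
          calc truncWeight T p.1.1 * truncWeight T p.1.2 / |g|
              = (truncWeight T p.1.1 * truncWeight T p.1.2) * (1 / |g|) := by ring
            _ ≤ (truncWeight T p.1.1 * truncWeight T p.1.2) * (η * (1 / g ^ 2) + 1 / (4 * η)) :=
                mul_le_mul_of_nonneg_left h1 hψψ0
            _ = η * (truncWeight T p.1.1 * truncWeight T p.1.2 * (1 / g ^ 2)) +
                  (truncWeight T p.1.1 * truncWeight T p.1.2) * (1 / (4 * η)) := by ring
            _ ≤ _ := by
                have : (truncWeight T p.1.1 * truncWeight T p.1.2) * (1 / (4 * η)) ≤ 1 * (1 / (4 * η)) :=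
                  mul_le_mul_of_nonneg_right hψψ1 (by positivity)
                linarith only [this]
        have h3 : (0 : ℝ) ≤ 2 * C₁ * ℓ / |(p.1.1 : ℝ) - p.1.2| := by positivity
        rw [hEg]
        calc Lc * (truncWeight T p.1.1 * truncWeight T p.1.2 / |g|)
            ≤ Ln * (truncWeight T p.1.1 * truncWeight T p.1.2 / |g|) :=
              mul_le_mul_of_nonneg_right hLcLn (div_nonneg hψψ0 (abs_nonneg _))
          _ ≤ Ln * (η * (truncWeight T p.1.1 * truncWeight T p.1.2 * (1 / g ^ 2)) + 1 / (4 * η)) :=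
              mul_le_mul_of_nonneg_left h2 hLn0.le
          _ ≤ _ := by
              have e : Ln * (η * (truncWeight T p.1.1 * truncWeight T p.1.2 * (1 / g ^ 2)) + 1 / (4 * η))
                  = Ln * η * (truncWeight T p.1.1 * truncWeight T p.1.2 * (1 / g ^ 2)) +
                    Ln * ((1 : ℝ) / (4 * η) + 0) := by ring
              rw [e]
              have : Ln * ((1 : ℝ) / (4 * η) + 0) ≤ Ln * ((1 : ℝ) / (4 * η) + 2 * C₁ * ℓ / |(p.1.1 : ℝ) - p.1.2|) :=
                mul_le_mul_of_nonneg_left (by linarith only [h3]) hLn0.le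
              linarith only [this]
      · -- far pair: comparison with the classical gap
        rw [if_neg hnear]
        have hfar' : L ≤ |(p.1.1 : ℝ) - p.1.2| := not_lt.1 hnear
        have hΛℓ : logPlus (|(p.1.1 : ℝ)| + |(p.1.2 : ℝ)|) ≤ ℓ := by
          rw [hℓ]
          refine logPlus_mono ?_
          rw [abs_of_nonneg (by positivity : (0 : ℝ) ≤ |(p.1.1 : ℝ)| + |(p.1.2 : ℝ)|),
            abs_of_nonneg (by linarith only [hT0] : (0 : ℝ) ≤ 2 * T)]
          linarith only [hbox.1, hbox.2, hNT]
        have hfar : 4 * B' * Cξ * C₁ * logPlus (|(p.1.1 : ℝ)| + |(p.1.2 : ℝ)|) ^ 2 ≤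
            |(p.1.1 : ℝ) - p.1.2| := by
          refine le_trans ?_ hfar'
          rw [← hD, hL]
          exact mul_le_mul_of_nonneg_left (pow_le_pow_left₀ (logPlus_nonneg _) hΛℓ 2) hD0
        have h1 := one_div_abs_sub_deBruijnZeroZ_le_of_far hB'0 hCξ0 hC₁ h50Z hCξ hgap hj hk hjk hfar
        have h2 : 1 / |g| ≤ 2 * C₁ * ℓ / |(p.1.1 : ℝ) - p.1.2| := by
          rw [hg]
          refine h1.trans ?_
          exact div_le_div_of_nonneg_right (mul_le_mul_of_nonneg_left hΛℓ (by positivity)) (abs_nonneg _)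
        calc Lc * (truncWeight T p.1.1 * truncWeight T p.1.2 / |g|)
            ≤ Ln * (1 * (1 / |g|)) := by
              refine mul_le_mul hLcLn ?_ (div_nonneg hψψ0 (abs_nonneg _)) hLn0.le
              rw [div_eq_mul_one_div]
              exact mul_le_mul_of_nonneg_right hψψ1 (by positivity)
          _ ≤ Ln * (0 / (4 * η) + 2 * C₁ * ℓ / |(p.1.1 : ℝ) - p.1.2|) := by
              refine mul_le_mul_of_nonneg_left ?_ hLn0.le
              rw [zero_div, zero_add, one_mul]; exact h2
          _ ≤ _ := by linarith only [hW0]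
    · exact add_nonneg hW0 (hr0 _)
  -- summability and the `tsum` bound
  have hrS' : Summable (fun p : zstarOffDiag ↦ r p.1) := hrS.subtype _
  have hmajS : Summable (fun p : zstarOffDiag ↦
      Ln * η * (truncWeight T p.1.1 * truncWeight T p.1.2 * interactionEnergy t p.1.1 p.1.2) + r p.1) :=
    (hWs.mul_left (Ln * η)).add hrS'
  have hFS : Summable F := hmajS.of_nonneg_of_le hF0 hpt
  refine ⟨hFS, ?_⟩
  rw [abs_of_nonneg (tsum_nonneg hF0)]
  have h1 : ∑' p, F p ≤ Ln * η * ∑' p : zstarOffDiag,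
      (truncWeight T p.1.1 * truncWeight T p.1.2 * interactionEnergy t p.1.1 p.1.2) +
        ∑' p : zstarOffDiag, r p.1 := by
    have hW2 : Summable (fun p : zstarOffDiag ↦ Ln * η *
        (truncWeight T p.1.1 * truncWeight T p.1.2 * interactionEnergy t p.1.1 p.1.2)) :=
      hWs.mul_left (Ln * η)
    have e1 := hW2.tsum_add hrS'
    have e2 : ∑' p : zstarOffDiag, Ln * η *
        (truncWeight T p.1.1 * truncWeight T p.1.2 * interactionEnergy t p.1.1 p.1.2) =
        Ln * η * ∑' p : zstarOffDiag,
          (truncWeight T p.1.1 * truncWeight T p.1.2 * interactionEnergy t p.1.1 p.1.2) :=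
      tsum_mul_left
    have e3 := hFS.tsum_le_tsum hpt hmajS
    linarith only [e1, e2, e3]
  have h2 : ∑' p : zstarOffDiag, r p.1 ≤ ∑ q ∈ I ×ˢ I, r q := by
    calc ∑' p : zstarOffDiag, r p.1 ≤ ∑' q, r q := Summable.tsum_subtype_le r zstarOffDiag hr0 hrS
      _ = ∑ q ∈ I ×ˢ I, r q := tsum_eq_sum hrsupp
  obtain ⟨M, hM⟩ : ∃ M : ℝ,
      M = (2 * L + 1) / (4 * η) + 2 * C₁ * ℓ * (2 * (1 + Real.log ((2 * Nz : ℕ) : ℝ))) := ⟨_, rfl⟩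
  have hrjk : ∀ j ∈ I, ∀ k ∈ I, r (j, k) =
      (Ln / (4 * η)) * (if |(j : ℝ) - k| < L then (1 : ℝ) else 0) +
        (Ln * (2 * C₁ * ℓ)) * (1 / |(j : ℝ) - k|) := by
    intro j hj k hk
    rw [hr]; dsimp only; rw [if_pos ⟨hj, hk⟩]
    ring
  have h3 : ∑ q ∈ I ×ˢ I, r q ≤ I.card * (Ln * M) := by
    rw [Finset.sum_product]
    have hinner : ∀ j ∈ I, ∑ k ∈ I, r (j, k) ≤ Ln * M := by
      intro j hj
      have e : ∑ k ∈ I, r (j, k) =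
          (Ln / (4 * η)) * ∑ k ∈ I, (if |(j : ℝ) - k| < L then (1 : ℝ) else 0) +
            (Ln * (2 * C₁ * ℓ)) * ∑ k ∈ I, 1 / |(j : ℝ) - k| := by
        rw [Finset.sum_congr rfl (fun k hk ↦ hrjk j hj k hk), Finset.sum_add_distrib,
          Finset.mul_sum, Finset.mul_sum]
      rw [e]
      have ha := sum_ite_abs_sub_lt_le I j hL0
      have hb : ∑ k ∈ I, 1 / |(j : ℝ) - k| ≤ 2 * (1 + Real.log ((2 * Nz : ℕ) : ℝ)) := by
        rw [← Finset.add_sum_erase I (fun k ↦ 1 / |(j : ℝ) - k|) hj]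
        simp only [sub_self, abs_zero, div_zero, zero_add]
        refine sum_one_div_abs_sub_le (I.erase j) j (2 * Nz) fun k hk ↦ ?_
        rw [Finset.mem_erase] at hk
        refine ⟨hk.1, ?_⟩
        have h1 := hIabs k hk.2
        have h2 := hIabs j hj
        calc |k - j| ≤ |k| + |j| := abs_sub k j
          _ ≤ (Nz : ℤ) + Nz := add_le_add h1 h2
          _ = ((2 * Nz : ℕ) : ℤ) := by push_cast; ring
      calc (Ln / (4 * η)) * ∑ k ∈ I, (if |(j : ℝ) - k| < L then (1 : ℝ) else 0) +
            (Ln * (2 * C₁ * ℓ)) * ∑ k ∈ I, 1 / |(j : ℝ) - k|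
          ≤ (Ln / (4 * η)) * (2 * L + 1) +
            (Ln * (2 * C₁ * ℓ)) * (2 * (1 + Real.log ((2 * Nz : ℕ) : ℝ))) :=
            add_le_add (mul_le_mul_of_nonneg_left ha (by positivity))
              (mul_le_mul_of_nonneg_left hb (by positivity))
        _ = Ln * M := by rw [hM]; ring
    have h := Finset.sum_le_card_nsmul I (fun j ↦ ∑ k ∈ I, r (j, k)) (Ln * M) hinner
    rwa [nsmul_eq_mul] at h
  -- the three numerical estimates
  have hTL0 : 0 ≤ T * Real.log T ^ 3 := by positivity
  have hb1 : Ln * η * ∑' p : zstarOffDiag,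
      (truncWeight T p.1.1 * truncWeight T p.1.2 * interactionEnergy t p.1.1 p.1.2) ≤ ε / 2 * X := by
    rw [hLnη]
    have key : (truncEnergy T t + Ci * (T * Real.log T ^ 3)) / A ≤ X / 2 := by
      rw [div_le_div_iff₀ hA0 two_pos, hA, hX]
      nlinarith only [hCi0, hE0, hTL0]
    calc ε / A * ∑' p : zstarOffDiag,
          (truncWeight T p.1.1 * truncWeight T p.1.2 * interactionEnergy t p.1.1 p.1.2)
        ≤ ε / A * (truncEnergy T t + Ci * (T * Real.log T ^ 3)) :=
          mul_le_mul_of_nonneg_left hWle (by positivity)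
      _ = ε * ((truncEnergy T t + Ci * (T * Real.log T ^ 3)) / A) := by ring
      _ ≤ ε * (X / 2) := mul_le_mul_of_nonneg_left key hε.le
      _ = ε / 2 * X := by ring
  have hlogNz : Real.log ((2 * Nz : ℕ) : ℝ) ≤ 2 * Real.log T := by
    have h1 : ((2 * Nz : ℕ) : ℝ) ≤ 2 * T := by push_cast; linarith only [hNzN, hNT]
    have h2 : (0 : ℝ) < ((2 * Nz : ℕ) : ℝ) := by positivity
    calc Real.log ((2 * Nz : ℕ) : ℝ) ≤ Real.log (2 * T) := Real.log_le_log h2 h1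
      _ ≤ Real.log (T ^ 2) := Real.log_le_log (by positivity) (by nlinarith only [hT3])
      _ = 2 * Real.log T := by rw [Real.log_pow]; ring
  have hb2 : (I.card : ℝ) * (Ln * ((2 * L + 1) / (4 * η))) ≤ ε / 4 * X := by
    have e : (I.card : ℝ) * (Ln * ((2 * L + 1) / (4 * η))) = I.card * (Ln ^ 2 * (2 * L + 1)) * A / (4 * ε) := by
      rw [hη]; exact alg_one hA0.ne' hLn0.ne' hε.ne'
    rw [e]
    have h1 : (I.card : ℝ) * (Ln ^ 2 * (2 * L + 1)) ≤ 3 * N * (Real.log T ^ (2 * n + 2) * (8 * D + 1)) := by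
      refine mul_le_mul hcardI ?_ (by positivity) (by positivity)
      calc Ln ^ 2 * (2 * L + 1) ≤ Ln ^ 2 * ((8 * D + 1) * Real.log T ^ 2) :=
            mul_le_mul_of_nonneg_left hLle (by positivity)
        _ = Real.log T ^ (2 * n + 2) * (8 * D + 1) := by rw [hLn]; ring
    have h2 := hTa T hTa'
    have h3 : 3 * N * (Real.log T ^ (2 * n + 2) * (8 * D + 1)) ≤
        3 * N * ((ε ^ 2 / (3 * A * (8 * D + 1)) * T ^ c) * (8 * D + 1)) :=
      mul_le_mul_of_nonneg_left (mul_le_mul_of_nonneg_right h2 (by positivity)) (by positivity)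
    have h4 : 3 * N * ((ε ^ 2 / (3 * A * (8 * D + 1)) * T ^ c) * (8 * D + 1)) =
        ε ^ 2 * (N * T ^ c) / A := alg_three hA0.ne' (by positivity)
    rw [hNTc] at h4
    calc (I.card : ℝ) * (Ln ^ 2 * (2 * L + 1)) * A / (4 * ε)
        ≤ (ε ^ 2 * T / A) * A / (4 * ε) := by
          refine div_le_div_of_nonneg_right (mul_le_mul_of_nonneg_right (h1.trans (h3.trans h4.le)) hA0.le) (by positivity)
      _ = ε / 4 * T := alg_two hA0.ne' hε.ne'
      _ ≤ ε / 4 * X := mul_le_mul_of_nonneg_left hTX (by positivity)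
  have hb3 : (I.card : ℝ) * (Ln * (2 * C₁ * ℓ * (2 * (1 + Real.log ((2 * Nz : ℕ) : ℝ))))) ≤ ε / 4 * X := by
    have h1 : 2 * (1 + Real.log ((2 * Nz : ℕ) : ℝ)) ≤ 6 * Real.log T := by linarith only [hlogNz, hlog1]
    have h2 : (I.card : ℝ) * (Ln * (2 * C₁ * ℓ * (2 * (1 + Real.log ((2 * Nz : ℕ) : ℝ))))) ≤
        3 * N * (Ln * (2 * C₁ * (2 * Real.log T) * (6 * Real.log T))) := by
      refine mul_le_mul hcardI ?_ (by positivity) (by positivity)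
      refine mul_le_mul_of_nonneg_left ?_ hLn0.le
      exact mul_le_mul (mul_le_mul_of_nonneg_left hℓle (by positivity)) h1 (by positivity) (by positivity)
    have h3 : 3 * N * (Ln * (2 * C₁ * (2 * Real.log T) * (6 * Real.log T))) =
        72 * C₁ * N * Real.log T ^ (n + 2) := by rw [hLn]; ring
    have h4 := hTb T hTb'
    have h5 : 72 * C₁ * N * Real.log T ^ (n + 2) ≤ 72 * C₁ * N * (ε / (288 * C₁) * T ^ c) :=
      mul_le_mul_of_nonneg_left h4 (by positivity)
    have h6 : 72 * C₁ * N * (ε / (288 * C₁) * T ^ c) = ε / 4 * (N * T ^ c) := alg_four hC₁.ne'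
    rw [hNTc] at h6
    calc _ ≤ 72 * C₁ * N * Real.log T ^ (n + 2) := h2.trans h3.le
      _ ≤ ε / 4 * T := h5.trans h6.le
      _ ≤ ε / 4 * X := mul_le_mul_of_nonneg_left hTX (by positivity)
  have h4 : (I.card : ℝ) * (Ln * M) = (I.card : ℝ) * (Ln * ((2 * L + 1) / (4 * η))) +
      (I.card : ℝ) * (Ln * (2 * C₁ * ℓ * (2 * (1 + Real.log ((2 * Nz : ℕ) : ℝ))))) := by
    rw [hM]; ring
  linarith only [h1, h2, h3, h4, hb1, hb2, hb3]

/-- **Rodgers–Tao 2020, Lemma 21 (iii), printed witness form — CONTENT proof from the as-printed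
location law.** `RodgersTao2020.cor33_location` (Cor. 10 (50), itself CONTENT-proved in the tree as
`RodgersTao2020.cor33_location_content`) implies conjunct (iii) of `rodgers_tao_moderatelySized t₀`
for every `t₀ < 0` with `H_{t₀}` real-rooted (the tree's witness rendering of `Λ ≤ t₀ < 0`; the window
`[t₀/2, 0]` lies above the real-rooted time `t₀` itself). The ex-falso record
`rodgers_tao_moderatelySized_holds` is untouched.
[cite: RodgersTaoFMP2020, Lemma 21 (iii) p. 47 (= arXiv:1801.05914v4 Lemma 7.6 (iii)); Cor. 10 (50) p. 23] -/
theorem rodgers_tao_negligible_iii_of_cor33_location (h50 : RodgersTao2020.cor33_location) :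
    ∀ t₀ : ℝ, t₀ < 0 → HasOnlyRealZeros (deBruijnH t₀) → ∀ C c : ℝ, 0 < C → 0 < c →
      IsNegligible t₀ (fun T t p ↦
        if |(p.1.1 : ℝ)| ≤ T ^ (1 - c) ∧ |(p.1.2 : ℝ)| ≤ T ^ (1 - c) then Real.log T ^ C *
          (truncWeight T p.1.1 * truncWeight T p.1.2 /
            |deBruijnZeroZ t p.1.1 - deBruijnZeroZ t p.1.2|)
        else 0) := by
  intro t₀ ht₀ hreal C c _ hc
  obtain ⟨A50, hA50⟩ := h50
  have H2 : ∀ t ∈ Icc (t₀ / 2) 0, ∀ n : ℕ, 1 ≤ n →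
      |deBruijnZero t n - classicalLocation (n : ℝ)| ≤ A50 * logPlus (classicalLocation (n : ℝ)) :=
    fun t ht n hn ↦ hA50 t ⟨t₀, by linarith [ht.1], hreal⟩ ht.2 n hn
  exact rodgers_tao_negligible_iii_of_location ⟨t₀, by linarith, hreal⟩ H2 (C := C) hc

/-! ## Lemma 21 (iii), the `ξ`-clause («similarly if the `x_i(t)` are replaced by `ξ_i` throughout») -/

open RodgersTaoNegligibleSums in
/-- **Rodgers–Tao 2020, Lemma 21 (iii) with `ξ_i` in place of `x_i(t)` — RH-FREE CONTENT twin.**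
For every `t₀` whose window `[t₀/2, 0]` lies above a real-rooted time `t₁ < t₀/2` (only used to make
`T log³ T + Ẽ_T(t)` a legitimate majorant, `Ẽ_T(t) ≥ 0`) and all `C`, `c > 0`, the restricted sum
`(log^C T) Σ_{|j|,|k| ≤ T^{1−c}, j ≠ k} ψ_T(j)ψ_T(k)/|ξ_j − ξ_k|` is negligible (`IsNegligible t₀`) —
conjunct (iii) of `rodgers_tao_moderatelySized_xi t₀` BY CONTENT. The `ξ`-sum does not depend on
`t`; road: the gap bound (44) `1/|ξ_j − ξ_k| ≤ C₁ log₊(|j|+|k|)/|j − k|`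
(`exists_inv_abs_sub_classicalLocationZ_le`) and the two-sided harmonic sum over the box, giving
`≤ 36 C₁ T^{1−c} log^{⌈C⌉+2} T = o(T)`; valid for ALL `c > 0` (the printed one-liner again only
covers `c > 1/2`). [cite: RodgersTaoFMP2020, Lemma 21 (iii) p. 47 («similarly if the x_i are replaced by ξ_i»)] -/
theorem rodgers_tao_negligible_xi_iii {t₀ : ℝ}
    (hreal : ∃ t₁ : ℝ, t₁ < t₀ / 2 ∧ HasOnlyRealZeros (deBruijnH t₁)) {C c : ℝ} (hc : 0 < c) :
    IsNegligible t₀ (fun T _ p ↦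
      if |(p.1.1 : ℝ)| ≤ T ^ (1 - c) ∧ |(p.1.2 : ℝ)| ≤ T ^ (1 - c) then Real.log T ^ C *
        (truncWeight T p.1.1 * truncWeight T p.1.2 /
          |classicalLocationZ p.1.1 - classicalLocationZ p.1.2|)
      else 0) := by
  classical
  obtain ⟨t₁, ht₁, hreal₁⟩ := hreal
  obtain ⟨C₁, hC₁, hgap⟩ := exists_inv_abs_sub_classicalLocationZ_le
  obtain ⟨n, hn⟩ : ∃ n : ℕ, n = ⌈C⌉₊ := ⟨_, rfl⟩
  intro ε hε
  obtain ⟨Tb, hTb⟩ := exists_forall_log_pow_le (n + 2) hc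
    (show 0 < ε / (288 * C₁) by positivity)
  refine ⟨max 3 Tb, fun T hT t ht1 _ _ ↦ ?_⟩
  have hT3 : 3 ≤ T := le_trans (le_max_left _ _) hT
  have hTb' : Tb ≤ T := le_trans (le_max_right _ _) hT
  have hT0 : 0 < T := by linarith only [hT3]
  have hlog1 : 1 ≤ Real.log T := one_le_log_three.trans (Real.log_le_log (by norm_num) hT3)
  have hlog0 : 0 < Real.log T := by linarith only [hlog1]
  have hTlog : 0 < T * Real.log T := mul_pos hT0 hlog0
  have hΛt : ∃ t₁' : ℝ, t₁' < t ∧ HasOnlyRealZeros (deBruijnH t₁') :=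
    ⟨t₁, by linarith only [ht₁, ht1], hreal₁⟩
  have hmono := strictMono_deBruijnZeroZ hΛt
  have hE0 : 0 ≤ truncEnergy T t := truncEnergy_nonneg hTlog hmono
  set X : ℝ := T * Real.log T ^ 3 + truncEnergy T t with hX
  have hTX : T ≤ X := by
    have : T * 1 ≤ T * Real.log T ^ 3 := mul_le_mul_of_nonneg_left (one_le_pow₀ hlog1) hT0.le
    linarith only [this, hE0, hX]
  have hX0 : 0 ≤ X := by linarith only [hTX, hT0]
  set N : ℝ := T ^ (1 - c) with hN
  have hN0 : 0 ≤ N := Real.rpow_nonneg hT0.le _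
  have hNT : N ≤ T := by
    rw [hN]
    conv_rhs => rw [← Real.rpow_one T]
    exact Real.rpow_le_rpow_of_exponent_le (by linarith only [hT3]) (by linarith only [hc])
  have hNTc : N * T ^ c = T := by
    rw [hN, ← Real.rpow_add hT0]; norm_num
  set Lc : ℝ := Real.log T ^ C with hLc
  obtain ⟨Ln, hLn⟩ : ∃ Ln : ℝ, Ln = Real.log T ^ n := ⟨_, rfl⟩
  have hLc0 : 0 ≤ Lc := Real.rpow_nonneg hlog0.le _
  have hLcLn : Lc ≤ Ln := by
    rw [hLc, hLn, ← Real.rpow_natCast, hn]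
    exact Real.rpow_le_rpow_of_exponent_le hlog1 (Nat.le_ceil C)
  have hLn1 : 1 ≤ Ln := by rw [hLn]; exact one_le_pow₀ hlog1
  have hLn0 : 0 < Ln := by linarith only [hLn1]
  set F : zstarOffDiag → ℝ := fun p ↦
    if |(p.1.1 : ℝ)| ≤ N ∧ |(p.1.2 : ℝ)| ≤ N then Lc *
      (truncWeight T p.1.1 * truncWeight T p.1.2 /
        |classicalLocationZ p.1.1 - classicalLocationZ p.1.2|)
    else 0 with hF
  show Summable F ∧ |∑' p, F p| ≤ ε * X
  have hψ0 : ∀ j : ℤ, 0 ≤ truncWeight T j := fun j ↦ (truncWeight_pos hTlog j).le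
  have hψ1 : ∀ j : ℤ, truncWeight T j ≤ 1 := fun j ↦ truncWeight_le_one hTlog j
  have hF0 : ∀ p, 0 ≤ F p := fun p ↦ by
    simp only [hF]
    split_ifs
    · exact mul_nonneg hLc0 (div_nonneg (mul_nonneg (hψ0 _) (hψ0 _)) (abs_nonneg _))
    · exact le_rfl
  -- trivial case `N < 1`: the restricted sum is empty
  rcases lt_or_ge N 1 with hN1 | hN1
  · have hFz : ∀ p, F p = 0 := fun p ↦ by
      simp only [hF]
      rw [if_neg]
      intro h
      have hj : (1 : ℝ) ≤ |(p.1.1 : ℝ)| := by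
        have := Int.one_le_abs (mem_zstarOffDiag.1 p.2).1
        rw [← Int.cast_abs]; exact_mod_cast this
      linarith only [h.1, hj, hN1]
    refine ⟨summable_zero.congr fun p ↦ (hFz p).symm, ?_⟩
    rw [tsum_congr hFz, tsum_zero, abs_zero]
    positivity
  -- main case `1 ≤ N`
  obtain ⟨ℓ, hℓ⟩ : ∃ ℓ : ℝ, ℓ = logPlus (2 * T) := ⟨_, rfl⟩
  have hℓ0 : 0 < ℓ := by rw [hℓ]; exact logPlus_pos _
  have hℓle : ℓ ≤ 2 * Real.log T := by
    rw [hℓ, logPlus_eq, abs_of_nonneg (by linarith only [hT0]), ← Real.log_rpow hT0, Real.rpow_two]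
    exact Real.log_le_log (by linarith only [hT0]) (by nlinarith only [hT3])
  obtain ⟨Nz, hNz⟩ : ∃ Nz : ℕ, Nz = ⌊N⌋₊ := ⟨_, rfl⟩
  have hNz1 : 1 ≤ Nz := by rw [hNz]; exact Nat.le_floor (by exact_mod_cast hN1)
  have hNzN : (Nz : ℝ) ≤ N := by rw [hNz]; exact Nat.floor_le hN0
  obtain ⟨I, hI⟩ : ∃ I : Finset ℤ, I = Finset.Icc (-(Nz : ℤ)) Nz := ⟨_, rfl⟩
  have hmemI : ∀ j : ℤ, |(j : ℝ)| ≤ N → j ∈ I := by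
    intro j hj
    have h1 : ((j.natAbs : ℕ) : ℝ) ≤ N := by rw [Nat.cast_natAbs]; exact_mod_cast hj
    have h2 : j.natAbs ≤ Nz := by rw [hNz]; exact Nat.le_floor h1
    rw [hI, Finset.mem_Icc]
    omega
  have hIabs : ∀ k ∈ I, |k| ≤ (Nz : ℤ) := by
    intro k hk
    rw [hI, Finset.mem_Icc] at hk
    exact abs_le.2 ⟨hk.1, hk.2⟩
  have hcardI : (I.card : ℝ) ≤ 3 * N := by
    have : I.card = 2 * Nz + 1 := by
      rw [hI, Int.card_Icc]; omega
    rw [this]; push_cast; linarith only [hNzN, hN1]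
  -- the majorant
  obtain ⟨r, hr⟩ : ∃ r : ℤ × ℤ → ℝ, r = fun q ↦ if q.1 ∈ I ∧ q.2 ∈ I then
      Ln * (C₁ * ℓ / |(q.1 : ℝ) - q.2|) else 0 := ⟨_, rfl⟩
  have hr0 : ∀ q, 0 ≤ r q := fun q ↦ by
    rw [hr]; dsimp only
    split_ifs <;> positivity
  have hrsupp : ∀ q ∉ I ×ˢ I, r q = 0 := fun q hq ↦ by
    rw [hr]; dsimp only
    rw [if_neg]
    rwa [Finset.mem_product] at hq
  have hrS : Summable r := summable_of_ne_finset_zero hrsupp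
  have hpt : ∀ p : zstarOffDiag, F p ≤ r p.1 := by
    intro p
    obtain ⟨hj, hk, hjk⟩ := mem_zstarOffDiag.1 p.2
    simp only [hF]
    split_ifs with hbox
    · have hjI : p.1.1 ∈ I := hmemI _ hbox.1
      have hkI : p.1.2 ∈ I := hmemI _ hbox.2
      have hrp : r p.1 = Ln * (C₁ * ℓ / |(p.1.1 : ℝ) - p.1.2|) := by
        rw [hr]; dsimp only; rw [if_pos (And.intro hjI hkI)]
      rw [hrp]
      have hψψ1 : truncWeight T p.1.1 * truncWeight T p.1.2 ≤ 1 := by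
        calc truncWeight T p.1.1 * truncWeight T p.1.2 ≤ 1 * 1 :=
              mul_le_mul (hψ1 _) (hψ1 _) (hψ0 _) zero_le_one
          _ = 1 := by ring
      have hψψ0 : 0 ≤ truncWeight T p.1.1 * truncWeight T p.1.2 := mul_nonneg (hψ0 _) (hψ0 _)
      have hΛℓ : logPlus (|(p.1.1 : ℝ)| + |(p.1.2 : ℝ)|) ≤ ℓ := by
        rw [hℓ]
        refine logPlus_mono ?_
        rw [abs_of_nonneg (by positivity : (0 : ℝ) ≤ |(p.1.1 : ℝ)| + |(p.1.2 : ℝ)|),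
          abs_of_nonneg (by linarith only [hT0] : (0 : ℝ) ≤ 2 * T)]
        linarith only [hbox.1, hbox.2, hNT]
      have h1 : 1 / |classicalLocationZ p.1.1 - classicalLocationZ p.1.2| ≤
          C₁ * ℓ / |(p.1.1 : ℝ) - p.1.2| := by
        refine (hgap _ _ hj hk).trans ?_
        rw [mul_div_assoc]
        exact mul_le_mul_of_nonneg_left
          (div_le_div_of_nonneg_right hΛℓ (abs_nonneg _)) hC₁.le
      calc Lc * (truncWeight T p.1.1 * truncWeight T p.1.2 /
            |classicalLocationZ p.1.1 - classicalLocationZ p.1.2|)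
          ≤ Ln * (1 * (1 / |classicalLocationZ p.1.1 - classicalLocationZ p.1.2|)) := by
            refine mul_le_mul hLcLn ?_ (div_nonneg hψψ0 (abs_nonneg _)) hLn0.le
            rw [div_eq_mul_one_div]
            exact mul_le_mul_of_nonneg_right hψψ1 (by positivity)
        _ ≤ Ln * (C₁ * ℓ / |(p.1.1 : ℝ) - p.1.2|) := by
            refine mul_le_mul_of_nonneg_left ?_ hLn0.le
            rw [one_mul]; exact h1
    · exact hr0 _
  have hrS' : Summable (fun p : zstarOffDiag ↦ r p.1) := hrS.subtype _
  have hFS : Summable F := hrS'.of_nonneg_of_le hF0 hpt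
  refine ⟨hFS, ?_⟩
  rw [abs_of_nonneg (tsum_nonneg hF0)]
  have h1 : ∑' p, F p ≤ ∑' p : zstarOffDiag, r p.1 := hFS.tsum_le_tsum hpt hrS'
  have h2 : ∑' p : zstarOffDiag, r p.1 ≤ ∑ q ∈ I ×ˢ I, r q := by
    calc ∑' p : zstarOffDiag, r p.1 ≤ ∑' q, r q := Summable.tsum_subtype_le r zstarOffDiag hr0 hrS
      _ = ∑ q ∈ I ×ˢ I, r q := tsum_eq_sum hrsupp
  have hrjk : ∀ j ∈ I, ∀ k ∈ I, r (j, k) = (Ln * (C₁ * ℓ)) * (1 / |(j : ℝ) - k|) := by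
    intro j hj k hk
    rw [hr]; dsimp only; rw [if_pos ⟨hj, hk⟩]
    ring
  have h3 : ∑ q ∈ I ×ˢ I, r q ≤
      I.card * ((Ln * (C₁ * ℓ)) * (2 * (1 + Real.log ((2 * Nz : ℕ) : ℝ)))) := by
    rw [Finset.sum_product]
    have hinner : ∀ j ∈ I, ∑ k ∈ I, r (j, k) ≤
        (Ln * (C₁ * ℓ)) * (2 * (1 + Real.log ((2 * Nz : ℕ) : ℝ))) := by
      intro j hj
      rw [Finset.sum_congr rfl (fun k hk ↦ hrjk j hj k hk), ← Finset.mul_sum]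
      refine mul_le_mul_of_nonneg_left ?_ (by positivity)
      rw [← Finset.add_sum_erase I (fun k ↦ 1 / |(j : ℝ) - k|) hj]
      simp only [sub_self, abs_zero, div_zero, zero_add]
      refine sum_one_div_abs_sub_le (I.erase j) j (2 * Nz) fun k hk ↦ ?_
      rw [Finset.mem_erase] at hk
      refine ⟨hk.1, ?_⟩
      have h1 := hIabs k hk.2
      have h2 := hIabs j hj
      calc |k - j| ≤ |k| + |j| := abs_sub k j
        _ ≤ (Nz : ℤ) + Nz := add_le_add h1 h2
        _ = ((2 * Nz : ℕ) : ℤ) := by push_cast; ring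
    have h := Finset.sum_le_card_nsmul I (fun j ↦ ∑ k ∈ I, r (j, k)) _ hinner
    rwa [nsmul_eq_mul] at h
  have hlogNz : Real.log ((2 * Nz : ℕ) : ℝ) ≤ 2 * Real.log T := by
    have h1 : ((2 * Nz : ℕ) : ℝ) ≤ 2 * T := by push_cast; linarith only [hNzN, hNT]
    have h2 : (0 : ℝ) < ((2 * Nz : ℕ) : ℝ) := by positivity
    calc Real.log ((2 * Nz : ℕ) : ℝ) ≤ Real.log (2 * T) := Real.log_le_log h2 h1
      _ ≤ Real.log (T ^ 2) := Real.log_le_log (by positivity) (by nlinarith only [hT3])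
      _ = 2 * Real.log T := by rw [Real.log_pow]; ring
  have hb3 : (I.card : ℝ) * ((Ln * (C₁ * ℓ)) * (2 * (1 + Real.log ((2 * Nz : ℕ) : ℝ)))) ≤
      ε / 8 * X := by
    have h1 : 2 * (1 + Real.log ((2 * Nz : ℕ) : ℝ)) ≤ 6 * Real.log T := by
      linarith only [hlogNz, hlog1]
    have h2 : (I.card : ℝ) * ((Ln * (C₁ * ℓ)) * (2 * (1 + Real.log ((2 * Nz : ℕ) : ℝ)))) ≤
        3 * N * ((Ln * (C₁ * (2 * Real.log T))) * (6 * Real.log T)) := by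
      refine mul_le_mul hcardI ?_ (by positivity) (by positivity)
      exact mul_le_mul (mul_le_mul_of_nonneg_left (mul_le_mul_of_nonneg_left hℓle hC₁.le) hLn0.le)
        h1 (by positivity) (by positivity)
    have h3 : 3 * N * ((Ln * (C₁ * (2 * Real.log T))) * (6 * Real.log T)) =
        36 * C₁ * N * Real.log T ^ (n + 2) := by rw [hLn]; ring
    have h4 := hTb T hTb'
    have h5 : 36 * C₁ * N * Real.log T ^ (n + 2) ≤ 36 * C₁ * N * (ε / (288 * C₁) * T ^ c) :=
      mul_le_mul_of_nonneg_left h4 (by positivity)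
    have h6 : 72 * C₁ * N * (ε / (288 * C₁) * T ^ c) = ε / 4 * (N * T ^ c) := alg_four hC₁.ne'
    rw [hNTc] at h6
    calc _ ≤ 36 * C₁ * N * Real.log T ^ (n + 2) := h2.trans h3.le
      _ ≤ 36 * C₁ * N * (ε / (288 * C₁) * T ^ c) := h5
      _ = ε / 8 * T := by linarith only [h6]
      _ ≤ ε / 8 * X := mul_le_mul_of_nonneg_left hTX (by positivity)
  have hεX : 0 ≤ ε * X := by positivity
  linarith only [h1, h2, h3, hb3, hεX]

/-- **Rodgers–Tao 2020, Lemma 21 (iii) `ξ`-clause, printed witness form — CONTENT proof.** For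
`t₀ < 0` with `H_{t₀}` real-rooted, conjunct (iii) of `rodgers_tao_moderatelySized_xi t₀` holds by the
argument of this file (the ex-falso record `rodgers_tao_moderatelySized_xi_holds` is untouched).
[cite: RodgersTaoFMP2020, Lemma 21 (iii) p. 47 («similarly if the x_i are replaced by ξ_i»)] -/
theorem rodgers_tao_negligible_xi_iii_of_neg {t₀ : ℝ} (ht₀ : t₀ < 0)
    (hreal : HasOnlyRealZeros (deBruijnH t₀)) :
    ∀ C c : ℝ, 0 < C → 0 < c →
      IsNegligible t₀ (fun T _ p ↦
        if |(p.1.1 : ℝ)| ≤ T ^ (1 - c) ∧ |(p.1.2 : ℝ)| ≤ T ^ (1 - c) then Real.log T ^ C *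
          (truncWeight T p.1.1 * truncWeight T p.1.2 /
            |classicalLocationZ p.1.1 - classicalLocationZ p.1.2|)
        else 0) :=
  fun C _ _ hc ↦ rodgers_tao_negligible_xi_iii ⟨t₀, by linarith, hreal⟩ (C := C) hc


/-! ## Lemma 21 (iv): pairs with `|j|, |k| ≥ T^{1+c}` (infinite support: `ψ_T`-tails and row sums) -/

namespace RodgersTaoNegligibleSums

/-! ### The profile `(1 + n/N)^{−q}` and `ψ_T log₊^p` (house copies of the private toolkit of
`RodgersTaoTruncEnergyLemma18Proofs`, [folklore]) -/


/-- `psiN ≥ 0`. [folklore] -/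
private theorem psiN_nonneg {N : ℝ} (hN : 0 < N) (q n : ℕ) : 0 ≤ ((1 + (n : ℝ) / N) ^ q)⁻¹ := by
  positivity

/-- `psiN ≤ 1`. [folklore] -/
private theorem psiN_le_one {N : ℝ} (hN : 0 < N) (q n : ℕ) : ((1 + (n : ℝ) / N) ^ q)⁻¹ ≤ 1 := by
  have h1 : 1 ≤ 1 + (n : ℝ) / N := by
    have : 0 ≤ (n : ℝ) / N := by positivity
    linarith
  exact inv_le_one_of_one_le₀ (one_le_pow₀ h1)

/-- For `n ≥ N` and `q ≥ 2`: `(1 + n/N)^{−q} ≤ N²/n²`. [folklore] -/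
private theorem psiN_le_sq_div {N : ℝ} (hN : 0 < N) {q : ℕ} (hq : 2 ≤ q) {n : ℕ} (hn : N ≤ n) :
    ((1 + (n : ℝ) / N) ^ q)⁻¹ ≤ N ^ 2 * (((n : ℝ)) ^ 2)⁻¹ := by
  have hn0 : (0 : ℝ) < n := hN.trans_le hn
  have h1 : (n : ℝ) / N ≤ 1 + (n : ℝ) / N := by linarith
  have h2 : 1 ≤ (n : ℝ) / N := by rwa [le_div_iff₀ hN, one_mul]
  have h3 : ((n : ℝ) / N) ^ 2 ≤ (1 + (n : ℝ) / N) ^ q :=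
    calc ((n : ℝ) / N) ^ 2 ≤ ((n : ℝ) / N) ^ q := pow_le_pow_right₀ h2 hq
      _ ≤ (1 + (n : ℝ) / N) ^ q := pow_le_pow_left₀ (by positivity) h1 q
  calc ((1 + (n : ℝ) / N) ^ q)⁻¹ ≤ (((n : ℝ) / N) ^ 2)⁻¹ := inv_anti₀ (by positivity) h3
    _ = N ^ 2 * ((n : ℝ) ^ 2)⁻¹ := by rw [div_pow]; field_simp

/-- Partial sums: `Σ_{n<M} (1 + n/N)^{−q} ≤ 5N` for `N ≥ 1`, `q ≥ 2`. [folklore] -/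
private theorem sum_range_psiN_le {N : ℝ} (hN : 1 ≤ N) {q : ℕ} (hq : 2 ≤ q) (M : ℕ) :
    ∑ n ∈ Finset.range M, ((1 + (n : ℝ) / N) ^ q)⁻¹ ≤ 5 * N := by
  have hN0 : 0 < N := one_pos.trans_le hN
  set K : ℕ := ⌈N⌉₊ with hK
  have hKN : N ≤ (K : ℝ) := Nat.le_ceil N
  have hK1 : (K : ℝ) < N + 1 := Nat.ceil_lt_add_one hN0.le
  rw [← Finset.sum_filter_add_sum_filter_not (Finset.range M) (fun n ↦ n ≤ K)]
  have h1 : ∑ n ∈ (Finset.range M).filter (fun n ↦ n ≤ K), ((1 + (n : ℝ) / N) ^ q)⁻¹ ≤ (K : ℝ) + 1 := by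
    calc ∑ n ∈ (Finset.range M).filter (fun n ↦ n ≤ K), ((1 + (n : ℝ) / N) ^ q)⁻¹
        ≤ ∑ n ∈ (Finset.range M).filter (fun n ↦ n ≤ K), (1 : ℝ) :=
          Finset.sum_le_sum fun n _ ↦ psiN_le_one hN0 q n
      _ = (((Finset.range M).filter (fun n ↦ n ≤ K)).card : ℝ) := by simp
      _ ≤ ((Finset.range (K + 1)).card : ℝ) := by
          gcongr
          intro n hn
          simp only [Finset.mem_filter, Finset.mem_range] at hn ⊢
          omega
      _ = (K : ℝ) + 1 := by simp
  have h2 : ∑ n ∈ (Finset.range M).filter (fun n ↦ ¬ n ≤ K), ((1 + (n : ℝ) / N) ^ q)⁻¹ ≤ 2 * N := by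
    calc ∑ n ∈ (Finset.range M).filter (fun n ↦ ¬ n ≤ K), ((1 + (n : ℝ) / N) ^ q)⁻¹
        ≤ ∑ n ∈ (Finset.range M).filter (fun n ↦ ¬ n ≤ K), N ^ 2 * (((n : ℝ)) ^ 2)⁻¹ := by
          refine Finset.sum_le_sum fun n hn ↦ psiN_le_sq_div hN0 hq ?_
          simp only [Finset.mem_filter, not_le] at hn
          exact hKN.trans (by exact_mod_cast hn.2.le)
      _ = N ^ 2 * ∑ n ∈ (Finset.range M).filter (fun n ↦ ¬ n ≤ K), (((n : ℝ)) ^ 2)⁻¹ := by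
          rw [Finset.mul_sum]
      _ ≤ N ^ 2 * ∑ n ∈ Finset.Ioo K M, (((n : ℝ)) ^ 2)⁻¹ := by
          refine mul_le_mul_of_nonneg_left
            (Finset.sum_le_sum_of_subset_of_nonneg (fun n hn ↦ ?_) fun _ _ _ ↦ by positivity)
            (by positivity)
          simp only [Finset.mem_filter, Finset.mem_range, not_le] at hn
          simp only [Finset.mem_Ioo]
          exact ⟨hn.2, hn.1⟩
      _ ≤ N ^ 2 * (2 / ((K : ℝ) + 1)) := by gcongr; exact sum_Ioo_inv_sq_le K M
      _ ≤ N ^ 2 * (2 / N) := by gcongr; linarith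
      _ = 2 * N := by field_simp
  linarith

/-- Summability and sum of the profile on `ℕ`. [folklore] -/
private theorem summable_psiN {N : ℝ} (hN : 1 ≤ N) {q : ℕ} (hq : 2 ≤ q) :
    Summable (fun n : ℕ ↦ ((1 + (n : ℝ) / N) ^ q)⁻¹) ∧ ∑' n : ℕ, ((1 + (n : ℝ) / N) ^ q)⁻¹ ≤ 5 * N :=
  ⟨summable_of_sum_range_le (psiN_nonneg (one_pos.trans_le hN) q) (sum_range_psiN_le hN hq),
    Real.tsum_le_of_sum_range_le (psiN_nonneg (one_pos.trans_le hN) q) (sum_range_psiN_le hN hq)⟩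

/-- Summability and sum of the profile on `ℤ`: `Σ_j (1 + |j|/N)^{−q} ≤ 10 N`. [folklore] -/
private theorem summable_psiZq {N : ℝ} (hN : 1 ≤ N) {q : ℕ} (hq : 2 ≤ q) :
    Summable (fun j : ℤ ↦ ((1 + |(j : ℝ)| / N) ^ q)⁻¹) ∧
      ∑' j : ℤ, ((1 + |(j : ℝ)| / N) ^ q)⁻¹ ≤ 10 * N := by
  have hN0 : 0 < N := one_pos.trans_le hN
  set F : ℤ → ℝ := fun j ↦ ((1 + |(j : ℝ)| / N) ^ q)⁻¹ with hF
  have hnat : ∀ n : ℕ, F (n : ℤ) = ((1 + (n : ℝ) / N) ^ q)⁻¹ := fun n ↦ by simp [hF]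
  have hneg : ∀ n : ℕ, F (-(n : ℤ)) = ((1 + (n : ℝ) / N) ^ q)⁻¹ := fun n ↦ by simp [hF]
  obtain ⟨hsN, htN⟩ := summable_psiN hN hq
  have hs : Summable F := by
    refine summable_int_iff_summable_nat_and_neg.2 ⟨?_, ?_⟩
    · simpa only [hnat] using hsN
    · simpa only [hneg] using hsN
  refine ⟨hs, ?_⟩
  have h1 : HasSum (fun n : ℕ ↦ F n + F (-(n : ℤ))) (∑' j : ℤ, F j + F 0) := hs.hasSum.nat_add_neg
  have h2 : (fun n : ℕ ↦ F n + F (-(n : ℤ))) = fun n : ℕ ↦ 2 * ((1 + (n : ℝ) / N) ^ q)⁻¹ := by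
    ext n; rw [hnat, hneg]; ring
  rw [h2] at h1
  have h3 : ∑' n : ℕ, 2 * ((1 + (n : ℝ) / N) ^ q)⁻¹ = 2 * ∑' n : ℕ, ((1 + (n : ℝ) / N) ^ q)⁻¹ :=
    tsum_mul_left
  have h4 := h1.tsum_eq
  rw [h3] at h4
  have h5 : 0 ≤ F 0 := by simp only [hF]; positivity
  show ∑' j : ℤ, F j ≤ 10 * N
  linarith

/-- Pointwise: `ψ_T(j) log₊^p j ≤ (log(2 + N) + 1)^p (1 + |j|/N)^{−(100−p)}`, `N = T log T > 0`,
`p ≤ 100` (from `log₊ j ≤ log(2 + N) + |j|/N ≤ (log(2+N) + 1)(1 + |j|/N)`).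
[cite: RodgersTaoFMP2020, §7 p. 42 (66)] -/
private theorem truncWeight_mul_logPlus_pow_le {T : ℝ} (hT : 0 < T * Real.log T) {p : ℕ} (hp : p ≤ 100)
    (j : ℤ) :
    truncWeight T j * logPlus j ^ p ≤
      (Real.log (2 + T * Real.log T) + 1) ^ p *
        ((1 + |(j : ℝ)| / (T * Real.log T)) ^ (100 - p))⁻¹ := by
  set N := T * Real.log T with hN
  set u := |(j : ℝ)| / N with hu
  have hu0 : 0 ≤ u := by positivity
  set a := Real.log (2 + N) with ha
  have ha0 : 0 ≤ a := Real.log_nonneg (by linarith)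
  have h1 : logPlus (j : ℝ) ≤ a + u := by
    rw [logPlus_eq]
    have h2 : 2 + |(j : ℝ)| ≤ (2 + N) * (1 + u) := by
      have : (2 + N) * (1 + u) = 2 + N + 2 * u + |(j : ℝ)| := by
        rw [hu]; field_simp; ring
      rw [this]; linarith
    have h3 : Real.log (1 + u) ≤ u := by
      have := Real.log_le_sub_one_of_pos (by linarith : (0 : ℝ) < 1 + u); linarith
    calc Real.log (2 + |(j : ℝ)|) ≤ Real.log ((2 + N) * (1 + u)) :=
          Real.log_le_log (by positivity) h2
      _ = Real.log (2 + N) + Real.log (1 + u) := Real.log_mul (by positivity) (by positivity)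
      _ ≤ a + u := by linarith
  have h4 : logPlus (j : ℝ) ≤ (a + 1) * (1 + u) := h1.trans (by nlinarith)
  have h5 : logPlus (j : ℝ) ^ p ≤ (a + 1) ^ p * (1 + u) ^ p := by
    rw [← mul_pow]; exact pow_le_pow_left₀ (logPlus_nonneg _) h4 p
  have hψ : truncWeight T j = ((1 + u) ^ 100)⁻¹ := by rw [truncWeight_eq]
  rw [hψ]
  have h1u : 0 < 1 + u := by linarith
  have hsplit : (1 + u) ^ 100 = (1 + u) ^ p * (1 + u) ^ (100 - p) := by
    rw [← pow_add]; congr 1; omega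
  calc ((1 + u) ^ 100)⁻¹ * logPlus (j : ℝ) ^ p
      ≤ ((1 + u) ^ 100)⁻¹ * ((a + 1) ^ p * (1 + u) ^ p) :=
        mul_le_mul_of_nonneg_left h5 (by positivity)
    _ = (a + 1) ^ p * ((1 + u) ^ (100 - p))⁻¹ := by
        rw [hsplit]; field_simp


/-- **Row sums with the harmonic kernel.** For `T ≥ 3`, `a ≤ 98` and `j ∈ ℤ*`:
`Σ_k ψ_T(k) log₊^a k/|j − k| ≤ log₊^a(2|j|)·2(1 + log|j|) + (1/|j|)·Σ_k ψ_T(k) log₊^a k`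
(split at `|k − j| ≤ |j|`: harmonic sum near `j` with `ψ_T ≤ 1`, `|k| ≤ 2|j|`; `1/|j − k| < 1/|j|`
beyond). [cite: RodgersTaoFMP2020, §7 p. 42 (66); Lemma 21 p. 47] -/
theorem tsum_truncWeight_logPlus_pow_div_le {T : ℝ} (hT : 3 ≤ T) {a : ℕ} (ha : a ≤ 98) {j : ℤ}
    (hj : j ≠ 0) :
    Summable (fun k : ℤ ↦ truncWeight T k * logPlus k ^ a * (1 / |(j : ℝ) - k|)) ∧
      ∑' k : ℤ, truncWeight T k * logPlus k ^ a * (1 / |(j : ℝ) - k|) ≤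
        logPlus (2 * |(j : ℝ)|) ^ a * (2 * (1 + Real.log |(j : ℝ)|)) +
          (1 / |(j : ℝ)|) * ((Real.log (2 + T * Real.log T) + 1) ^ a * (10 * (T * Real.log T))) := by
  classical
  obtain ⟨hsg, hg⟩ := RodgersTaoTruncEnergyExpansion.tsum_truncWeight_mul_logPlus_pow_le hT ha
  have hT0 : 0 < T := by linarith
  have hlog : 0 < Real.log T := Real.log_pos (by linarith)
  have hTlog : 0 < T * Real.log T := mul_pos hT0 hlog
  have hψ0 : ∀ k : ℤ, 0 ≤ truncWeight T k := fun k ↦ (truncWeight_pos hTlog k).le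
  have hψ1 : ∀ k : ℤ, truncWeight T k ≤ 1 := fun k ↦ truncWeight_le_one hTlog k
  set g : ℤ → ℝ := fun k ↦ truncWeight T k * logPlus k ^ a with hgdef
  set f : ℤ → ℝ := fun k ↦ truncWeight T k * logPlus k ^ a * (1 / |(j : ℝ) - k|) with hfdef
  have hg0 : ∀ k, 0 ≤ g k := fun k ↦ mul_nonneg (hψ0 k) (pow_nonneg (logPlus_nonneg _) _)
  have hf0 : ∀ k, 0 ≤ f k := fun k ↦ mul_nonneg (hg0 k) (by positivity)
  have hinv1 : ∀ k : ℤ, 1 / |(j : ℝ) - k| ≤ 1 := by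
    intro k
    rcases eq_or_ne k j with rfl | hkj
    · simp
    · have : (1 : ℝ) ≤ |(j : ℝ) - k| := by
        have h1 : (1 : ℤ) ≤ |j - k| := Int.one_le_abs (sub_ne_zero.2 (Ne.symm hkj))
        have h2 : ((1 : ℤ) : ℝ) ≤ ((|j - k| : ℤ) : ℝ) := by exact_mod_cast h1
        simpa [Int.cast_abs, Int.cast_sub] using h2
      exact (div_le_one (by linarith)).2 this
  have hfg : ∀ k, f k ≤ g k := fun k ↦ by
    simp only [hfdef, hgdef]
    exact mul_le_of_le_one_right (hg0 k) (hinv1 k)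
  have hsf : Summable f := hsg.of_nonneg_of_le hf0 hfg
  refine ⟨hsf, ?_⟩
  have hj0 : 0 < |(j : ℝ)| := abs_pos.2 (by exact_mod_cast hj)
  obtain ⟨K, hK⟩ : ∃ K : Finset ℤ, K = Finset.Icc (j - (j.natAbs : ℤ)) (j + (j.natAbs : ℤ)) :=
    ⟨_, rfl⟩
  have hKmem : ∀ m : ℤ, m ∈ K ↔ j - (j.natAbs : ℤ) ≤ m ∧ m ≤ j + (j.natAbs : ℤ) := fun m ↦ by
    rw [hK, Finset.mem_Icc]
  have hnat : ((j.natAbs : ℕ) : ℝ) = |(j : ℝ)| := by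
    rw [Nat.cast_natAbs, Int.cast_abs]
  -- near part
  have hnear : ∑ k ∈ K, f k ≤ logPlus (2 * |(j : ℝ)|) ^ a * (2 * (1 + Real.log |(j : ℝ)|)) := by
    have hjK : j ∈ K := by rw [hKmem]; omega
    rw [← Finset.add_sum_erase K f hjK]
    have hfj : f j = 0 := by simp [hfdef]
    rw [hfj, zero_add]
    have hterm : ∀ k ∈ K.erase j, f k ≤ logPlus (2 * |(j : ℝ)|) ^ a * (1 / |(j : ℝ) - k|) := by
      intro k hk
      rw [Finset.mem_erase, hKmem] at hk
      have hkle : |(k : ℝ)| ≤ 2 * |(j : ℝ)| := by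
        have h1 : |k| ≤ 2 * |j| := by
          rw [Int.abs_eq_natAbs, Int.abs_eq_natAbs]; have := hk.2; omega
        have h2 : ((|k| : ℤ) : ℝ) ≤ ((2 * |j| : ℤ) : ℝ) := by exact_mod_cast h1
        simpa [Int.cast_abs, Int.cast_mul] using h2
      have hlp : logPlus (k : ℝ) ≤ logPlus (2 * |(j : ℝ)|) :=
        logPlus_mono (by rw [abs_of_nonneg (by positivity : (0:ℝ) ≤ 2 * |(j : ℝ)|)]; exact hkle)
      simp only [hfdef]
      refine mul_le_mul_of_nonneg_right ?_ (by positivity)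
      calc truncWeight T k * logPlus (k : ℝ) ^ a ≤ 1 * logPlus (2 * |(j : ℝ)|) ^ a :=
            mul_le_mul (hψ1 k) (pow_le_pow_left₀ (logPlus_nonneg _) hlp a)
              (pow_nonneg (logPlus_nonneg _) _) zero_le_one
        _ = logPlus (2 * |(j : ℝ)|) ^ a := one_mul _
    calc ∑ k ∈ K.erase j, f k ≤ ∑ k ∈ K.erase j, logPlus (2 * |(j : ℝ)|) ^ a * (1 / |(j : ℝ) - k|) :=
          Finset.sum_le_sum hterm
      _ = logPlus (2 * |(j : ℝ)|) ^ a * ∑ k ∈ K.erase j, 1 / |(j : ℝ) - k| := by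
          rw [Finset.mul_sum]
      _ ≤ logPlus (2 * |(j : ℝ)|) ^ a * (2 * (1 + Real.log ((j.natAbs : ℕ) : ℝ))) := by
          refine mul_le_mul_of_nonneg_left ?_ (pow_nonneg (logPlus_nonneg _) _)
          refine sum_one_div_abs_sub_le (K.erase j) j j.natAbs fun k hk ↦ ?_
          rw [Finset.mem_erase, hKmem] at hk
          refine ⟨hk.1, ?_⟩
          rw [abs_le]; constructor <;> omega
      _ = logPlus (2 * |(j : ℝ)|) ^ a * (2 * (1 + Real.log |(j : ℝ)|)) := by rw [hnat]
  -- far part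
  have hfar : ∑' k : ((K : Set ℤ)ᶜ : Set ℤ), f k ≤
      (1 / |(j : ℝ)|) * ((Real.log (2 + T * Real.log T) + 1) ^ a * (10 * (T * Real.log T))) := by
    have hle : ∀ k : ((K : Set ℤ)ᶜ : Set ℤ), f k ≤ (1 / |(j : ℝ)|) * g k := by
      intro k
      have hk : (k : ℤ) ∉ K := by
        have := k.2
        rw [Set.mem_compl_iff, Finset.mem_coe] at this
        exact this
      rw [hKmem, not_and_or, not_le, not_le] at hk
      have hdist : |(j : ℝ)| ≤ |(j : ℝ) - (k : ℤ)| := by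
        have h1 : |j| ≤ |j - (k : ℤ)| := by
          rw [Int.abs_eq_natAbs, Int.abs_eq_natAbs]; rcases hk with h | h <;> omega
        have h2 : ((|j| : ℤ) : ℝ) ≤ ((|j - (k : ℤ)| : ℤ) : ℝ) := by exact_mod_cast h1
        simpa [Int.cast_abs, Int.cast_sub] using h2
      simp only [hfdef, hgdef]
      rw [mul_comm (1 / |(j : ℝ)|)]
      exact mul_le_mul_of_nonneg_left (one_div_le_one_div_of_le hj0 hdist) (hg0 _)
    have hs1 : Summable (fun k : ((K : Set ℤ)ᶜ : Set ℤ) ↦ f k) := hsf.subtype _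
    have hs2 : Summable (fun k : ((K : Set ℤ)ᶜ : Set ℤ) ↦ (1 / |(j : ℝ)|) * g k) :=
      (hsg.subtype _).mul_left _
    calc ∑' k : ((K : Set ℤ)ᶜ : Set ℤ), f k ≤ ∑' k : ((K : Set ℤ)ᶜ : Set ℤ), (1 / |(j : ℝ)|) * g k :=
          hs1.tsum_le_tsum hle hs2
      _ = (1 / |(j : ℝ)|) * ∑' k : ((K : Set ℤ)ᶜ : Set ℤ), g k := tsum_mul_left
      _ ≤ (1 / |(j : ℝ)|) * ∑' k : ℤ, g k :=
          mul_le_mul_of_nonneg_left (Summable.tsum_subtype_le g _ hg0 hsg) (by positivity)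
      _ ≤ _ := mul_le_mul_of_nonneg_left hg (by positivity)
  have hsplit := hsf.sum_add_tsum_compl (s := K)
  linarith

/-- **Near count for a row of (iv)**: `#{k : |k| ≤ 2|j|, |j − k| < L} ≤ 2L + 1` as a `tsum` of an
indicator. [folklore] -/
private theorem tsum_nearInd_le (j : ℤ) {L : ℝ} (hL : 0 ≤ L) :
    Summable (fun k : ℤ ↦ if |(k : ℝ)| ≤ 2 * |(j : ℝ)| ∧ |(j : ℝ) - k| < L then (1 : ℝ) else 0) ∧
      ∑' k : ℤ, (if |(k : ℝ)| ≤ 2 * |(j : ℝ)| ∧ |(j : ℝ) - k| < L then (1 : ℝ) else 0) ≤ 2 * L + 1 := by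
  classical
  set S : Finset ℤ := Finset.Icc (j - ⌈L⌉) (j + ⌈L⌉) with hS
  have hsupp : ∀ k ∉ S, (if |(k : ℝ)| ≤ 2 * |(j : ℝ)| ∧ |(j : ℝ) - k| < L then (1 : ℝ) else 0) = 0 := by
    intro k hk
    rw [if_neg]
    intro h
    apply hk
    rw [hS, Finset.mem_Icc]
    have h1 := abs_lt.1 h.2
    have hc : L ≤ ⌈L⌉ := Int.le_ceil L
    constructor
    · have : (j : ℝ) - ⌈L⌉ < k := by linarith [h1.2]
      have : ((j - ⌈L⌉ : ℤ) : ℝ) < k := by push_cast; exact this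
      exact (by exact_mod_cast this : j - ⌈L⌉ < k).le
    · have : (k : ℝ) < j + ⌈L⌉ := by linarith [h1.1]
      have : (k : ℝ) < ((j + ⌈L⌉ : ℤ) : ℝ) := by push_cast; exact this
      exact (by exact_mod_cast this : k < j + ⌈L⌉).le
  refine ⟨summable_of_ne_finset_zero hsupp, ?_⟩
  rw [tsum_eq_sum hsupp]
  calc ∑ k ∈ S, (if |(k : ℝ)| ≤ 2 * |(j : ℝ)| ∧ |(j : ℝ) - k| < L then (1 : ℝ) else 0)
      ≤ ∑ k ∈ S, (if |(j : ℝ) - k| < L then (1 : ℝ) else 0) := by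
        refine Finset.sum_le_sum fun k _ ↦ ?_
        split_ifs with h1 h2 h3 <;> first | exact le_rfl | exact zero_le_one | exact absurd h1.2 h2
    _ ≤ 2 * L + 1 := sum_ite_abs_sub_lt_le S j hL

/-- Bookkeeping identity (row bound of (iv)). [folklore] -/
private theorem alg_five {Ln ψ η lp D C₁ : ℝ} (hη : η ≠ 0) :
    Ln * ψ / (4 * η) * ((8 * D + 4) * lp ^ 2) + Ln * (2 * C₁) * ψ * lp * (16 * lp) +
      Ln * (2 * C₁) * ψ * (52 * lp ^ 2) = Ln * ((2 * D + 1) / η + 136 * C₁) * (ψ * lp ^ 2) := by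
  field_simp
  ring

/-- Bookkeeping identity. [folklore] -/
private theorem alg_six {Ln D ε A C₁ : ℝ} (hε : ε ≠ 0) (hLn : Ln ≠ 0) :
    Ln * ((2 * D + 1) / (ε / (A * Ln)) + 136 * C₁) =
      Ln ^ 2 * ((2 * D + 1) * A / ε) + Ln * (136 * C₁) := by
  field_simp

/-- Bookkeeping identity. [folklore] -/
private theorem alg_seven {Ln K₄ L Tc T : ℝ} (hTc : Tc ≠ 0) :
    (Ln ^ 2 * (K₄ / 160)) * ((16 * L ^ 2) * (L / Tc) ^ 96 * (10 * (T * L))) =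
      K₄ * ((Ln ^ 2 * L ^ 99) / Tc ^ 96) * T := by
  field_simp
  ring

/-- Bookkeeping identity. [folklore] -/
private theorem alg_eight {K₄ ε P : ℝ} (hK : K₄ ≠ 0) : K₄ * (ε / (2 * K₄) * P) = ε / 2 * P := by
  field_simp

end RodgersTaoNegligibleSums



set_option maxHeartbeats 400000 in
open RodgersTaoNegligibleSums in
/-- **Rodgers–Tao 2020, Lemma 21 (iv) — RH-FREE CONTENT twin** (location-law form). Above a
real-rooted time `t₁ < t₀/2`, under the location law (50) on the window `[t₀/2, 0]`, for all `C`,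
`c > 0` the restricted sum `(log^C T) Σ_{|j|,|k| ≥ T^{1+c}, j ≠ k} ψ_T(j)ψ_T(k)/|x_j(t) − x_k(t)|` is
negligible (`IsNegligible t₀`) — conjunct (iv) of `rodgers_tao_moderatelySized t₀` BY CONTENT. Road
(module docstring): near pairs (`|k| ≤ 2|j|`, `|j − k| < D log₊²(3|j|)`) by the `η`-split and
Lemma 21 (i); far pairs by the location law + (44) and row sums with the harmonic kernel
(`tsum_truncWeight_logPlus_pow_div_le`); the gain comes from the `ψ_T`-tail
`Σ_{|j| ≥ T^{1+c}} ψ_T(j) log₊² j ≲ (log T/T^c)^{96} · T log³ T`; valid for ALL `c > 0` (the printed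
one-liner needs `c > 1/198`). [cite: RodgersTaoFMP2020, Lemma 21 (iv) p. 47 (= arXiv:1801.05914v4 Lemma 7.6 (iv)); proof p. 48] -/
theorem rodgers_tao_negligible_iv_of_location {t₀ B : ℝ}
    (hreal : ∃ t₁ : ℝ, t₁ < t₀ / 2 ∧ HasOnlyRealZeros (deBruijnH t₁))
    (H2 : ∀ t ∈ Icc (t₀ / 2) 0, ∀ n : ℕ, 1 ≤ n →
      |deBruijnZero t n - classicalLocation (n : ℝ)| ≤ B * logPlus (classicalLocation (n : ℝ)))
    {C c : ℝ} (hc : 0 < c) :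
    IsNegligible t₀ (fun T t p ↦
      if T ^ (1 + c) ≤ |(p.1.1 : ℝ)| ∧ T ^ (1 + c) ≤ |(p.1.2 : ℝ)| then Real.log T ^ C *
        (truncWeight T p.1.1 * truncWeight T p.1.2 / |deBruijnZeroZ t p.1.1 - deBruijnZeroZ t p.1.2|)
      else 0) := by
  classical
  obtain ⟨t₁, ht₁, hreal₁⟩ := hreal
  obtain ⟨Ci, Ti, hCi0, hEi⟩ := tsum_truncWeight_interactionEnergy_le
  obtain ⟨Cξ, hCξ1, hCξ⟩ := exists_logPlus_classicalLocationZ_le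
  obtain ⟨C₁, hC₁, hgap⟩ := exists_inv_abs_sub_classicalLocationZ_le
  have hCξ0 : 0 ≤ Cξ := by linarith only [hCξ1]
  obtain ⟨B', hB'⟩ : ∃ B' : ℝ, B' = max B 0 := ⟨_, rfl⟩
  have hB'0 : 0 ≤ B' := by rw [hB']; exact le_max_right _ _
  have hBB' : B ≤ B' := by rw [hB']; exact le_max_left _ _
  obtain ⟨D, hD⟩ : ∃ D : ℝ, D = 4 * B' * Cξ * C₁ := ⟨_, rfl⟩
  have hD0 : 0 ≤ D := by rw [hD]; positivity
  obtain ⟨n, hn⟩ : ∃ n : ℕ, n = ⌈C⌉₊ := ⟨_, rfl⟩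
  obtain ⟨A, hA⟩ : ∃ A : ℝ, A = 2 * (1 + Ci) := ⟨_, rfl⟩
  have hA0 : 0 < A := by rw [hA]; positivity
  intro ε hε
  -- the constant of the row bound and the two thresholds
  obtain ⟨K₄, hK₄⟩ : ∃ K₄ : ℝ, K₄ = 160 * ((2 * D + 1) * A / ε + 136 * C₁) := ⟨_, rfl⟩
  have hK₄0 : 0 < K₄ := by rw [hK₄]; positivity
  obtain ⟨Ta, hTa⟩ := exists_forall_log_pow_le (2 * n + 99) (c := 96 * c) (by positivity)
    (show 0 < ε / (2 * K₄) by positivity)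
  obtain ⟨Td, hTd⟩ := exists_forall_log_pow_le 2 (c := 1) one_pos
    (show 0 < 1 / (8 * D + 1) by positivity)
  refine ⟨max (max 3 Ti) (max Ta Td), fun T hT t ht1 ht2 hs ↦ ?_⟩
  have hT3 : 3 ≤ T := le_trans (le_max_left _ _) (le_trans (le_max_left _ _) hT)
  have hTi : Ti ≤ T := le_trans (le_max_right _ _) (le_trans (le_max_left _ _) hT)
  have hTa' : Ta ≤ T := le_trans (le_max_left _ _) (le_trans (le_max_right _ _) hT)
  have hTd' : Td ≤ T := le_trans (le_max_right _ _) (le_trans (le_max_right _ _) hT)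
  have hT0 : 0 < T := by linarith only [hT3]
  have hT1 : 1 ≤ T := by linarith only [hT3]
  have hlog1 : 1 ≤ Real.log T := one_le_log_three.trans (Real.log_le_log (by norm_num) hT3)
  have hlog0 : 0 < Real.log T := by linarith only [hlog1]
  have hTlog : 0 < T * Real.log T := mul_pos hT0 hlog0
  have hN₀1 : 1 ≤ T * Real.log T := by nlinarith only [hT3, hlog1]
  have hΛt : ∃ t₁' : ℝ, t₁' < t ∧ HasOnlyRealZeros (deBruijnH t₁') :=
    ⟨t₁, by linarith only [ht₁, ht1], hreal₁⟩
  have hmono := strictMono_deBruijnZeroZ hΛt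
  have hE0 : 0 ≤ truncEnergy T t := truncEnergy_nonneg hTlog hmono
  set X : ℝ := T * Real.log T ^ 3 + truncEnergy T t with hX
  have hTL0 : 0 ≤ T * Real.log T ^ 3 := by positivity
  have hTX : T ≤ X := by
    have : T * 1 ≤ T * Real.log T ^ 3 := mul_le_mul_of_nonneg_left (one_le_pow₀ hlog1) hT0.le
    linarith only [this, hE0, hX]
  have hX0 : 0 ≤ X := by linarith only [hTX, hT0]
  set M : ℝ := T ^ (1 + c) with hM
  have hMT : T ≤ M := by
    rw [hM]
    conv_lhs => rw [← Real.rpow_one T]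
    exact Real.rpow_le_rpow_of_exponent_le hT1 (by linarith only [hc])
  have hM0 : 0 < M := hT0.trans_le hMT
  have hMeq : M = T * T ^ c := by rw [hM, Real.rpow_add hT0, Real.rpow_one]
  have hTc0 : 0 < T ^ c := Real.rpow_pos_of_pos hT0 _
  set Lc : ℝ := Real.log T ^ C with hLc
  obtain ⟨Ln, hLn⟩ : ∃ Ln : ℝ, Ln = Real.log T ^ n := ⟨_, rfl⟩
  have hLc0 : 0 ≤ Lc := Real.rpow_nonneg hlog0.le _
  have hLcLn : Lc ≤ Ln := by
    rw [hLc, hLn, ← Real.rpow_natCast, hn]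
    exact Real.rpow_le_rpow_of_exponent_le hlog1 (Nat.le_ceil C)
  have hLn1 : 1 ≤ Ln := by rw [hLn]; exact one_le_pow₀ hlog1
  have hLn0 : 0 < Ln := by linarith only [hLn1]
  set F : zstarOffDiag → ℝ := fun p ↦
    if M ≤ |(p.1.1 : ℝ)| ∧ M ≤ |(p.1.2 : ℝ)| then Lc *
      (truncWeight T p.1.1 * truncWeight T p.1.2 / |deBruijnZeroZ t p.1.1 - deBruijnZeroZ t p.1.2|)
    else 0 with hF
  show Summable F ∧ |∑' p, F p| ≤ ε * X
  have hψ0 : ∀ j : ℤ, 0 ≤ truncWeight T j := fun j ↦ (truncWeight_pos hTlog j).le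
  have hψ1 : ∀ j : ℤ, truncWeight T j ≤ 1 := fun j ↦ truncWeight_le_one hTlog j
  have hF0 : ∀ p, 0 ≤ F p := fun p ↦ by
    simp only [hF]
    split_ifs
    · exact mul_nonneg hLc0 (div_nonneg (mul_nonneg (hψ0 _) (hψ0 _)) (abs_nonneg _))
    · exact le_rfl
  have h50Z : ∀ j : ℤ, j ≠ 0 →
      |deBruijnZeroZ t j - classicalLocationZ j| ≤ B' * logPlus (classicalLocationZ j) := by
    refine fun j hj ↦ location_zstar_of_nat (fun m hm ↦ ?_) hj
    exact (H2 t ⟨ht1, ht2⟩ m hm).trans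
      (mul_le_mul_of_nonneg_right hBB' (logPlus_nonneg _))
  obtain ⟨η, hη⟩ : ∃ η : ℝ, η = ε / (A * Ln) := ⟨_, rfl⟩
  have hη0 : 0 < η := by rw [hη]; positivity
  have hLnη : Ln * η = ε / A := by
    rw [hη, mul_div_assoc', mul_comm A Ln, mul_div_mul_left _ _ hLn0.ne']
  -- log-versus-linear for the far comparison in the regime `|k| > 2|j|`
  have hfarA : ∀ x : ℝ, T ≤ x → D * logPlus (2 * x) ^ 2 ≤ x / 2 := by
    intro x hx
    have hx3 : 3 ≤ x := hT3.trans hx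
    have hlp : logPlus (2 * x) ≤ 2 * Real.log x := by
      rw [logPlus_eq, abs_of_nonneg (by linarith only [hx3]), ← Real.log_rpow (by linarith only [hx3]),
        Real.rpow_two]
      exact Real.log_le_log (by linarith only [hx3]) (by nlinarith only [hx3])
    have h1 := hTd x (hTd'.trans hx)
    rw [Real.rpow_one] at h1
    have h2 : logPlus (2 * x) ^ 2 ≤ 4 * Real.log x ^ 2 := by
      have := pow_le_pow_left₀ (logPlus_nonneg _) hlp 2; nlinarith only [this]
    have h3 : D * (4 * (1 / (8 * D + 1) * x)) ≤ x / 2 := by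
      rw [show D * (4 * (1 / (8 * D + 1) * x)) = x * (4 * D / (8 * D + 1)) by ring]
      have : 4 * D / (8 * D + 1) ≤ 1 / 2 := by
        rw [div_le_div_iff₀ (by positivity) (by norm_num)]; linarith only [hD0]
      nlinarith only [this, hx3]
    calc D * logPlus (2 * x) ^ 2 ≤ D * (4 * Real.log x ^ 2) := mul_le_mul_of_nonneg_left h2 hD0
      _ ≤ D * (4 * (1 / (8 * D + 1) * x)) := by
          refine mul_le_mul_of_nonneg_left (mul_le_mul_of_nonneg_left h1 (by norm_num)) hD0
      _ ≤ x / 2 := h3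
  -- the majorant `G` on `ℤ × ℤ`
  obtain ⟨G, hG⟩ : ∃ G : ℤ × ℤ → ℝ, G = fun q ↦ if M ≤ |(q.1 : ℝ)| then
      Ln * ((if |(q.2 : ℝ)| ≤ 2 * |(q.1 : ℝ)| ∧ |(q.1 : ℝ) - q.2| < D * logPlus (3 * |(q.1 : ℝ)|) ^ 2
          then (1 : ℝ) else 0) * truncWeight T q.1 / (4 * η) +
        2 * C₁ * truncWeight T q.1 * (truncWeight T q.2 * (1 / |(q.1 : ℝ) - q.2|)) *
          logPlus q.1 +
        2 * C₁ * truncWeight T q.1 * (truncWeight T q.2 * logPlus q.2 * (1 / |(q.1 : ℝ) - q.2|)))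
      else 0 := ⟨_, rfl⟩
  have hG0 : ∀ q, 0 ≤ G q := fun q ↦ by
    have h1 : 0 ≤ logPlus (q.1 : ℝ) := logPlus_nonneg _
    have h2 : 0 ≤ logPlus (q.2 : ℝ) := logPlus_nonneg _
    have h3 := hψ0 q.1
    have h4 := hψ0 q.2
    have h5 : 0 ≤ 1 / |(q.1 : ℝ) - q.2| := by positivity
    have h6 : (0 : ℝ) ≤ 2 * C₁ := by positivity
    have hfar0 : 0 ≤ 2 * C₁ * truncWeight T q.1 * (truncWeight T q.2 * (1 / |(q.1 : ℝ) - q.2|)) *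
          logPlus q.1 +
        2 * C₁ * truncWeight T q.1 * (truncWeight T q.2 * logPlus q.2 * (1 / |(q.1 : ℝ) - q.2|)) :=
      add_nonneg (mul_nonneg (mul_nonneg (mul_nonneg h6 h3) (mul_nonneg h4 h5)) h1)
        (mul_nonneg (mul_nonneg h6 h3) (mul_nonneg (mul_nonneg h4 h2) h5))
    rw [hG]; dsimp only
    split_ifs
    · exact mul_nonneg hLn0.le (add_nonneg (add_nonneg
        (div_nonneg (by rw [one_mul]; exact h3) (by positivity))
        (mul_nonneg (mul_nonneg (mul_nonneg h6 h3) (mul_nonneg h4 h5)) h1))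
        (mul_nonneg (mul_nonneg h6 h3) (mul_nonneg (mul_nonneg h4 h2) h5)))
    · exact mul_nonneg hLn0.le (add_nonneg (add_nonneg
        (div_nonneg (by rw [zero_mul]) (by positivity))
        (mul_nonneg (mul_nonneg (mul_nonneg h6 h3) (mul_nonneg h4 h5)) h1))
        (mul_nonneg (mul_nonneg h6 h3) (mul_nonneg (mul_nonneg h4 h2) h5)))
    · exact le_rfl
  -- pointwise comparison on the subtype
  have hpt : ∀ p : zstarOffDiag, F p ≤
      Ln * η * (truncWeight T p.1.1 * truncWeight T p.1.2 * interactionEnergy t p.1.1 p.1.2) +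
        G p.1 := by
    intro p
    obtain ⟨hj, hk, hjk⟩ := mem_zstarOffDiag.1 p.2
    have hW0 : 0 ≤ Ln * η *
        (truncWeight T p.1.1 * truncWeight T p.1.2 * interactionEnergy t p.1.1 p.1.2) :=
      mul_nonneg (by positivity) (mul_nonneg (mul_nonneg (hψ0 _) (hψ0 _)) (interactionEnergy_nonneg _ _ _))
    simp only [hF]
    split_ifs with hbox
    · obtain ⟨g, hg⟩ : ∃ g : ℝ, g = deBruijnZeroZ t p.1.1 - deBruijnZeroZ t p.1.2 := ⟨_, rfl⟩
      rw [← hg]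
      have hψψ0 : 0 ≤ truncWeight T p.1.1 * truncWeight T p.1.2 := mul_nonneg (hψ0 _) (hψ0 _)
      have hEg : interactionEnergy t p.1.1 p.1.2 = 1 / g ^ 2 := by rw [interactionEnergy_eq, hg]
      have hlp1 : 0 ≤ logPlus (p.1.1 : ℝ) := logPlus_nonneg _
      have hlp2 : 0 ≤ logPlus (p.1.2 : ℝ) := logPlus_nonneg _
      -- the two non-`E` terms of `G p.1`, abbreviated
      obtain ⟨Rfar, hRfar⟩ : ∃ Rfar : ℝ, Rfar =
          2 * C₁ * truncWeight T p.1.1 * (truncWeight T p.1.2 *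
              (1 / |(p.1.1 : ℝ) - p.1.2|)) * logPlus (p.1.1 : ℝ) +
            2 * C₁ * truncWeight T p.1.1 * (truncWeight T p.1.2 * logPlus (p.1.2 : ℝ) *
              (1 / |(p.1.1 : ℝ) - p.1.2|)) := ⟨_, rfl⟩
      have hψj := hψ0 p.1.1
      have hψk := hψ0 p.1.2
      have hRfar0 : 0 ≤ Rfar := by
        have h5 : 0 ≤ 1 / |(p.1.1 : ℝ) - p.1.2| := by positivity
        have h6 : (0 : ℝ) ≤ 2 * C₁ := by positivity
        rw [hRfar]
        exact add_nonneg (mul_nonneg (mul_nonneg (mul_nonneg h6 hψj) (mul_nonneg hψk h5)) hlp1)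
          (mul_nonneg (mul_nonneg h6 hψj) (mul_nonneg (mul_nonneg hψk hlp2) h5))
      have hRfar_eq : Rfar = 2 * C₁ * (truncWeight T p.1.1 * truncWeight T p.1.2) *
          (logPlus (p.1.1 : ℝ) + logPlus (p.1.2 : ℝ)) / |(p.1.1 : ℝ) - p.1.2| := by
        rw [hRfar]; ring
      have hGp : ∀ ind : ℝ, (ind = if |(p.1.2 : ℝ)| ≤ 2 * |(p.1.1 : ℝ)| ∧
            |(p.1.1 : ℝ) - p.1.2| < D * logPlus (3 * |(p.1.1 : ℝ)|) ^ 2 then (1 : ℝ) else 0) →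
          G p.1 = Ln * (ind * truncWeight T p.1.1 / (4 * η) + Rfar) := by
        intro ind hind
        rw [hG]; dsimp only; rw [if_pos hbox.1, hind, hRfar]; ring
      by_cases hnear : |(p.1.2 : ℝ)| ≤ 2 * |(p.1.1 : ℝ)| ∧
          |(p.1.1 : ℝ) - p.1.2| < D * logPlus (3 * |(p.1.1 : ℝ)|) ^ 2
      · -- near pair: the `η`-split, keeping `ψ_T(j)`
        rw [hGp 1 (by rw [if_pos hnear])]
        have h1 := one_div_abs_le_eta g hη0
        have h2 : truncWeight T p.1.1 * truncWeight T p.1.2 / |g| ≤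
            η * (truncWeight T p.1.1 * truncWeight T p.1.2 * (1 / g ^ 2)) +
              truncWeight T p.1.1 / (4 * η) := by
          calc truncWeight T p.1.1 * truncWeight T p.1.2 / |g|
              = (truncWeight T p.1.1 * truncWeight T p.1.2) * (1 / |g|) := by ring
            _ ≤ (truncWeight T p.1.1 * truncWeight T p.1.2) * (η * (1 / g ^ 2) + 1 / (4 * η)) :=
                mul_le_mul_of_nonneg_left h1 hψψ0
            _ = η * (truncWeight T p.1.1 * truncWeight T p.1.2 * (1 / g ^ 2)) +
                  truncWeight T p.1.1 * (truncWeight T p.1.2 * (1 / (4 * η))) := by ring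
            _ ≤ η * (truncWeight T p.1.1 * truncWeight T p.1.2 * (1 / g ^ 2)) +
                  truncWeight T p.1.1 * (1 * (1 / (4 * η))) := by
                have : truncWeight T p.1.2 * (1 / (4 * η)) ≤ 1 * (1 / (4 * η)) :=
                  mul_le_mul_of_nonneg_right (hψ1 _) (by positivity)
                have := mul_le_mul_of_nonneg_left this (hψ0 p.1.1)
                linarith only [this]
            _ = _ := by ring
        rw [hEg]
        calc Lc * (truncWeight T p.1.1 * truncWeight T p.1.2 / |g|)
            ≤ Ln * (truncWeight T p.1.1 * truncWeight T p.1.2 / |g|) :=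
              mul_le_mul_of_nonneg_right hLcLn (div_nonneg hψψ0 (abs_nonneg _))
          _ ≤ Ln * (η * (truncWeight T p.1.1 * truncWeight T p.1.2 * (1 / g ^ 2)) +
                truncWeight T p.1.1 / (4 * η)) := mul_le_mul_of_nonneg_left h2 hLn0.le
          _ = Ln * η * (truncWeight T p.1.1 * truncWeight T p.1.2 * (1 / g ^ 2)) +
                Ln * (1 * truncWeight T p.1.1 / (4 * η) + 0) := by ring
          _ ≤ Ln * η * (truncWeight T p.1.1 * truncWeight T p.1.2 * (1 / g ^ 2)) +
                Ln * (1 * truncWeight T p.1.1 / (4 * η) + Rfar) := by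
              have := mul_le_mul_of_nonneg_left
                (add_le_add_left hRfar0 (1 * truncWeight T p.1.1 / (4 * η))) hLn0.le
              linarith only [this]
      · -- far pair
        rw [hGp _ rfl, if_neg hnear]
        have hjM : M ≤ |(p.1.1 : ℝ)| := hbox.1
        have hkM : M ≤ |(p.1.2 : ℝ)| := hbox.2
        have hfar : 4 * B' * Cξ * C₁ * logPlus (|(p.1.1 : ℝ)| + |(p.1.2 : ℝ)|) ^ 2 ≤
            |(p.1.1 : ℝ) - p.1.2| := by
          rw [← hD]
          by_cases h2j : |(p.1.2 : ℝ)| ≤ 2 * |(p.1.1 : ℝ)|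
          · -- then `¬ near` is the far inequality, and `Λ₁ ≤ log₊(3|j|)`
            have hnot : ¬ |(p.1.1 : ℝ) - p.1.2| < D * logPlus (3 * |(p.1.1 : ℝ)|) ^ 2 :=
              fun h ↦ hnear ⟨h2j, h⟩
            have hΛ : logPlus (|(p.1.1 : ℝ)| + |(p.1.2 : ℝ)|) ≤ logPlus (3 * |(p.1.1 : ℝ)|) := by
              refine logPlus_mono ?_
              rw [abs_of_nonneg (by positivity : (0 : ℝ) ≤ |(p.1.1 : ℝ)| + |(p.1.2 : ℝ)|),
                abs_of_nonneg (by positivity : (0 : ℝ) ≤ 3 * |(p.1.1 : ℝ)|)]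
              linarith only [h2j]
            calc D * logPlus (|(p.1.1 : ℝ)| + |(p.1.2 : ℝ)|) ^ 2 ≤ D * logPlus (3 * |(p.1.1 : ℝ)|) ^ 2 :=
                  mul_le_mul_of_nonneg_left (pow_le_pow_left₀ (logPlus_nonneg _) hΛ 2) hD0
              _ ≤ |(p.1.1 : ℝ) - p.1.2| := not_lt.1 hnot
          · -- `|k| > 2|j|`: `|j − k| ≥ |k|/2 ≥ D log₊²(2|k|) ≥ D Λ₁²`
            have h2j' : 2 * |(p.1.1 : ℝ)| < |(p.1.2 : ℝ)| := not_le.1 h2j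
            have hΛ : logPlus (|(p.1.1 : ℝ)| + |(p.1.2 : ℝ)|) ≤ logPlus (2 * |(p.1.2 : ℝ)|) := by
              refine logPlus_mono ?_
              rw [abs_of_nonneg (by positivity : (0 : ℝ) ≤ |(p.1.1 : ℝ)| + |(p.1.2 : ℝ)|),
                abs_of_nonneg (by positivity : (0 : ℝ) ≤ 2 * |(p.1.2 : ℝ)|)]
              linarith only [h2j', abs_nonneg (p.1.1 : ℝ)]
            have hdist : |(p.1.2 : ℝ)| / 2 ≤ |(p.1.1 : ℝ) - p.1.2| := by
              have := abs_sub_abs_le_abs_sub (p.1.2 : ℝ) (p.1.1 : ℝ)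
              rw [abs_sub_comm (p.1.2 : ℝ)] at this
              linarith only [this, h2j', abs_nonneg (p.1.1 : ℝ)]
            calc D * logPlus (|(p.1.1 : ℝ)| + |(p.1.2 : ℝ)|) ^ 2 ≤ D * logPlus (2 * |(p.1.2 : ℝ)|) ^ 2 :=
                  mul_le_mul_of_nonneg_left (pow_le_pow_left₀ (logPlus_nonneg _) hΛ 2) hD0
              _ ≤ |(p.1.2 : ℝ)| / 2 := hfarA _ (hMT.trans hkM)
              _ ≤ |(p.1.1 : ℝ) - p.1.2| := hdist
        have h1 := one_div_abs_sub_deBruijnZeroZ_le_of_far hB'0 hCξ0 hC₁ h50Z hCξ hgap hj hk hjk hfar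
        have hΛle : logPlus (|(p.1.1 : ℝ)| + |(p.1.2 : ℝ)|) ≤ logPlus (p.1.1 : ℝ) + logPlus (p.1.2 : ℝ) := by
          rw [logPlus_eq, logPlus_eq, logPlus_eq,
            abs_of_nonneg (by positivity : (0 : ℝ) ≤ |(p.1.1 : ℝ)| + |(p.1.2 : ℝ)|),
            ← Real.log_mul (by positivity) (by positivity)]
          exact Real.log_le_log (by positivity)
            (by nlinarith only [abs_nonneg (p.1.1 : ℝ), abs_nonneg (p.1.2 : ℝ)])
        have h2 : 1 / |g| ≤ 2 * C₁ * (logPlus (p.1.1 : ℝ) + logPlus (p.1.2 : ℝ)) / |(p.1.1 : ℝ) - p.1.2| := by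
          rw [hg]
          refine h1.trans (div_le_div_of_nonneg_right ?_ (abs_nonneg _))
          exact mul_le_mul_of_nonneg_left hΛle (by positivity)
        have h3 : Lc * (truncWeight T p.1.1 * truncWeight T p.1.2 / |g|) ≤ Ln * Rfar := by
          rw [hRfar_eq]
          calc Lc * (truncWeight T p.1.1 * truncWeight T p.1.2 / |g|)
              = Lc * ((truncWeight T p.1.1 * truncWeight T p.1.2) * (1 / |g|)) := by ring
            _ ≤ Ln * ((truncWeight T p.1.1 * truncWeight T p.1.2) *
                  (2 * C₁ * (logPlus (p.1.1 : ℝ) + logPlus (p.1.2 : ℝ)) / |(p.1.1 : ℝ) - p.1.2|)) :=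
                mul_le_mul hLcLn (mul_le_mul_of_nonneg_left h2 hψψ0)
                  (mul_nonneg hψψ0 (div_nonneg zero_le_one (abs_nonneg _))) hLn0.le
            _ = _ := by ring
        have h4 : Ln * Rfar ≤ Ln * (0 * truncWeight T p.1.1 / (4 * η) + Rfar) := by
          rw [zero_mul, zero_div, zero_add]
        linarith only [h3, h4, hW0]
    · exact add_nonneg hW0 (hG0 _)
  -- ### rows of `G`
  have ha' : Real.log (2 + T * Real.log T) + 1 ≤ 4 * Real.log T := by
    have h1 : 2 + T * Real.log T ≤ T ^ 3 := by
      have : Real.log T ≤ T := (Real.log_le_sub_one_of_pos hT0).trans (by linarith only [hT3])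
      have hTT : T * Real.log T ≤ T * T := mul_le_mul_of_nonneg_left this hT0.le
      have h9 : (9 : ℝ) ≤ T * T := by nlinarith only [hT3]
      have h18 : (9 : ℝ) * 2 ≤ T * T * (T - 1) :=
        mul_le_mul h9 (by linarith only [hT3]) (by norm_num) (by positivity)
      nlinarith only [hTT, h18]
    have h2 : Real.log (2 + T * Real.log T) ≤ 3 * Real.log T := by
      have := Real.log_le_log (by positivity) h1
      rw [Real.log_pow] at this; push_cast at this; linarith only [this]
    linarith only [h2, hlog1]
  have hlog2 : (1 : ℝ) / 2 ≤ Real.log 2 := by have := Real.log_two_gt_d9; linarith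
  obtain ⟨Kr, hKr⟩ : ∃ Kr : ℝ, Kr = Ln * ((2 * D + 1) / η + 136 * C₁) := ⟨_, rfl⟩
  have hKr0 : 0 ≤ Kr := by rw [hKr]; positivity
  obtain ⟨Φ, hΦ⟩ : ∃ Φ : ℤ → ℝ, Φ = fun j : ℤ ↦
      Kr * (if M ≤ |(j : ℝ)| then truncWeight T j * logPlus (j : ℝ) ^ 2 else 0) := ⟨_, rfl⟩
  have hrow : ∀ j : ℤ, Summable (fun k : ℤ ↦ G (j, k)) ∧ ∑' k : ℤ, G (j, k) ≤ Φ j := by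
    intro j
    by_cases hjM : M ≤ |(j : ℝ)|
    · have hj1 : (1 : ℝ) ≤ |(j : ℝ)| := le_trans (by linarith only [hMT, hT3]) hjM
      have hj : j ≠ 0 := by
        intro h; rw [h] at hj1; norm_num at hj1
      have hjT : T ≤ |(j : ℝ)| := hMT.trans hjM
      have hψj := hψ0 j
      have hlpj : Real.log 2 ≤ logPlus (j : ℝ) := by
        rw [logPlus_eq]; exact Real.log_le_log two_pos (by linarith only [abs_nonneg (j : ℝ)])
      have hlp0 : 0 < logPlus (j : ℝ) := logPlus_pos _
      -- the three pieces
      obtain ⟨hsI, hI⟩ := tsum_nearInd_le j (L := D * logPlus (3 * |(j : ℝ)|) ^ 2) (by positivity)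
      obtain ⟨hs0, hB0⟩ := tsum_truncWeight_logPlus_pow_div_le hT3 (a := 0) (by norm_num) hj
      obtain ⟨hs1, hB1⟩ := tsum_truncWeight_logPlus_pow_div_le hT3 (a := 1) (by norm_num) hj
      simp only [pow_zero, mul_one, one_mul] at hs0 hB0
      simp only [pow_one] at hs1 hB1
      obtain ⟨a₁, ha₁⟩ : ∃ a₁ : ℝ, a₁ = Ln * truncWeight T j / (4 * η) := ⟨_, rfl⟩
      obtain ⟨a₂, ha₂⟩ : ∃ a₂ : ℝ, a₂ = Ln * (2 * C₁) * truncWeight T j * logPlus (j : ℝ) := ⟨_, rfl⟩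
      obtain ⟨a₃, ha₃⟩ : ∃ a₃ : ℝ, a₃ = Ln * (2 * C₁) * truncWeight T j := ⟨_, rfl⟩
      have ha₁0 : 0 ≤ a₁ := by rw [ha₁]; exact div_nonneg (mul_nonneg hLn0.le hψj) (by positivity)
      have ha₂0 : 0 ≤ a₂ := by rw [ha₂]; exact mul_nonneg (mul_nonneg (by positivity) hψj) hlp0.le
      have ha₃0 : 0 ≤ a₃ := by rw [ha₃]; exact mul_nonneg (by positivity) hψj
      have hGjk : ∀ k : ℤ, G (j, k) =
          a₁ * (if |(k : ℝ)| ≤ 2 * |(j : ℝ)| ∧ |(j : ℝ) - k| < D * logPlus (3 * |(j : ℝ)|) ^ 2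
                then (1 : ℝ) else 0) +
            a₂ * (truncWeight T k * (1 / |(j : ℝ) - k|)) +
            a₃ * (truncWeight T k * logPlus k * (1 / |(j : ℝ) - k|)) := by
        intro k
        rw [hG, ha₁, ha₂, ha₃]; dsimp only; rw [if_pos hjM]; ring
      have hsum : Summable (fun k : ℤ ↦ G (j, k)) :=
        (((hsI.mul_left a₁).add (hs0.mul_left a₂)).add (hs1.mul_left a₃)).congr fun k ↦ (hGjk k).symm
      refine ⟨hsum, ?_⟩
      have htsum : ∑' k : ℤ, G (j, k) =
          a₁ * ∑' k : ℤ, (if |(k : ℝ)| ≤ 2 * |(j : ℝ)| ∧ |(j : ℝ) - k| < D * logPlus (3 * |(j : ℝ)|) ^ 2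
                then (1 : ℝ) else 0) +
            a₂ * ∑' k : ℤ, truncWeight T k * (1 / |(j : ℝ) - k|) +
            a₃ * ∑' k : ℤ, truncWeight T k * logPlus k * (1 / |(j : ℝ) - k|) := by
        rw [tsum_congr hGjk, ((hsI.mul_left a₁).add (hs0.mul_left a₂)).tsum_add (hs1.mul_left a₃),
          (hsI.mul_left a₁).tsum_add (hs0.mul_left a₂), tsum_mul_left, tsum_mul_left, tsum_mul_left]
      rw [htsum, hΦ]; dsimp only; rw [if_pos hjM, hKr]
      -- elementary comparisons, all in terms of `lp := log₊ j`
      have hloglp : Real.log |(j : ℝ)| ≤ logPlus (j : ℝ) := by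
        rw [logPlus_eq]; exact Real.log_le_log (by linarith only [hj1]) (by linarith only [hj1])
      have hlogT : Real.log T ≤ logPlus (j : ℝ) := (Real.log_le_log hT0 hjT).trans hloglp
      have hlp3 : logPlus (3 * |(j : ℝ)|) ≤ 2 * logPlus (j : ℝ) := by
        rw [logPlus_eq, logPlus_eq, abs_of_nonneg (by positivity : (0:ℝ) ≤ 3 * |(j : ℝ)|),
          ← Real.log_rpow (by positivity), Real.rpow_two]
        exact Real.log_le_log (by positivity) (by nlinarith only [abs_nonneg (j : ℝ)])
      have hlp2j : logPlus (2 * |(j : ℝ)|) ≤ 2 * logPlus (j : ℝ) := by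
        have := logPlus_two_mul_le (abs_nonneg (j : ℝ)); rwa [logPlus_abs] at this
      have hNj : (1 / |(j : ℝ)|) * (10 * (T * Real.log T)) ≤ 10 * logPlus (j : ℝ) := by
        rw [div_mul_eq_mul_div, one_mul, div_le_iff₀ (by linarith only [hj1])]
        nlinarith only [hjT, hlogT, hlog0, hT0]
      have ha'0 : 0 ≤ Real.log (2 + T * Real.log T) + 1 := by
        have : 0 ≤ Real.log (2 + T * Real.log T) := Real.log_nonneg (by linarith only [hTlog])
        linarith only [this]
      have hNj' : (1 / |(j : ℝ)|) * ((Real.log (2 + T * Real.log T) + 1) * (10 * (T * Real.log T))) ≤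
          40 * logPlus (j : ℝ) ^ 2 := by
        rw [show (1 / |(j : ℝ)|) * ((Real.log (2 + T * Real.log T) + 1) * (10 * (T * Real.log T))) =
          (Real.log (2 + T * Real.log T) + 1) * ((1 / |(j : ℝ)|) * (10 * (T * Real.log T))) by ring]
        have h1 : Real.log (2 + T * Real.log T) + 1 ≤ 4 * logPlus (j : ℝ) :=
          ha'.trans (by linarith only [hlogT])
        calc (Real.log (2 + T * Real.log T) + 1) * ((1 / |(j : ℝ)|) * (10 * (T * Real.log T)))
            ≤ (4 * logPlus (j : ℝ)) * (10 * logPlus (j : ℝ)) :=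
              mul_le_mul h1 hNj (by positivity) (by positivity)
          _ = 40 * logPlus (j : ℝ) ^ 2 := by ring
      have hB0' : ∑' k : ℤ, truncWeight T k * (1 / |(j : ℝ) - k|) ≤ 16 * logPlus (j : ℝ) := by
        refine hB0.trans ?_
        nlinarith only [hloglp, hNj, hlpj, hlog2]
      have hB1' : ∑' k : ℤ, truncWeight T k * logPlus k * (1 / |(j : ℝ) - k|) ≤
          52 * logPlus (j : ℝ) ^ 2 := by
        refine hB1.trans ?_
        have h1 : logPlus (2 * |(j : ℝ)|) * (2 * (1 + Real.log |(j : ℝ)|)) ≤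
            (2 * logPlus (j : ℝ)) * (6 * logPlus (j : ℝ)) :=
          mul_le_mul hlp2j (by nlinarith only [hloglp, hlpj, hlog2])
            (by nlinarith only [hloglp, hlpj, hlog2, hj1, Real.log_nonneg hj1]) (by positivity)
        nlinarith only [h1, hNj']
      have hI' : ∑' k : ℤ, (if |(k : ℝ)| ≤ 2 * |(j : ℝ)| ∧ |(j : ℝ) - k| < D * logPlus (3 * |(j : ℝ)|) ^ 2
          then (1 : ℝ) else 0) ≤ (8 * D + 4) * logPlus (j : ℝ) ^ 2 := by
        refine hI.trans ?_
        have h1 : logPlus (3 * |(j : ℝ)|) ^ 2 ≤ (2 * logPlus (j : ℝ)) ^ 2 :=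
          pow_le_pow_left₀ (logPlus_nonneg _) hlp3 2
        nlinarith only [h1, hD0, hlpj, hlog2]
      -- assemble
      calc a₁ * ∑' k : ℤ, (if |(k : ℝ)| ≤ 2 * |(j : ℝ)| ∧ |(j : ℝ) - k| < D * logPlus (3 * |(j : ℝ)|) ^ 2
                then (1 : ℝ) else 0) +
            a₂ * ∑' k : ℤ, truncWeight T k * (1 / |(j : ℝ) - k|) +
            a₃ * ∑' k : ℤ, truncWeight T k * logPlus k * (1 / |(j : ℝ) - k|)
          ≤ a₁ * ((8 * D + 4) * logPlus (j : ℝ) ^ 2) + a₂ * (16 * logPlus (j : ℝ)) +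
            a₃ * (52 * logPlus (j : ℝ) ^ 2) :=
            add_le_add (add_le_add (mul_le_mul_of_nonneg_left hI' ha₁0)
              (mul_le_mul_of_nonneg_left hB0' ha₂0)) (mul_le_mul_of_nonneg_left hB1' ha₃0)
        _ = Ln * ((2 * D + 1) / η + 136 * C₁) * (truncWeight T j * logPlus (j : ℝ) ^ 2) := by
            rw [ha₁, ha₂, ha₃]; exact alg_five hη0.ne'
    · have hGz : ∀ k : ℤ, G (j, k) = 0 := fun k ↦ by
        rw [hG]; dsimp only; rw [if_neg hjM]
      refine ⟨(summable_zero).congr fun k ↦ (hGz k).symm, ?_⟩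
      rw [tsum_congr hGz, tsum_zero, hΦ]; dsimp only; rw [if_neg hjM, mul_zero]
  -- ### the tail `Σ_{|j| ≥ M} ψ_T(j) log₊² j`
  obtain ⟨hsψ2, -⟩ := RodgersTaoTruncEnergyExpansion.tsum_truncWeight_mul_logPlus_pow_le hT3
    (p := 2) (by norm_num)
  have hΦ0 : ∀ j, 0 ≤ Φ j := fun j ↦ by
    rw [hΦ]; dsimp only
    split_ifs
    · exact mul_nonneg hKr0 (mul_nonneg (hψ0 j) (sq_nonneg _))
    · rw [mul_zero]
  have hΦle : ∀ j, Φ j ≤ Kr * (truncWeight T j * logPlus j ^ 2) := fun j ↦ by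
    rw [hΦ]; dsimp only
    split_ifs
    · exact le_rfl
    · rw [mul_zero]; exact mul_nonneg hKr0 (mul_nonneg (hψ0 j) (sq_nonneg _))
  have hΦS : Summable Φ := (hsψ2.mul_left Kr).of_nonneg_of_le hΦ0 hΦle
  -- pointwise tail comparison: for `M ≤ |j|`, `ψ_T(j) log₊² j ≤ (a'+1)² (1+M/N₀)^{-96} (1+|j|/N₀)^{-2}`
  obtain ⟨ρ, hρ⟩ : ∃ ρ : ℝ, ρ = ((1 + M / (T * Real.log T)) ^ 96)⁻¹ := ⟨_, rfl⟩
  have hρ0 : 0 ≤ ρ := by rw [hρ]; positivity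
  have htailpt : ∀ j : ℤ, (if M ≤ |(j : ℝ)| then truncWeight T j * logPlus j ^ 2 else 0) ≤
      (Real.log (2 + T * Real.log T) + 1) ^ 2 * ρ * ((1 + |(j : ℝ)| / (T * Real.log T)) ^ 2)⁻¹ := by
    intro j
    split_ifs with hjM
    · have h1 := truncWeight_mul_logPlus_pow_le hTlog (p := 2) (by norm_num) j
      have hu : M / (T * Real.log T) ≤ |(j : ℝ)| / (T * Real.log T) :=
        div_le_div_of_nonneg_right hjM hTlog.le
      have h2 : ((1 + |(j : ℝ)| / (T * Real.log T)) ^ (100 - 2))⁻¹ ≤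
          ρ * ((1 + |(j : ℝ)| / (T * Real.log T)) ^ 2)⁻¹ := by
        rw [hρ, ← mul_inv, show (100 - 2 : ℕ) = 96 + 2 by norm_num, pow_add]
        refine inv_anti₀ (by positivity) (mul_le_mul_of_nonneg_right ?_ (by positivity))
        exact pow_le_pow_left₀ (by positivity) (by linarith only [hu]) 96
      calc truncWeight T j * logPlus (j : ℝ) ^ 2
          ≤ (Real.log (2 + T * Real.log T) + 1) ^ 2 * ((1 + |(j : ℝ)| / (T * Real.log T)) ^ (100 - 2))⁻¹ := h1
        _ ≤ (Real.log (2 + T * Real.log T) + 1) ^ 2 * (ρ * ((1 + |(j : ℝ)| / (T * Real.log T)) ^ 2)⁻¹) :=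
            mul_le_mul_of_nonneg_left h2 (by positivity)
        _ = _ := by ring
    · positivity
  obtain ⟨hsq2, hq2⟩ := summable_psiZq hN₀1 (q := 2) le_rfl
  have htail : ∑' j : ℤ, Φ j ≤ Kr * ((Real.log (2 + T * Real.log T) + 1) ^ 2 * ρ * (10 * (T * Real.log T))) := by
    have hs3 : Summable (fun j : ℤ ↦ Kr * ((Real.log (2 + T * Real.log T) + 1) ^ 2 * ρ *
        ((1 + |(j : ℝ)| / (T * Real.log T)) ^ 2)⁻¹)) := (hsq2.mul_left _).mul_left Kr
    have hle : ∀ j, Φ j ≤ Kr * ((Real.log (2 + T * Real.log T) + 1) ^ 2 * ρ *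
        ((1 + |(j : ℝ)| / (T * Real.log T)) ^ 2)⁻¹) := fun j ↦ by
      rw [hΦ]; dsimp only
      exact mul_le_mul_of_nonneg_left (htailpt j) hKr0
    calc ∑' j : ℤ, Φ j ≤ ∑' j : ℤ, Kr * ((Real.log (2 + T * Real.log T) + 1) ^ 2 * ρ *
          ((1 + |(j : ℝ)| / (T * Real.log T)) ^ 2)⁻¹) := hΦS.tsum_le_tsum hle hs3
      _ = Kr * ((Real.log (2 + T * Real.log T) + 1) ^ 2 * ρ *
          ∑' j : ℤ, ((1 + |(j : ℝ)| / (T * Real.log T)) ^ 2)⁻¹) := by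
          rw [tsum_mul_left, tsum_mul_left]
      _ ≤ _ := mul_le_mul_of_nonneg_left (mul_le_mul_of_nonneg_left hq2 (by positivity)) hKr0
  -- ### summability of `G` on `ℤ × ℤ` and the bound on its sum
  have hrows : Summable (fun j : ℤ ↦ ∑' k : ℤ, G (j, k)) :=
    hΦS.of_nonneg_of_le (fun j ↦ tsum_nonneg fun k ↦ hG0 _) fun j ↦ (hrow j).2
  have hGS : Summable G := (summable_prod_of_nonneg hG0).2 ⟨fun j ↦ (hrow j).1, hrows⟩
  have hGle : ∑' q : ℤ × ℤ, G q ≤ Kr * ((Real.log (2 + T * Real.log T) + 1) ^ 2 * ρ * (10 * (T * Real.log T))) :=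
    calc ∑' q : ℤ × ℤ, G q = ∑' j : ℤ, ∑' k : ℤ, G (j, k) := hGS.tsum_prod' fun j ↦ (hrow j).1
      _ ≤ ∑' j : ℤ, Φ j := hrows.tsum_le_tsum (fun j ↦ (hrow j).2) hΦS
      _ ≤ _ := htail
  -- ### summability of `F` and the `tsum` bound
  obtain ⟨hWs, hWle⟩ := hEi T hTi t hs
  have hGS' : Summable (fun p : zstarOffDiag ↦ G p.1) := hGS.subtype _
  have hmajS : Summable (fun p : zstarOffDiag ↦
      Ln * η * (truncWeight T p.1.1 * truncWeight T p.1.2 * interactionEnergy t p.1.1 p.1.2) + G p.1) :=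
    (hWs.mul_left (Ln * η)).add hGS'
  have hFS : Summable F := hmajS.of_nonneg_of_le hF0 hpt
  refine ⟨hFS, ?_⟩
  rw [abs_of_nonneg (tsum_nonneg hF0)]
  have h1 : ∑' p, F p ≤ Ln * η * ∑' p : zstarOffDiag,
      (truncWeight T p.1.1 * truncWeight T p.1.2 * interactionEnergy t p.1.1 p.1.2) +
        ∑' p : zstarOffDiag, G p.1 := by
    have hW2 : Summable (fun p : zstarOffDiag ↦ Ln * η *
        (truncWeight T p.1.1 * truncWeight T p.1.2 * interactionEnergy t p.1.1 p.1.2)) :=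
      hWs.mul_left (Ln * η)
    have e1 := hW2.tsum_add hGS'
    have e2 : ∑' p : zstarOffDiag, Ln * η *
        (truncWeight T p.1.1 * truncWeight T p.1.2 * interactionEnergy t p.1.1 p.1.2) =
        Ln * η * ∑' p : zstarOffDiag,
          (truncWeight T p.1.1 * truncWeight T p.1.2 * interactionEnergy t p.1.1 p.1.2) :=
      tsum_mul_left
    have e3 := hFS.tsum_le_tsum hpt hmajS
    linarith only [e1, e2, e3]
  have h2 : ∑' p : zstarOffDiag, G p.1 ≤ ∑' q : ℤ × ℤ, G q := Summable.tsum_subtype_le G zstarOffDiag hG0 hGS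
  have hb1 : Ln * η * ∑' p : zstarOffDiag,
      (truncWeight T p.1.1 * truncWeight T p.1.2 * interactionEnergy t p.1.1 p.1.2) ≤ ε / 2 * X := by
    rw [hLnη]
    have key : (truncEnergy T t + Ci * (T * Real.log T ^ 3)) / A ≤ X / 2 := by
      rw [div_le_div_iff₀ hA0 two_pos, hA, hX]
      nlinarith only [hCi0, hE0, hTL0]
    calc ε / A * ∑' p : zstarOffDiag,
          (truncWeight T p.1.1 * truncWeight T p.1.2 * interactionEnergy t p.1.1 p.1.2)
        ≤ ε / A * (truncEnergy T t + Ci * (T * Real.log T ^ 3)) :=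
          mul_le_mul_of_nonneg_left hWle (by positivity)
      _ = ε * ((truncEnergy T t + Ci * (T * Real.log T ^ 3)) / A) := by ring
      _ ≤ ε * (X / 2) := mul_le_mul_of_nonneg_left key hε.le
      _ = ε / 2 * X := by ring
  -- ### the numerical estimate of the `G`-part
  have hb2 : Kr * ((Real.log (2 + T * Real.log T) + 1) ^ 2 * ρ * (10 * (T * Real.log T))) ≤ ε / 2 * X := by
    -- `ρ ≤ (log T / T^c)^96`
    have hρle : ρ ≤ (Real.log T / T ^ c) ^ 96 := by
      rw [hρ]
      have h1 : Real.log T / T ^ c ≠ 0 := (div_pos hlog0 hTc0).ne'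
      have h2 : M / (T * Real.log T) = (Real.log T / T ^ c)⁻¹ := by
        rw [hMeq, inv_div, mul_div_mul_left _ _ hT0.ne']
      rw [← inv_pow]
      refine pow_le_pow_left₀ (by positivity) ?_ 96
      have hy : 0 < Real.log T / T ^ c := div_pos hlog0 hTc0
      calc (1 + M / (T * Real.log T))⁻¹ = (1 + (Real.log T / T ^ c)⁻¹)⁻¹ := by rw [h2]
        _ ≤ ((Real.log T / T ^ c)⁻¹)⁻¹ :=
            inv_anti₀ (inv_pos.2 hy) (le_add_of_nonneg_left zero_le_one)
        _ = Real.log T / T ^ c := inv_inv _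
    -- `Kr ≤ Ln² · K₄/160`
    have hKrle : Kr ≤ Ln ^ 2 * (K₄ / 160) := by
      rw [hKr, hK₄, hη]
      have e : Ln * ((2 * D + 1) / (ε / (A * Ln)) + 136 * C₁) =
          Ln ^ 2 * ((2 * D + 1) * A / ε) + Ln * (136 * C₁) := alg_six hε.ne' hLn0.ne'
      rw [e, show (160 : ℝ) * ((2 * D + 1) * A / ε + 136 * C₁) / 160 = (2 * D + 1) * A / ε + 136 * C₁ by ring,
        mul_add]
      have : Ln * (136 * C₁) ≤ Ln ^ 2 * (136 * C₁) := by
        have : Ln ≤ Ln ^ 2 := by nlinarith only [hLn1]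
        exact mul_le_mul_of_nonneg_right this (by positivity)
      linarith only [this]
    have ha2 : (Real.log (2 + T * Real.log T) + 1) ^ 2 ≤ 16 * Real.log T ^ 2 := by
      have h0 : 0 ≤ Real.log (2 + T * Real.log T) + 1 := by
        have : 0 ≤ Real.log (2 + T * Real.log T) := Real.log_nonneg (by linarith only [hTlog])
        linarith only [this]
      nlinarith only [ha', h0]
    have hTa1 := hTa T hTa'
    have hpow : T ^ (96 * c) = (T ^ c) ^ 96 := by
      rw [show (96 : ℝ) * c = c * ((96 : ℕ) : ℝ) by push_cast; ring, Real.rpow_mul hT0.le, Real.rpow_natCast]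
    rw [hpow] at hTa1
    have hmain : Kr * ((Real.log (2 + T * Real.log T) + 1) ^ 2 * ρ * (10 * (T * Real.log T))) ≤
        (Ln ^ 2 * (K₄ / 160)) * ((16 * Real.log T ^ 2) * (Real.log T / T ^ c) ^ 96 * (10 * (T * Real.log T))) := by
      refine mul_le_mul hKrle ?_ (by positivity) (by positivity)
      exact mul_le_mul_of_nonneg_right (mul_le_mul ha2 hρle hρ0 (by positivity)) (by positivity)
    have hid : (Ln ^ 2 * (K₄ / 160)) * ((16 * Real.log T ^ 2) * (Real.log T / T ^ c) ^ 96 * (10 * (T * Real.log T))) =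
        K₄ * (Real.log T ^ (2 * n + 99) / (T ^ c) ^ 96) * T := by
      have h := alg_seven (Ln := Ln) (K₄ := K₄) (L := Real.log T) (T := T) hTc0.ne'
      have hn2 : n * 2 + 99 = 2 * n + 99 := by omega
      rw [h, hLn, ← pow_mul, ← pow_add, hn2]
    have hfin : K₄ * (Real.log T ^ (2 * n + 99) / (T ^ c) ^ 96) * T ≤ ε / 2 * T := by
      refine mul_le_mul_of_nonneg_right ?_ hT0.le
      rw [mul_div_assoc', div_le_iff₀ (by positivity)]
      calc K₄ * Real.log T ^ (2 * n + 99) ≤ K₄ * (ε / (2 * K₄) * (T ^ c) ^ 96) :=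
            mul_le_mul_of_nonneg_left hTa1 hK₄0.le
        _ = ε / 2 * (T ^ c) ^ 96 := alg_eight hK₄0.ne'
    calc _ ≤ _ := hmain
      _ = _ := hid
      _ ≤ ε / 2 * T := hfin
      _ ≤ ε / 2 * X := mul_le_mul_of_nonneg_left hTX (by positivity)
  linarith only [h1, h2, hGle, hb1, hb2]


/-- **Rodgers–Tao 2020, Lemma 21 (iv), printed witness form — CONTENT proof from the as-printed
location law.** `RodgersTao2020.cor33_location` (Cor. 10 (50), CONTENT-proved in the tree as
`RodgersTao2020.cor33_location_content`) implies conjunct (iv) of `rodgers_tao_moderatelySized t₀`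
for every `t₀ < 0` with `H_{t₀}` real-rooted. The ex-falso record `rodgers_tao_moderatelySized_holds`
is untouched. [cite: RodgersTaoFMP2020, Lemma 21 (iv) p. 47 (= arXiv:1801.05914v4 Lemma 7.6 (iv)); Cor. 10 (50) p. 23] -/
theorem rodgers_tao_negligible_iv_of_cor33_location (h50 : RodgersTao2020.cor33_location) :
    ∀ t₀ : ℝ, t₀ < 0 → HasOnlyRealZeros (deBruijnH t₀) → ∀ C c : ℝ, 0 < C → 0 < c →
      IsNegligible t₀ (fun T t p ↦
        if T ^ (1 + c) ≤ |(p.1.1 : ℝ)| ∧ T ^ (1 + c) ≤ |(p.1.2 : ℝ)| then Real.log T ^ C *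
          (truncWeight T p.1.1 * truncWeight T p.1.2 /
            |deBruijnZeroZ t p.1.1 - deBruijnZeroZ t p.1.2|)
        else 0) := by
  intro t₀ ht₀ hreal C c _ hc
  obtain ⟨A50, hA50⟩ := h50
  have H2 : ∀ t ∈ Icc (t₀ / 2) 0, ∀ n : ℕ, 1 ≤ n →
      |deBruijnZero t n - classicalLocation (n : ℝ)| ≤ A50 * logPlus (classicalLocation (n : ℝ)) :=
    fun t ht n hn ↦ hA50 t ⟨t₀, by linarith [ht.1], hreal⟩ ht.2 n hn
  exact rodgers_tao_negligible_iv_of_location ⟨t₀, by linarith, hreal⟩ H2 (C := C) hc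


/-! ## Lemma 21 (iv), `ξ`-clause: pairs with `|j|, |k| ≥ T^{1+c}` and `ξ_i` in place of `x_i(t)` -/

open RodgersTaoNegligibleSums in
/-- **Rodgers–Tao 2020, Lemma 21 (iv) with `ξ_i` in place of `x_i(t)` — RH-FREE CONTENT twin.**
For every `t₀` whose window `[t₀/2, 0]` lies above a real-rooted time `t₁ < t₀/2` (only used to make
`T log³ T + Ẽ_T(t)` a legitimate majorant, `Ẽ_T(t) ≥ 0`) and all `C`, `c > 0`, the restricted sum
`(log^C T) Σ_{|j|,|k| ≥ T^{1+c}, j ≠ k} ψ_T(j)ψ_T(k)/|ξ_j − ξ_k|` is negligible (`IsNegligible t₀`) —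
conjunct (iv) of `rodgers_tao_moderatelySized_xi t₀` BY CONTENT. The `ξ`-sum does not depend on `t`
and needs no location law and no near/far split: the gap bound (44)
`1/|ξ_j − ξ_k| ≤ C₁ log₊(|j|+|k|)/|j − k| ≤ C₁ (log₊ j + log₊ k)/|j − k|`
(`exists_inv_abs_sub_classicalLocationZ_le`) for all pairs, the row sums with the harmonic kernel
(`tsum_truncWeight_logPlus_pow_div_le`, each row `≤ 68 C₁ log^{⌈C⌉} T · ψ_T(j) log₊² j`) and the
`ψ_T`-tail `Σ_{|j| ≥ T^{1+c}} ψ_T(j) log₊² j ≤ (log(2 + T log T) + 1)² (1 + T^c/log T)^{−96} 10 T log T`,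
i.e. `≲ log^{2⌈C⌉+99} T · T^{1−96c} = o(T)`; valid for ALL `c > 0`.
[cite: RodgersTaoFMP2020, Lemma 21 (iv) p. 47 («similarly if the x_i are replaced by ξ_i»); proof p. 48] -/
theorem rodgers_tao_negligible_xi_iv {t₀ : ℝ}
    (hreal : ∃ t₁ : ℝ, t₁ < t₀ / 2 ∧ HasOnlyRealZeros (deBruijnH t₁)) {C c : ℝ} (hc : 0 < c) :
    IsNegligible t₀ (fun T _ p ↦
      if T ^ (1 + c) ≤ |(p.1.1 : ℝ)| ∧ T ^ (1 + c) ≤ |(p.1.2 : ℝ)| then Real.log T ^ C *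
        (truncWeight T p.1.1 * truncWeight T p.1.2 /
          |classicalLocationZ p.1.1 - classicalLocationZ p.1.2|)
      else 0) := by
  classical
  obtain ⟨t₁, ht₁, hreal₁⟩ := hreal
  obtain ⟨C₁, hC₁, hgap⟩ := exists_inv_abs_sub_classicalLocationZ_le
  obtain ⟨n, hn⟩ : ∃ n : ℕ, n = ⌈C⌉₊ := ⟨_, rfl⟩
  intro ε hε
  -- the constant of the row bound and the threshold
  obtain ⟨K₄, hK₄⟩ : ∃ K₄ : ℝ, K₄ = 160 * (68 * C₁) := ⟨_, rfl⟩
  have hK₄0 : 0 < K₄ := by rw [hK₄]; positivity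
  obtain ⟨Ta, hTa⟩ := exists_forall_log_pow_le (2 * n + 99) (c := 96 * c)
    (by positivity) (show 0 < ε / (2 * K₄) by positivity)
  refine ⟨max 3 Ta, fun T hT t ht1 _ _ ↦ ?_⟩
  have hT3 : 3 ≤ T := le_trans (le_max_left _ _) hT
  have hTa' : Ta ≤ T := le_trans (le_max_right _ _) hT
  have hT0 : 0 < T := by linarith only [hT3]
  have hT1 : 1 ≤ T := by linarith only [hT3]
  have hlog1 : 1 ≤ Real.log T :=
    one_le_log_three.trans (Real.log_le_log (by norm_num) hT3)
  have hlog0 : 0 < Real.log T := by linarith only [hlog1]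
  have hTlog : 0 < T * Real.log T := mul_pos hT0 hlog0
  have hN₀1 : 1 ≤ T * Real.log T := by nlinarith only [hT3, hlog1]
  have hΛt : ∃ t₁' : ℝ, t₁' < t ∧ HasOnlyRealZeros (deBruijnH t₁') :=
    ⟨t₁, by linarith only [ht₁, ht1], hreal₁⟩
  have hmono := strictMono_deBruijnZeroZ hΛt
  have hE0 : 0 ≤ truncEnergy T t := truncEnergy_nonneg hTlog hmono
  set X : ℝ := T * Real.log T ^ 3 + truncEnergy T t with hX
  have hTX : T ≤ X := by
    have : T * 1 ≤ T * Real.log T ^ 3 := mul_le_mul_of_nonneg_left (one_le_pow₀ hlog1) hT0.le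
    linarith only [this, hE0, hX]
  set M : ℝ := T ^ (1 + c) with hM
  have hMT : T ≤ M := by
    rw [hM]
    conv_lhs => rw [← Real.rpow_one T]
    exact Real.rpow_le_rpow_of_exponent_le hT1 (by linarith only [hc])
  have hMeq : M = T * T ^ c := by rw [hM, Real.rpow_add hT0, Real.rpow_one]
  have hTc0 : 0 < T ^ c := Real.rpow_pos_of_pos hT0 _
  set Lc : ℝ := Real.log T ^ C with hLc
  obtain ⟨Ln, hLn⟩ : ∃ Ln : ℝ, Ln = Real.log T ^ n := ⟨_, rfl⟩
  have hLc0 : 0 ≤ Lc := Real.rpow_nonneg hlog0.le _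
  have hLcLn : Lc ≤ Ln := by
    rw [hLc, hLn, ← Real.rpow_natCast, hn]
    exact Real.rpow_le_rpow_of_exponent_le hlog1 (Nat.le_ceil C)
  have hLn1 : 1 ≤ Ln := by rw [hLn]; exact one_le_pow₀ hlog1
  have hLn0 : 0 < Ln := by linarith only [hLn1]
  set F : zstarOffDiag → ℝ := fun p ↦
    if M ≤ |(p.1.1 : ℝ)| ∧ M ≤ |(p.1.2 : ℝ)| then Lc *
      (truncWeight T p.1.1 * truncWeight T p.1.2 /
        |classicalLocationZ p.1.1 - classicalLocationZ p.1.2|)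
    else 0 with hF
  show Summable F ∧ |∑' p, F p| ≤ ε * X
  have hψ0 : ∀ j : ℤ, 0 ≤ truncWeight T j := fun j ↦ (truncWeight_pos hTlog j).le
  have hF0 : ∀ p, 0 ≤ F p := fun p ↦ by
    simp only [hF]
    split_ifs
    · exact mul_nonneg hLc0 (div_nonneg (mul_nonneg (hψ0 _) (hψ0 _)) (abs_nonneg _))
    · exact le_rfl
  -- the majorant `G` on `ℤ × ℤ`
  obtain ⟨G, hG⟩ : ∃ G : ℤ × ℤ → ℝ, G = fun q ↦ if M ≤ |(q.1 : ℝ)| then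
      Ln * (C₁ * truncWeight T q.1 * (truncWeight T q.2 * (1 / |(q.1 : ℝ) - q.2|)) *
          logPlus q.1 +
        C₁ * truncWeight T q.1 * (truncWeight T q.2 * logPlus q.2 * (1 / |(q.1 : ℝ) - q.2|)))
      else 0 := ⟨_, rfl⟩
  have hG0 : ∀ q, 0 ≤ G q := fun q ↦ by
    have h1 : 0 ≤ logPlus (q.1 : ℝ) := logPlus_nonneg _
    have h2 : 0 ≤ logPlus (q.2 : ℝ) := logPlus_nonneg _
    have h3 := hψ0 q.1
    have h4 := hψ0 q.2
    have h5 : 0 ≤ 1 / |(q.1 : ℝ) - q.2| := by positivity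
    rw [hG]; dsimp only
    split_ifs
    · exact mul_nonneg hLn0.le (add_nonneg
        (mul_nonneg (mul_nonneg (mul_nonneg hC₁.le h3) (mul_nonneg h4 h5)) h1)
        (mul_nonneg (mul_nonneg hC₁.le h3) (mul_nonneg (mul_nonneg h4 h2) h5)))
    · exact le_rfl
  -- pointwise comparison on the subtype
  have hpt : ∀ p : zstarOffDiag, F p ≤ G p.1 := by
    intro p
    obtain ⟨hj, hk, -⟩ := mem_zstarOffDiag.1 p.2
    simp only [hF]
    split_ifs with hbox
    · have hψψ0 : 0 ≤ truncWeight T p.1.1 * truncWeight T p.1.2 := mul_nonneg (hψ0 _) (hψ0 _)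
      have hGp : G p.1 = Ln * ((truncWeight T p.1.1 * truncWeight T p.1.2) *
          (C₁ * (logPlus (p.1.1 : ℝ) + logPlus (p.1.2 : ℝ)) / |(p.1.1 : ℝ) - p.1.2|)) := by
        rw [hG]; dsimp only; rw [if_pos hbox.1]; ring
      rw [hGp]
      have hΛle : logPlus (|(p.1.1 : ℝ)| + |(p.1.2 : ℝ)|) ≤
          logPlus (p.1.1 : ℝ) + logPlus (p.1.2 : ℝ) := by
        rw [logPlus_eq, logPlus_eq, logPlus_eq,
          abs_of_nonneg (by positivity : (0 : ℝ) ≤ |(p.1.1 : ℝ)| + |(p.1.2 : ℝ)|),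
          ← Real.log_mul (by positivity) (by positivity)]
        exact Real.log_le_log (by positivity)
          (by nlinarith only [abs_nonneg (p.1.1 : ℝ), abs_nonneg (p.1.2 : ℝ)])
      have h2 : 1 / |classicalLocationZ p.1.1 - classicalLocationZ p.1.2| ≤
          C₁ * (logPlus (p.1.1 : ℝ) + logPlus (p.1.2 : ℝ)) / |(p.1.1 : ℝ) - p.1.2| := by
        refine (hgap _ _ hj hk).trans ?_
        rw [mul_div_assoc]
        exact mul_le_mul_of_nonneg_left
          (div_le_div_of_nonneg_right hΛle (abs_nonneg _)) hC₁.le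
      calc Lc * (truncWeight T p.1.1 * truncWeight T p.1.2 /
            |classicalLocationZ p.1.1 - classicalLocationZ p.1.2|)
          = Lc * ((truncWeight T p.1.1 * truncWeight T p.1.2) *
              (1 / |classicalLocationZ p.1.1 - classicalLocationZ p.1.2|)) := by ring
        _ ≤ Ln * ((truncWeight T p.1.1 * truncWeight T p.1.2) *
              (C₁ * (logPlus (p.1.1 : ℝ) + logPlus (p.1.2 : ℝ)) / |(p.1.1 : ℝ) - p.1.2|)) :=
            mul_le_mul hLcLn (mul_le_mul_of_nonneg_left h2 hψψ0)
              (mul_nonneg hψψ0 (div_nonneg zero_le_one (abs_nonneg _))) hLn0.le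
    · exact hG0 _
  -- ### rows of `G`
  have ha' : Real.log (2 + T * Real.log T) + 1 ≤ 4 * Real.log T := by
    have h1 : 2 + T * Real.log T ≤ T ^ 3 := by
      have : Real.log T ≤ T := (Real.log_le_sub_one_of_pos hT0).trans (by linarith only [hT3])
      have hTT : T * Real.log T ≤ T * T := mul_le_mul_of_nonneg_left this hT0.le
      have h9 : (9 : ℝ) ≤ T * T := by nlinarith only [hT3]
      have h18 : (9 : ℝ) * 2 ≤ T * T * (T - 1) :=
        mul_le_mul h9 (by linarith only [hT3]) (by norm_num) (by positivity)
      nlinarith only [hTT, h18]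
    have h2 : Real.log (2 + T * Real.log T) ≤ 3 * Real.log T := by
      have := Real.log_le_log (by positivity) h1
      rw [Real.log_pow] at this; push_cast at this; linarith only [this]
    linarith only [h2, hlog1]
  have hlog2 : (1 : ℝ) / 2 ≤ Real.log 2 := by have := Real.log_two_gt_d9; linarith
  obtain ⟨Kr, hKr⟩ : ∃ Kr : ℝ, Kr = Ln * (68 * C₁) := ⟨_, rfl⟩
  have hKr0 : 0 ≤ Kr := by rw [hKr]; positivity
  obtain ⟨Φ, hΦ⟩ : ∃ Φ : ℤ → ℝ, Φ = fun j : ℤ ↦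
      Kr * (if M ≤ |(j : ℝ)| then truncWeight T j * logPlus (j : ℝ) ^ 2 else 0) := ⟨_, rfl⟩
  have hrow : ∀ j : ℤ, Summable (fun k : ℤ ↦ G (j, k)) ∧ ∑' k : ℤ, G (j, k) ≤ Φ j := by
    intro j
    by_cases hjM : M ≤ |(j : ℝ)|
    · have hj1 : (1 : ℝ) ≤ |(j : ℝ)| := le_trans (by linarith only [hMT, hT3]) hjM
      have hj : j ≠ 0 := by
        intro h; rw [h] at hj1; norm_num at hj1
      have hjT : T ≤ |(j : ℝ)| := hMT.trans hjM
      have hψj := hψ0 j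
      have hlpj : Real.log 2 ≤ logPlus (j : ℝ) := by
        rw [logPlus_eq]; exact Real.log_le_log two_pos (by linarith only [abs_nonneg (j : ℝ)])
      have hlp0 : 0 < logPlus (j : ℝ) := logPlus_pos _
      -- the two pieces
      obtain ⟨hs0, hB0⟩ :=
        tsum_truncWeight_logPlus_pow_div_le hT3 (a := 0) (by norm_num) hj
      obtain ⟨hs1, hB1⟩ :=
        tsum_truncWeight_logPlus_pow_div_le hT3 (a := 1) (by norm_num) hj
      simp only [pow_zero, mul_one, one_mul] at hs0 hB0
      simp only [pow_one] at hs1 hB1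
      obtain ⟨a₂, ha₂⟩ : ∃ a₂ : ℝ, a₂ = Ln * C₁ * truncWeight T j * logPlus (j : ℝ) := ⟨_, rfl⟩
      obtain ⟨a₃, ha₃⟩ : ∃ a₃ : ℝ, a₃ = Ln * C₁ * truncWeight T j := ⟨_, rfl⟩
      have ha₂0 : 0 ≤ a₂ := by rw [ha₂]; exact mul_nonneg (mul_nonneg (by positivity) hψj) hlp0.le
      have ha₃0 : 0 ≤ a₃ := by rw [ha₃]; exact mul_nonneg (by positivity) hψj
      have hGjk : ∀ k : ℤ, G (j, k) =
          a₂ * (truncWeight T k * (1 / |(j : ℝ) - k|)) +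
            a₃ * (truncWeight T k * logPlus k * (1 / |(j : ℝ) - k|)) := by
        intro k
        rw [hG, ha₂, ha₃]; dsimp only; rw [if_pos hjM]; ring
      have hsum : Summable (fun k : ℤ ↦ G (j, k)) :=
        ((hs0.mul_left a₂).add (hs1.mul_left a₃)).congr fun k ↦ (hGjk k).symm
      refine ⟨hsum, ?_⟩
      have htsum : ∑' k : ℤ, G (j, k) =
          a₂ * ∑' k : ℤ, truncWeight T k * (1 / |(j : ℝ) - k|) +
            a₃ * ∑' k : ℤ, truncWeight T k * logPlus k * (1 / |(j : ℝ) - k|) := by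
        rw [tsum_congr hGjk, (hs0.mul_left a₂).tsum_add (hs1.mul_left a₃), tsum_mul_left,
          tsum_mul_left]
      rw [htsum, hΦ]; dsimp only; rw [if_pos hjM, hKr]
      -- elementary comparisons, all in terms of `lp := log₊ j`
      have hloglp : Real.log |(j : ℝ)| ≤ logPlus (j : ℝ) := by
        rw [logPlus_eq]; exact Real.log_le_log (by linarith only [hj1]) (by linarith only [hj1])
      have hlogT : Real.log T ≤ logPlus (j : ℝ) := (Real.log_le_log hT0 hjT).trans hloglp
      have hlp2j : logPlus (2 * |(j : ℝ)|) ≤ 2 * logPlus (j : ℝ) := by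
        have := logPlus_two_mul_le (abs_nonneg (j : ℝ)); rwa [logPlus_abs] at this
      have hNj : (1 / |(j : ℝ)|) * (10 * (T * Real.log T)) ≤ 10 * logPlus (j : ℝ) := by
        rw [div_mul_eq_mul_div, one_mul, div_le_iff₀ (by linarith only [hj1])]
        nlinarith only [hjT, hlogT, hlog0, hT0]
      have hNj' : (1 / |(j : ℝ)|) * ((Real.log (2 + T * Real.log T) + 1) * (10 * (T * Real.log T))) ≤
          40 * logPlus (j : ℝ) ^ 2 := by
        rw [show (1 / |(j : ℝ)|) * ((Real.log (2 + T * Real.log T) + 1) * (10 * (T * Real.log T))) =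
          (Real.log (2 + T * Real.log T) + 1) * ((1 / |(j : ℝ)|) * (10 * (T * Real.log T))) by ring]
        have h1 : Real.log (2 + T * Real.log T) + 1 ≤ 4 * logPlus (j : ℝ) :=
          ha'.trans (by linarith only [hlogT])
        calc (Real.log (2 + T * Real.log T) + 1) * ((1 / |(j : ℝ)|) * (10 * (T * Real.log T)))
            ≤ (4 * logPlus (j : ℝ)) * (10 * logPlus (j : ℝ)) :=
              mul_le_mul h1 hNj (by positivity) (by positivity)
          _ = 40 * logPlus (j : ℝ) ^ 2 := by ring
      have hB0' : ∑' k : ℤ, truncWeight T k * (1 / |(j : ℝ) - k|) ≤ 16 * logPlus (j : ℝ) := by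
        refine hB0.trans ?_
        nlinarith only [hloglp, hNj, hlpj, hlog2]
      have hB1' : ∑' k : ℤ, truncWeight T k * logPlus k * (1 / |(j : ℝ) - k|) ≤
          52 * logPlus (j : ℝ) ^ 2 := by
        refine hB1.trans ?_
        have h1 : logPlus (2 * |(j : ℝ)|) * (2 * (1 + Real.log |(j : ℝ)|)) ≤
            (2 * logPlus (j : ℝ)) * (6 * logPlus (j : ℝ)) :=
          mul_le_mul hlp2j (by nlinarith only [hloglp, hlpj, hlog2])
            (by nlinarith only [hloglp, hlpj, hlog2, hj1, Real.log_nonneg hj1]) (by positivity)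
        nlinarith only [h1, hNj']
      -- assemble
      calc a₂ * ∑' k : ℤ, truncWeight T k * (1 / |(j : ℝ) - k|) +
            a₃ * ∑' k : ℤ, truncWeight T k * logPlus k * (1 / |(j : ℝ) - k|)
          ≤ a₂ * (16 * logPlus (j : ℝ)) + a₃ * (52 * logPlus (j : ℝ) ^ 2) :=
            add_le_add (mul_le_mul_of_nonneg_left hB0' ha₂0) (mul_le_mul_of_nonneg_left hB1' ha₃0)
        _ = Ln * (68 * C₁) * (truncWeight T j * logPlus (j : ℝ) ^ 2) := by
            rw [ha₂, ha₃]; ring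
    · have hGz : ∀ k : ℤ, G (j, k) = 0 := fun k ↦ by
        rw [hG]; dsimp only; rw [if_neg hjM]
      refine ⟨(summable_zero).congr fun k ↦ (hGz k).symm, ?_⟩
      rw [tsum_congr hGz, tsum_zero, hΦ]; dsimp only; rw [if_neg hjM, mul_zero]
  -- ### the tail `Σ_{|j| ≥ M} ψ_T(j) log₊² j`
  obtain ⟨hsψ2, -⟩ := RodgersTaoTruncEnergyExpansion.tsum_truncWeight_mul_logPlus_pow_le hT3
    (p := 2) (by norm_num)
  have hΦ0 : ∀ j, 0 ≤ Φ j := fun j ↦ by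
    rw [hΦ]; dsimp only
    split_ifs
    · exact mul_nonneg hKr0 (mul_nonneg (hψ0 j) (sq_nonneg _))
    · rw [mul_zero]
  have hΦle : ∀ j, Φ j ≤ Kr * (truncWeight T j * logPlus j ^ 2) := fun j ↦ by
    rw [hΦ]; dsimp only
    split_ifs
    · exact le_rfl
    · rw [mul_zero]; exact mul_nonneg hKr0 (mul_nonneg (hψ0 j) (sq_nonneg _))
  have hΦS : Summable Φ := (hsψ2.mul_left Kr).of_nonneg_of_le hΦ0 hΦle
  -- pointwise tail comparison: for `M ≤ |j|`, `ψ_T(j) log₊² j ≤ (a'+1)² (1+M/N₀)^{-96} (1+|j|/N₀)^{-2}`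
  obtain ⟨ρ, hρ⟩ : ∃ ρ : ℝ, ρ = ((1 + M / (T * Real.log T)) ^ 96)⁻¹ := ⟨_, rfl⟩
  have hρ0 : 0 ≤ ρ := by rw [hρ]; positivity
  have htailpt : ∀ j : ℤ, (if M ≤ |(j : ℝ)| then truncWeight T j * logPlus j ^ 2 else 0) ≤
      (Real.log (2 + T * Real.log T) + 1) ^ 2 * ρ * ((1 + |(j : ℝ)| / (T * Real.log T)) ^ 2)⁻¹ := by
    intro j
    split_ifs with hjM
    · have h1 := truncWeight_mul_logPlus_pow_le hTlog (p := 2) (by norm_num) j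
      have hu : M / (T * Real.log T) ≤ |(j : ℝ)| / (T * Real.log T) :=
        div_le_div_of_nonneg_right hjM hTlog.le
      have h2 : ((1 + |(j : ℝ)| / (T * Real.log T)) ^ (100 - 2))⁻¹ ≤
          ρ * ((1 + |(j : ℝ)| / (T * Real.log T)) ^ 2)⁻¹ := by
        rw [hρ, ← mul_inv, show (100 - 2 : ℕ) = 96 + 2 by norm_num, pow_add]
        refine inv_anti₀ (by positivity) (mul_le_mul_of_nonneg_right ?_ (by positivity))
        exact pow_le_pow_left₀ (by positivity) (by linarith only [hu]) 96
      calc truncWeight T j * logPlus (j : ℝ) ^ 2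
          ≤ (Real.log (2 + T * Real.log T) + 1) ^ 2 *
              ((1 + |(j : ℝ)| / (T * Real.log T)) ^ (100 - 2))⁻¹ := h1
        _ ≤ (Real.log (2 + T * Real.log T) + 1) ^ 2 *
              (ρ * ((1 + |(j : ℝ)| / (T * Real.log T)) ^ 2)⁻¹) :=
            mul_le_mul_of_nonneg_left h2 (by positivity)
        _ = _ := by ring
    · positivity
  obtain ⟨hsq2, hq2⟩ := summable_psiZq hN₀1 (q := 2) le_rfl
  have htail : ∑' j : ℤ, Φ j ≤
      Kr * ((Real.log (2 + T * Real.log T) + 1) ^ 2 * ρ * (10 * (T * Real.log T))) := by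
    have hs3 : Summable (fun j : ℤ ↦ Kr * ((Real.log (2 + T * Real.log T) + 1) ^ 2 * ρ *
        ((1 + |(j : ℝ)| / (T * Real.log T)) ^ 2)⁻¹)) := (hsq2.mul_left _).mul_left Kr
    have hle : ∀ j, Φ j ≤ Kr * ((Real.log (2 + T * Real.log T) + 1) ^ 2 * ρ *
        ((1 + |(j : ℝ)| / (T * Real.log T)) ^ 2)⁻¹) := fun j ↦ by
      rw [hΦ]; dsimp only
      exact mul_le_mul_of_nonneg_left (htailpt j) hKr0
    calc ∑' j : ℤ, Φ j ≤ ∑' j : ℤ, Kr * ((Real.log (2 + T * Real.log T) + 1) ^ 2 * ρ *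
          ((1 + |(j : ℝ)| / (T * Real.log T)) ^ 2)⁻¹) := hΦS.tsum_le_tsum hle hs3
      _ = Kr * ((Real.log (2 + T * Real.log T) + 1) ^ 2 * ρ *
          ∑' j : ℤ, ((1 + |(j : ℝ)| / (T * Real.log T)) ^ 2)⁻¹) := by
          rw [tsum_mul_left, tsum_mul_left]
      _ ≤ _ := mul_le_mul_of_nonneg_left (mul_le_mul_of_nonneg_left hq2 (by positivity)) hKr0
  -- ### summability of `G` on `ℤ × ℤ` and the bound on its sum
  have hrows : Summable (fun j : ℤ ↦ ∑' k : ℤ, G (j, k)) :=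
    hΦS.of_nonneg_of_le (fun j ↦ tsum_nonneg fun k ↦ hG0 _) fun j ↦ (hrow j).2
  have hGS : Summable G := (summable_prod_of_nonneg hG0).2 ⟨fun j ↦ (hrow j).1, hrows⟩
  have hGle : ∑' q : ℤ × ℤ, G q ≤
      Kr * ((Real.log (2 + T * Real.log T) + 1) ^ 2 * ρ * (10 * (T * Real.log T))) :=
    calc ∑' q : ℤ × ℤ, G q = ∑' j : ℤ, ∑' k : ℤ, G (j, k) := hGS.tsum_prod' fun j ↦ (hrow j).1
      _ ≤ ∑' j : ℤ, Φ j := hrows.tsum_le_tsum (fun j ↦ (hrow j).2) hΦS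
      _ ≤ _ := htail
  -- ### summability of `F` and the `tsum` bound
  have hGS' : Summable (fun p : zstarOffDiag ↦ G p.1) := hGS.subtype _
  have hFS : Summable F := hGS'.of_nonneg_of_le hF0 hpt
  refine ⟨hFS, ?_⟩
  rw [abs_of_nonneg (tsum_nonneg hF0)]
  have h1 : ∑' p, F p ≤ ∑' p : zstarOffDiag, G p.1 := hFS.tsum_le_tsum hpt hGS'
  have h2 : ∑' p : zstarOffDiag, G p.1 ≤ ∑' q : ℤ × ℤ, G q :=
    Summable.tsum_subtype_le G zstarOffDiag hG0 hGS
  -- ### the numerical estimate of the `G`-part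
  have hb2 : Kr * ((Real.log (2 + T * Real.log T) + 1) ^ 2 * ρ * (10 * (T * Real.log T))) ≤
      ε / 2 * X := by
    -- `ρ ≤ (log T / T^c)^96`
    have hρle : ρ ≤ (Real.log T / T ^ c) ^ 96 := by
      rw [hρ]
      have h2 : M / (T * Real.log T) = (Real.log T / T ^ c)⁻¹ := by
        rw [hMeq, inv_div, mul_div_mul_left _ _ hT0.ne']
      rw [← inv_pow]
      refine pow_le_pow_left₀ (by positivity) ?_ 96
      have hy : 0 < Real.log T / T ^ c := div_pos hlog0 hTc0
      calc (1 + M / (T * Real.log T))⁻¹ = (1 + (Real.log T / T ^ c)⁻¹)⁻¹ := by rw [h2]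
        _ ≤ ((Real.log T / T ^ c)⁻¹)⁻¹ :=
            inv_anti₀ (inv_pos.2 hy) (le_add_of_nonneg_left zero_le_one)
        _ = Real.log T / T ^ c := inv_inv _
    -- `Kr ≤ Ln² · K₄/160`
    have hKrle : Kr ≤ Ln ^ 2 * (K₄ / 160) := by
      rw [hKr, hK₄, show (160 : ℝ) * (68 * C₁) / 160 = 68 * C₁ by ring]
      have : Ln ≤ Ln ^ 2 := by nlinarith only [hLn1]
      exact mul_le_mul_of_nonneg_right this (by positivity)
    have ha2 : (Real.log (2 + T * Real.log T) + 1) ^ 2 ≤ 16 * Real.log T ^ 2 := by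
      have h0 : 0 ≤ Real.log (2 + T * Real.log T) + 1 := by
        have : 0 ≤ Real.log (2 + T * Real.log T) := Real.log_nonneg (by linarith only [hTlog])
        linarith only [this]
      nlinarith only [ha', h0]
    have hTa1 := hTa T hTa'
    have hpow : T ^ (96 * c) = (T ^ c) ^ 96 := by
      rw [show (96 : ℝ) * c = c * ((96 : ℕ) : ℝ) by push_cast; ring, Real.rpow_mul hT0.le,
        Real.rpow_natCast]
    rw [hpow] at hTa1
    have hmain : Kr * ((Real.log (2 + T * Real.log T) + 1) ^ 2 * ρ * (10 * (T * Real.log T))) ≤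
        (Ln ^ 2 * (K₄ / 160)) *
          ((16 * Real.log T ^ 2) * (Real.log T / T ^ c) ^ 96 * (10 * (T * Real.log T))) := by
      refine mul_le_mul hKrle ?_ (by positivity) (by positivity)
      exact mul_le_mul_of_nonneg_right (mul_le_mul ha2 hρle hρ0 (by positivity)) (by positivity)
    have hid : (Ln ^ 2 * (K₄ / 160)) *
          ((16 * Real.log T ^ 2) * (Real.log T / T ^ c) ^ 96 * (10 * (T * Real.log T))) =
        K₄ * (Real.log T ^ (2 * n + 99) / (T ^ c) ^ 96) * T := by
      have h := alg_seven (Ln := Ln) (K₄ := K₄) (L := Real.log T) (T := T)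
        hTc0.ne'
      have hn2 : n * 2 + 99 = 2 * n + 99 := by omega
      rw [h, hLn, ← pow_mul, ← pow_add, hn2]
    have hfin : K₄ * (Real.log T ^ (2 * n + 99) / (T ^ c) ^ 96) * T ≤ ε / 2 * T := by
      refine mul_le_mul_of_nonneg_right ?_ hT0.le
      rw [mul_div_assoc', div_le_iff₀ (by positivity)]
      calc K₄ * Real.log T ^ (2 * n + 99) ≤ K₄ * (ε / (2 * K₄) * (T ^ c) ^ 96) :=
            mul_le_mul_of_nonneg_left hTa1 hK₄0.le
        _ = ε / 2 * (T ^ c) ^ 96 := alg_eight hK₄0.ne'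
    calc _ ≤ _ := hmain
      _ = _ := hid
      _ ≤ ε / 2 * T := hfin
      _ ≤ ε / 2 * X := mul_le_mul_of_nonneg_left hTX (by positivity)
  have hεX : 0 ≤ ε / 2 * X := by positivity
  linarith only [h1, h2, hGle, hb2, hεX]

/-- **Rodgers–Tao 2020, Lemma 21 (iv) `ξ`-clause, printed witness form — CONTENT proof.** For
`t₀ < 0` with `H_{t₀}` real-rooted, conjunct (iv) of `rodgers_tao_moderatelySized_xi t₀` holds by the
argument of this file (the ex-falso record `rodgers_tao_moderatelySized_xi_holds` is untouched).
[cite: RodgersTaoFMP2020, Lemma 21 (iv) p. 47 («similarly if the x_i are replaced by ξ_i»)] -/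
theorem rodgers_tao_negligible_xi_iv_of_neg {t₀ : ℝ} (ht₀ : t₀ < 0)
    (hreal : HasOnlyRealZeros (deBruijnH t₀)) :
    ∀ C c : ℝ, 0 < C → 0 < c →
      IsNegligible t₀ (fun T _ p ↦
        if T ^ (1 + c) ≤ |(p.1.1 : ℝ)| ∧ T ^ (1 + c) ≤ |(p.1.2 : ℝ)| then Real.log T ^ C *
          (truncWeight T p.1.1 * truncWeight T p.1.2 /
            |classicalLocationZ p.1.1 - classicalLocationZ p.1.2|)
        else 0) :=
  fun C _ _ hc ↦ rodgers_tao_negligible_xi_iv ⟨t₀, by linarith, hreal⟩ (C := C) hc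


/-! ## Lemma 21 (ii) WITHOUT the prefactor `log₊ T` (the true part of (ii), cf. the cell's erratum E-d),
`ξ`-version: `Σ_{j ≠ k} ψ_T(j)ψ_T(k)/|ξ_j − ξ_k| ≪ T log³ T` -/

open RodgersTaoNegligibleSums in
/-- **Rodgers–Tao 2020, Lemma 21 (ii) WITHOUT the prefactor `log₊ T`, `ξ`-version — RH-FREE CONTENT.**
For every `t₀` whose window `[t₀/2, 0]` lies above a real-rooted time `t₁ < t₀/2` (only used for
`Ẽ_T(t) ≥ 0`), the full sum `Σ_{j ≠ k ∈ ℤ*} ψ_T(j)ψ_T(k)/|ξ_j − ξ_k|` is moderately sized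
(`IsModeratelySized t₀`), indeed `≤ 2740·C₁·T log³ T` for `T ≥ 3`, `C₁` the constant of (44). Item
(ii) AS PRINTED carries an extra factor `log₊ T` and is false as stated (the cell's CONFIRMED erratum
E-d: short by exactly one logarithm at the generic spacing — no form of it is typed here, and this is
NOT conjunct (ii) of `rodgers_tao_moderatelySized_xi`); this theorem is its true log-free part, by
(44) `1/|ξ_j − ξ_k| ≤ C₁ log₊(|j|+|k|)/|j − k| ≤ C₁ (log₊ j + log₊ k)/|j − k|`
(`exists_inv_abs_sub_classicalLocationZ_le`), the row sums with the harmonic kernel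
(`tsum_truncWeight_logPlus_pow_div_le`: `Σ_k ψ_T(k) log₊^a k/|j − k| ≤ log₊^a(2|j|)·2(1 + log|j|) +
(log(2 + T log T) + 1)^a·10 T log T/|j|`, `a = 0, 1`) and the profile sums
`Σ_j ψ_T(j) log₊² j ≤ 90 T log³ T`, `Σ_j ψ_T(j) log₊^a j/|j| ≤ 16·3^a log^{a+1} T`
(`RodgersTaoTruncEnergyExpansion.tsum_truncWeight_mul_logPlus_pow_le'`, `…_pow_div_le`).
[cite: RodgersTaoFMP2020, Lemma 21 (ii) p. 47 («similarly if the x_i are replaced by ξ_i»), proof p. 48 (first two displays); (44) p. 21] -/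
theorem rodgers_tao_moderatelySized_xi_ii_logFree {t₀ : ℝ}
    (hreal : ∃ t₁ : ℝ, t₁ < t₀ / 2 ∧ HasOnlyRealZeros (deBruijnH t₁)) :
    IsModeratelySized t₀ (fun T _ p ↦
      truncWeight T p.1.1 * truncWeight T p.1.2 /
        |classicalLocationZ p.1.1 - classicalLocationZ p.1.2|) := by
  classical
  obtain ⟨t₁, ht₁, hreal₁⟩ := hreal
  obtain ⟨C₁, hC₁, hgap⟩ := exists_inv_abs_sub_classicalLocationZ_le
  refine ⟨2740 * C₁, 3, fun T hT3 t ht1 _ _ ↦ ?_⟩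
  have hT0 : 0 < T := by linarith only [hT3]
  have hlog1 : 1 ≤ Real.log T := one_le_log_three.trans (Real.log_le_log (by norm_num) hT3)
  have hlog0 : 0 < Real.log T := by linarith only [hlog1]
  have hTlog : 0 < T * Real.log T := mul_pos hT0 hlog0
  have hΛt : ∃ t₁' : ℝ, t₁' < t ∧ HasOnlyRealZeros (deBruijnH t₁') :=
    ⟨t₁, by linarith only [ht₁, ht1], hreal₁⟩
  have hmono := strictMono_deBruijnZeroZ hΛt
  have hE0 : 0 ≤ truncEnergy T t := truncEnergy_nonneg hTlog hmono
  set X : ℝ := T * Real.log T ^ 3 + truncEnergy T t with hX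
  have hTX : T * Real.log T ^ 3 ≤ X := by linarith only [hE0, hX]
  set F : zstarOffDiag → ℝ := fun p ↦
    truncWeight T p.1.1 * truncWeight T p.1.2 /
      |classicalLocationZ p.1.1 - classicalLocationZ p.1.2| with hF
  show Summable F ∧ |∑' p, F p| ≤ 2740 * C₁ * X
  have hψ0 : ∀ j : ℤ, 0 ≤ truncWeight T j := fun j ↦ (truncWeight_pos hTlog j).le
  have hF0 : ∀ p, 0 ≤ F p := fun p ↦ by
    simp only [hF]
    exact div_nonneg (mul_nonneg (hψ0 _) (hψ0 _)) (abs_nonneg _)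
  -- the majorant `G` on `ℤ × ℤ`
  obtain ⟨G, hG⟩ : ∃ G : ℤ × ℤ → ℝ, G = fun q ↦ if (1 : ℝ) ≤ |(q.1 : ℝ)| then
      C₁ * truncWeight T q.1 * (truncWeight T q.2 * (1 / |(q.1 : ℝ) - q.2|)) * logPlus q.1 +
        C₁ * truncWeight T q.1 * (truncWeight T q.2 * logPlus q.2 * (1 / |(q.1 : ℝ) - q.2|))
      else 0 := ⟨_, rfl⟩
  have hG0 : ∀ q, 0 ≤ G q := fun q ↦ by
    have h1 : 0 ≤ logPlus (q.1 : ℝ) := logPlus_nonneg _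
    have h2 : 0 ≤ logPlus (q.2 : ℝ) := logPlus_nonneg _
    have h3 := hψ0 q.1
    have h4 := hψ0 q.2
    have h5 : 0 ≤ 1 / |(q.1 : ℝ) - q.2| := by positivity
    rw [hG]; dsimp only
    split_ifs
    · exact add_nonneg
        (mul_nonneg (mul_nonneg (mul_nonneg hC₁.le h3) (mul_nonneg h4 h5)) h1)
        (mul_nonneg (mul_nonneg hC₁.le h3) (mul_nonneg (mul_nonneg h4 h2) h5))
    · exact le_rfl
  -- pointwise comparison on the subtype
  have hpt : ∀ p : zstarOffDiag, F p ≤ G p.1 := by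
    intro p
    obtain ⟨hj, hk, -⟩ := mem_zstarOffDiag.1 p.2
    have hj1 : (1 : ℝ) ≤ |(p.1.1 : ℝ)| := by
      have := Int.one_le_abs hj
      rw [← Int.cast_abs]; exact_mod_cast this
    simp only [hF]
    have hψψ0 : 0 ≤ truncWeight T p.1.1 * truncWeight T p.1.2 := mul_nonneg (hψ0 _) (hψ0 _)
    have hGp : G p.1 = (truncWeight T p.1.1 * truncWeight T p.1.2) *
        (C₁ * (logPlus (p.1.1 : ℝ) + logPlus (p.1.2 : ℝ)) / |(p.1.1 : ℝ) - p.1.2|) := by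
      rw [hG]; dsimp only; rw [if_pos hj1]; ring
    rw [hGp]
    have hΛle : logPlus (|(p.1.1 : ℝ)| + |(p.1.2 : ℝ)|) ≤
        logPlus (p.1.1 : ℝ) + logPlus (p.1.2 : ℝ) := by
      rw [logPlus_eq, logPlus_eq, logPlus_eq,
        abs_of_nonneg (by positivity : (0 : ℝ) ≤ |(p.1.1 : ℝ)| + |(p.1.2 : ℝ)|),
        ← Real.log_mul (by positivity) (by positivity)]
      exact Real.log_le_log (by positivity)
        (by nlinarith only [abs_nonneg (p.1.1 : ℝ), abs_nonneg (p.1.2 : ℝ)])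
    have h2 : 1 / |classicalLocationZ p.1.1 - classicalLocationZ p.1.2| ≤
        C₁ * (logPlus (p.1.1 : ℝ) + logPlus (p.1.2 : ℝ)) / |(p.1.1 : ℝ) - p.1.2| := by
      refine (hgap _ _ hj hk).trans ?_
      rw [mul_div_assoc]
      exact mul_le_mul_of_nonneg_left
        (div_le_div_of_nonneg_right hΛle (abs_nonneg _)) hC₁.le
    calc truncWeight T p.1.1 * truncWeight T p.1.2 /
          |classicalLocationZ p.1.1 - classicalLocationZ p.1.2|
        = (truncWeight T p.1.1 * truncWeight T p.1.2) *
            (1 / |classicalLocationZ p.1.1 - classicalLocationZ p.1.2|) := by ring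
      _ ≤ (truncWeight T p.1.1 * truncWeight T p.1.2) *
            (C₁ * (logPlus (p.1.1 : ℝ) + logPlus (p.1.2 : ℝ)) / |(p.1.1 : ℝ) - p.1.2|) :=
          mul_le_mul_of_nonneg_left h2 hψψ0
  -- ### rows of `G`
  have ha' : Real.log (2 + T * Real.log T) + 1 ≤ 4 * Real.log T := by
    have h1 : 2 + T * Real.log T ≤ T ^ 3 := by
      have : Real.log T ≤ T := (Real.log_le_sub_one_of_pos hT0).trans (by linarith only [hT3])
      have hTT : T * Real.log T ≤ T * T := mul_le_mul_of_nonneg_left this hT0.le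
      have h9 : (9 : ℝ) ≤ T * T := by nlinarith only [hT3]
      have h18 : (9 : ℝ) * 2 ≤ T * T * (T - 1) :=
        mul_le_mul h9 (by linarith only [hT3]) (by norm_num) (by positivity)
      nlinarith only [hTT, h18]
    have h2 : Real.log (2 + T * Real.log T) ≤ 3 * Real.log T := by
      have := Real.log_le_log (by positivity) h1
      rw [Real.log_pow] at this; push_cast at this; linarith only [this]
    linarith only [h2, hlog1]
  have ha'0 : 0 ≤ Real.log (2 + T * Real.log T) + 1 := by
    have : 0 ≤ Real.log (2 + T * Real.log T) := Real.log_nonneg (by linarith only [hTlog])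
    linarith only [this]
  have hlog2 : (1 : ℝ) / 2 ≤ Real.log 2 := by have := Real.log_two_gt_d9; linarith
  obtain ⟨Φ, hΦ⟩ : ∃ Φ : ℤ → ℝ, Φ = fun j : ℤ ↦
      C₁ * (18 * (truncWeight T j * logPlus (j : ℝ) ^ 2) +
        10 * (T * Real.log T) * (truncWeight T j * logPlus (j : ℝ) ^ 1 / |(j : ℝ)|) +
        10 * ((Real.log (2 + T * Real.log T) + 1) * (T * Real.log T)) *
          (truncWeight T j * logPlus (j : ℝ) ^ 0 / |(j : ℝ)|)) := ⟨_, rfl⟩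
  have hΦ0 : ∀ j, 0 ≤ Φ j := fun j ↦ by
    have h1 : 0 ≤ logPlus (j : ℝ) := logPlus_nonneg _
    have h3 := hψ0 j
    rw [hΦ]; dsimp only
    exact mul_nonneg hC₁.le (add_nonneg (add_nonneg (mul_nonneg (by norm_num) (mul_nonneg h3 (sq_nonneg _)))
      (mul_nonneg (by positivity) (div_nonneg (mul_nonneg h3 (pow_nonneg h1 _)) (abs_nonneg _))))
      (mul_nonneg (by positivity) (div_nonneg (mul_nonneg h3 (pow_nonneg h1 _)) (abs_nonneg _))))
  have hrow : ∀ j : ℤ, Summable (fun k : ℤ ↦ G (j, k)) ∧ ∑' k : ℤ, G (j, k) ≤ Φ j := by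
    intro j
    by_cases hj1 : (1 : ℝ) ≤ |(j : ℝ)|
    · have hj : j ≠ 0 := by
        intro h; rw [h] at hj1; norm_num at hj1
      have hψj := hψ0 j
      have hlpj : Real.log 2 ≤ logPlus (j : ℝ) := by
        rw [logPlus_eq]; exact Real.log_le_log two_pos (by linarith only [abs_nonneg (j : ℝ)])
      have hlp0 : 0 < logPlus (j : ℝ) := logPlus_pos _
      -- the two pieces
      obtain ⟨hs0, hB0⟩ := tsum_truncWeight_logPlus_pow_div_le hT3 (a := 0) (by norm_num) hj
      obtain ⟨hs1, hB1⟩ := tsum_truncWeight_logPlus_pow_div_le hT3 (a := 1) (by norm_num) hj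
      simp only [pow_zero, mul_one, one_mul] at hs0 hB0
      simp only [pow_one] at hs1 hB1
      obtain ⟨a₂, ha₂⟩ : ∃ a₂ : ℝ, a₂ = C₁ * truncWeight T j * logPlus (j : ℝ) := ⟨_, rfl⟩
      obtain ⟨a₃, ha₃⟩ : ∃ a₃ : ℝ, a₃ = C₁ * truncWeight T j := ⟨_, rfl⟩
      have ha₂0 : 0 ≤ a₂ := by rw [ha₂]; exact mul_nonneg (mul_nonneg hC₁.le hψj) hlp0.le
      have ha₃0 : 0 ≤ a₃ := by rw [ha₃]; exact mul_nonneg hC₁.le hψj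
      have hGjk : ∀ k : ℤ, G (j, k) =
          a₂ * (truncWeight T k * (1 / |(j : ℝ) - k|)) +
            a₃ * (truncWeight T k * logPlus k * (1 / |(j : ℝ) - k|)) := by
        intro k
        rw [hG, ha₂, ha₃]; dsimp only; rw [if_pos hj1]; ring
      have hsum : Summable (fun k : ℤ ↦ G (j, k)) :=
        ((hs0.mul_left a₂).add (hs1.mul_left a₃)).congr fun k ↦ (hGjk k).symm
      refine ⟨hsum, ?_⟩
      have htsum : ∑' k : ℤ, G (j, k) =
          a₂ * ∑' k : ℤ, truncWeight T k * (1 / |(j : ℝ) - k|) +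
            a₃ * ∑' k : ℤ, truncWeight T k * logPlus k * (1 / |(j : ℝ) - k|) := by
        rw [tsum_congr hGjk, (hs0.mul_left a₂).tsum_add (hs1.mul_left a₃), tsum_mul_left,
          tsum_mul_left]
      rw [htsum, hΦ]; dsimp only
      -- elementary comparisons, all in terms of `lp := log₊ j`
      have hloglp : Real.log |(j : ℝ)| ≤ logPlus (j : ℝ) := by
        rw [logPlus_eq]; exact Real.log_le_log (by linarith only [hj1]) (by linarith only [hj1])
      have hlog0j : 0 ≤ Real.log |(j : ℝ)| := Real.log_nonneg hj1
      have hlp2j : logPlus (2 * |(j : ℝ)|) ≤ 2 * logPlus (j : ℝ) := by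
        have := logPlus_two_mul_le (abs_nonneg (j : ℝ)); rwa [logPlus_abs] at this
      have h1log : 2 * (1 + Real.log |(j : ℝ)|) ≤ 6 * logPlus (j : ℝ) := by
        linarith only [hloglp, hlpj, hlog2]
      have hB0' : ∑' k : ℤ, truncWeight T k * (1 / |(j : ℝ) - k|) ≤
          6 * logPlus (j : ℝ) + 1 / |(j : ℝ)| * (10 * (T * Real.log T)) :=
        hB0.trans (by linarith only [h1log])
      have hB1' : ∑' k : ℤ, truncWeight T k * logPlus k * (1 / |(j : ℝ) - k|) ≤
          12 * logPlus (j : ℝ) ^ 2 +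
            1 / |(j : ℝ)| * ((Real.log (2 + T * Real.log T) + 1) * (10 * (T * Real.log T))) := by
        refine hB1.trans ?_
        have h1 : logPlus (2 * |(j : ℝ)|) * (2 * (1 + Real.log |(j : ℝ)|)) ≤
            (2 * logPlus (j : ℝ)) * (6 * logPlus (j : ℝ)) :=
          mul_le_mul hlp2j h1log (by linarith only [hlog0j]) (by linarith only [hlp0])
        linarith only [h1]
      -- assemble
      calc a₂ * ∑' k : ℤ, truncWeight T k * (1 / |(j : ℝ) - k|) +
            a₃ * ∑' k : ℤ, truncWeight T k * logPlus k * (1 / |(j : ℝ) - k|)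
          ≤ a₂ * (6 * logPlus (j : ℝ) + 1 / |(j : ℝ)| * (10 * (T * Real.log T))) +
            a₃ * (12 * logPlus (j : ℝ) ^ 2 +
              1 / |(j : ℝ)| * ((Real.log (2 + T * Real.log T) + 1) * (10 * (T * Real.log T)))) :=
            add_le_add (mul_le_mul_of_nonneg_left hB0' ha₂0) (mul_le_mul_of_nonneg_left hB1' ha₃0)
        _ = C₁ * (18 * (truncWeight T j * logPlus (j : ℝ) ^ 2) +
              10 * (T * Real.log T) * (truncWeight T j * logPlus (j : ℝ) ^ 1 / |(j : ℝ)|) +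
              10 * ((Real.log (2 + T * Real.log T) + 1) * (T * Real.log T)) *
                (truncWeight T j * logPlus (j : ℝ) ^ 0 / |(j : ℝ)|)) := by
            rw [ha₂, ha₃]; ring
    · have hGz : ∀ k : ℤ, G (j, k) = 0 := fun k ↦ by
        rw [hG]; dsimp only; rw [if_neg hj1]
      refine ⟨(summable_zero).congr fun k ↦ (hGz k).symm, ?_⟩
      rw [tsum_congr hGz, tsum_zero]
      exact hΦ0 j
  -- ### the profile sums
  obtain ⟨hsψ2, -⟩ := RodgersTaoTruncEnergyExpansion.tsum_truncWeight_mul_logPlus_pow_le hT3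
    (p := 2) (by norm_num)
  have hB2 := RodgersTaoTruncEnergyExpansion.tsum_truncWeight_mul_logPlus_pow_le' hT3
    (p := 2) (by norm_num)
  obtain ⟨hsd1, hBd1⟩ := RodgersTaoTruncEnergyExpansion.tsum_truncWeight_mul_logPlus_pow_div_le hT3
    (p := 1) (by norm_num)
  obtain ⟨hsd0, hBd0⟩ := RodgersTaoTruncEnergyExpansion.tsum_truncWeight_mul_logPlus_pow_div_le hT3
    (p := 0) (by norm_num)
  have hΦS : Summable Φ := by
    rw [hΦ]
    exact (((hsψ2.mul_left 18).add (hsd1.mul_left _)).add (hsd0.mul_left _)).mul_left C₁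
  have hΦsum : ∑' j : ℤ, Φ j = C₁ * (18 * ∑' j : ℤ, truncWeight T j * logPlus (j : ℝ) ^ 2 +
      10 * (T * Real.log T) * ∑' j : ℤ, truncWeight T j * logPlus (j : ℝ) ^ 1 / |(j : ℝ)| +
      10 * ((Real.log (2 + T * Real.log T) + 1) * (T * Real.log T)) *
        ∑' j : ℤ, truncWeight T j * logPlus (j : ℝ) ^ 0 / |(j : ℝ)|) := by
    rw [hΦ]; dsimp only
    rw [tsum_mul_left, ((hsψ2.mul_left 18).add (hsd1.mul_left _)).tsum_add (hsd0.mul_left _),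
      (hsψ2.mul_left 18).tsum_add (hsd1.mul_left _), tsum_mul_left, tsum_mul_left, tsum_mul_left]
  have hΦle : ∑' j : ℤ, Φ j ≤ 2740 * C₁ * (T * Real.log T ^ 3) := by
    rw [hΦsum]
    have e1 : 18 * ∑' j : ℤ, truncWeight T j * logPlus (j : ℝ) ^ 2 ≤
        18 * (10 * 3 ^ 2 * (T * Real.log T) * Real.log T ^ 2) :=
      mul_le_mul_of_nonneg_left hB2 (by norm_num)
    have e2 : 10 * (T * Real.log T) * ∑' j : ℤ, truncWeight T j * logPlus (j : ℝ) ^ 1 / |(j : ℝ)| ≤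
        10 * (T * Real.log T) * (16 * 3 ^ 1 * Real.log T ^ (1 + 1)) :=
      mul_le_mul_of_nonneg_left hBd1 (by positivity)
    have e3 : 10 * ((Real.log (2 + T * Real.log T) + 1) * (T * Real.log T)) *
        ∑' j : ℤ, truncWeight T j * logPlus (j : ℝ) ^ 0 / |(j : ℝ)| ≤
        10 * ((4 * Real.log T) * (T * Real.log T)) * (16 * 3 ^ 0 * Real.log T ^ (0 + 1)) :=
      mul_le_mul (mul_le_mul_of_nonneg_left (mul_le_mul_of_nonneg_right ha' hTlog.le) (by norm_num))
        hBd0 (tsum_nonneg fun j ↦ div_nonneg (mul_nonneg (hψ0 j) (pow_nonneg (logPlus_nonneg _) _))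
          (abs_nonneg _)) (by positivity)
    have e4 : 18 * (10 * 3 ^ 2 * (T * Real.log T) * Real.log T ^ 2) +
        10 * (T * Real.log T) * (16 * 3 ^ 1 * Real.log T ^ (1 + 1)) +
        10 * ((4 * Real.log T) * (T * Real.log T)) * (16 * 3 ^ 0 * Real.log T ^ (0 + 1)) =
        2740 * (T * Real.log T ^ 3) := by ring
    have e5 : C₁ * (18 * ∑' j : ℤ, truncWeight T j * logPlus (j : ℝ) ^ 2 +
        10 * (T * Real.log T) * ∑' j : ℤ, truncWeight T j * logPlus (j : ℝ) ^ 1 / |(j : ℝ)| +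
        10 * ((Real.log (2 + T * Real.log T) + 1) * (T * Real.log T)) *
          ∑' j : ℤ, truncWeight T j * logPlus (j : ℝ) ^ 0 / |(j : ℝ)|) ≤
        C₁ * (2740 * (T * Real.log T ^ 3)) := by
      refine mul_le_mul_of_nonneg_left ?_ hC₁.le
      linarith only [e1, e2, e3, e4]
    linarith only [e5]
  -- ### summability of `G` on `ℤ × ℤ`, of `F`, and the bound
  have hrows : Summable (fun j : ℤ ↦ ∑' k : ℤ, G (j, k)) :=
    hΦS.of_nonneg_of_le (fun j ↦ tsum_nonneg fun k ↦ hG0 _) fun j ↦ (hrow j).2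
  have hGS : Summable G := (summable_prod_of_nonneg hG0).2 ⟨fun j ↦ (hrow j).1, hrows⟩
  have hGle : ∑' q : ℤ × ℤ, G q ≤ 2740 * C₁ * (T * Real.log T ^ 3) :=
    calc ∑' q : ℤ × ℤ, G q = ∑' j : ℤ, ∑' k : ℤ, G (j, k) := hGS.tsum_prod' fun j ↦ (hrow j).1
      _ ≤ ∑' j : ℤ, Φ j := hrows.tsum_le_tsum (fun j ↦ (hrow j).2) hΦS
      _ ≤ _ := hΦle
  have hGS' : Summable (fun p : zstarOffDiag ↦ G p.1) := hGS.subtype _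
  have hFS : Summable F := hGS'.of_nonneg_of_le hF0 hpt
  refine ⟨hFS, ?_⟩
  rw [abs_of_nonneg (tsum_nonneg hF0)]
  have h1 : ∑' p, F p ≤ ∑' p : zstarOffDiag, G p.1 := hFS.tsum_le_tsum hpt hGS'
  have h2 : ∑' p : zstarOffDiag, G p.1 ≤ ∑' q : ℤ × ℤ, G q :=
    Summable.tsum_subtype_le G zstarOffDiag hG0 hGS
  have h3 : 2740 * C₁ * (T * Real.log T ^ 3) ≤ 2740 * C₁ * X :=
    mul_le_mul_of_nonneg_left hTX (by positivity)
  linarith only [h1, h2, hGle, h3]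

/-- **Rodgers–Tao 2020, Lemma 21 (ii) without `log₊ T`, `ξ`-version, witness form.** For `t₀ < 0`
with `H_{t₀}` real-rooted, `Σ_{j ≠ k} ψ_T(j)ψ_T(k)/|ξ_j − ξ_k|` is moderately sized in the window of
`t₀`. (The printed (ii), with the factor `log₊ T`, is false as stated — erratum E-d — and is not
typed; the ex-falso record `rodgers_tao_moderatelySized_xi_holds` is untouched.)
[cite: RodgersTaoFMP2020, Lemma 21 (ii) p. 47, proof p. 48 (first two displays)] -/
theorem rodgers_tao_moderatelySized_xi_ii_logFree_of_neg {t₀ : ℝ} (ht₀ : t₀ < 0)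
    (hreal : HasOnlyRealZeros (deBruijnH t₀)) :
    IsModeratelySized t₀ (fun T _ p ↦
      truncWeight T p.1.1 * truncWeight T p.1.2 /
        |classicalLocationZ p.1.1 - classicalLocationZ p.1.2|) :=
  rodgers_tao_moderatelySized_xi_ii_logFree ⟨t₀, by linarith, hreal⟩


/-! ## Lemma 21 (ii) WITHOUT the prefactor `log₊ T`, `x_i(t)`-version under the location law (50):
`Σ_{j ≠ k} ψ_T(j)ψ_T(k)/|x_j(t) − x_k(t)| ≪ T log³ T + Ẽ_T(t)` -/

namespace RodgersTaoNegligibleSums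

/-- **Small count**: `#{k : |k| < L} ≤ 2L + 1` as a `tsum` of an indicator. [folklore] -/
private theorem tsum_ite_abs_lt_le {L : ℝ} (hL : 0 ≤ L) :
    Summable (fun k : ℤ ↦ if |(k : ℝ)| < L then (1 : ℝ) else 0) ∧
      ∑' k : ℤ, (if |(k : ℝ)| < L then (1 : ℝ) else 0) ≤ 2 * L + 1 := by
  classical
  set S : Finset ℤ := Finset.Icc (-⌈L⌉) ⌈L⌉ with hS
  have hsupp : ∀ k ∉ S, (if |(k : ℝ)| < L then (1 : ℝ) else 0) = 0 := by
    intro k hk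
    rw [if_neg]
    intro h
    apply hk
    rw [hS, Finset.mem_Icc]
    have h1 := abs_lt.1 h
    have hc : L ≤ ⌈L⌉ := Int.le_ceil L
    constructor
    · have : -((⌈L⌉ : ℤ) : ℝ) < k := by linarith [h1.1]
      have : ((-⌈L⌉ : ℤ) : ℝ) < k := by push_cast; exact this
      exact (by exact_mod_cast this : -⌈L⌉ < k).le
    · have : (k : ℝ) < ((⌈L⌉ : ℤ) : ℝ) := by linarith [h1.2]
      exact (by exact_mod_cast this : k < ⌈L⌉).le
  refine ⟨summable_of_ne_finset_zero hsupp, ?_⟩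
  rw [tsum_eq_sum hsupp]
  have h := sum_ite_abs_sub_lt_le S 0 hL
  simp only [Int.cast_zero, zero_sub, abs_neg] at h
  exact h

end RodgersTaoNegligibleSums

open RodgersTaoNegligibleSums in
/-- **Rodgers–Tao 2020, Lemma 21 (ii) WITHOUT the prefactor `log₊ T`, `x_i(t)`-version — RH-FREE
CONTENT** (location-law form). Above a real-rooted time `t₁ < t₀/2` and under the location law (50)
on the window `[t₀/2, 0]`, the full sum `Σ_{j ≠ k ∈ ℤ*} ψ_T(j)ψ_T(k)/|x_j(t) − x_k(t)|` is moderately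
sized (`IsModeratelySized t₀`): `≤ Ẽ_T(t) + (C_i + K) T log³ T` with `K = 90(2D+1) + 10(2T_D+1) +
5480 C₁` (`D = 4B'C_ξC₁`, `T_D` the log-versus-linear threshold). Item (ii) AS PRINTED (with `log₊ T`)
is false as stated — the cell's CONFIRMED erratum E-d — and no form of it is typed here; this is NOT
conjunct (ii) of `rodgers_tao_moderatelySized`. Road = the near/far road of (iv) over ALL pairs with
`η = 1`: near pairs (`|k| ≤ 2|j|`, `|j − k| < D log₊²(3|j|)`, or `|k| < T_D`) by
`1/|x_j − x_k| ≤ E_{jk} + 1/4` (`one_div_abs_le_eta`) and Lemma 21 (i) with content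
(`tsum_truncWeight_interactionEnergy_le`), counted by `tsum_nearInd_le` / `tsum_ite_abs_lt_le`; far
pairs by `one_div_abs_sub_deBruijnZeroZ_le_of_far` and the row sums `tsum_truncWeight_logPlus_pow_div_le`;
then the profile sums `Σ ψ_T log₊^p`, `Σ ψ_T log₊^p/|j|` of `RodgersTaoTruncEnergyLemma18Proofs`.
[cite: RodgersTaoFMP2020, Lemma 21 (ii) p. 47, proof p. 48 (first two displays); (44) p. 21; (50) p. 23] -/
theorem rodgers_tao_moderatelySized_ii_logFree_of_location {t₀ B : ℝ}
    (hreal : ∃ t₁ : ℝ, t₁ < t₀ / 2 ∧ HasOnlyRealZeros (deBruijnH t₁))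
    (H2 : ∀ t ∈ Icc (t₀ / 2) 0, ∀ n : ℕ, 1 ≤ n →
      |deBruijnZero t n - classicalLocation (n : ℝ)| ≤ B * logPlus (classicalLocation (n : ℝ))) :
    IsModeratelySized t₀ (fun T t p ↦
      truncWeight T p.1.1 * truncWeight T p.1.2 /
        |deBruijnZeroZ t p.1.1 - deBruijnZeroZ t p.1.2|) := by
  classical
  obtain ⟨t₁, ht₁, hreal₁⟩ := hreal
  obtain ⟨Ci, Ti, hCi0, hEi⟩ := tsum_truncWeight_interactionEnergy_le
  obtain ⟨Cξ, hCξ1, hCξ⟩ := exists_logPlus_classicalLocationZ_le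
  obtain ⟨C₁, hC₁, hgap⟩ := exists_inv_abs_sub_classicalLocationZ_le
  have hCξ0 : 0 ≤ Cξ := by linarith only [hCξ1]
  obtain ⟨B', hB'⟩ : ∃ B' : ℝ, B' = max B 0 := ⟨_, rfl⟩
  have hB'0 : 0 ≤ B' := by rw [hB']; exact le_max_right _ _
  have hBB' : B ≤ B' := by rw [hB']; exact le_max_left _ _
  obtain ⟨D, hD⟩ : ∃ D : ℝ, D = 4 * B' * Cξ * C₁ := ⟨_, rfl⟩
  have hD0 : 0 ≤ D := by rw [hD]; positivity
  obtain ⟨Td, hTd⟩ := exists_forall_log_pow_le 2 (c := 1) one_pos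
    (show 0 < 1 / (8 * D + 1) by positivity)
  obtain ⟨Td', hTd'⟩ : ∃ Td' : ℝ, Td' = max 3 Td := ⟨_, rfl⟩
  have hTd'3 : 3 ≤ Td' := by rw [hTd']; exact le_max_left _ _
  have hTd'd : Td ≤ Td' := by rw [hTd']; exact le_max_right _ _
  have hTd'0 : 0 ≤ Td' := by linarith only [hTd'3]
  obtain ⟨K, hK⟩ : ∃ K : ℝ, K = 90 * (2 * D + 1) + 10 * (2 * Td' + 1) + 5480 * C₁ := ⟨_, rfl⟩
  have hK0 : 0 ≤ K := by rw [hK]; positivity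
  refine ⟨1 + Ci + K, max 3 Ti, fun T hT t ht1 ht2 hs ↦ ?_⟩
  have hT3 : 3 ≤ T := le_trans (le_max_left _ _) hT
  have hTi : Ti ≤ T := le_trans (le_max_right _ _) hT
  have hT0 : 0 < T := by linarith only [hT3]
  have hlog1 : 1 ≤ Real.log T := one_le_log_three.trans (Real.log_le_log (by norm_num) hT3)
  have hlog0 : 0 < Real.log T := by linarith only [hlog1]
  have hTlog : 0 < T * Real.log T := mul_pos hT0 hlog0
  have hΛt : ∃ t₁' : ℝ, t₁' < t ∧ HasOnlyRealZeros (deBruijnH t₁') :=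
    ⟨t₁, by linarith only [ht₁, ht1], hreal₁⟩
  have hmono := strictMono_deBruijnZeroZ hΛt
  have hE0 : 0 ≤ truncEnergy T t := truncEnergy_nonneg hTlog hmono
  set X : ℝ := T * Real.log T ^ 3 + truncEnergy T t with hX
  have hTL0 : 0 ≤ T * Real.log T ^ 3 := by positivity
  have hNL : T * Real.log T ≤ T * Real.log T ^ 3 := by
    have h := mul_le_mul_of_nonneg_left (one_le_pow₀ hlog1 : (1 : ℝ) ≤ Real.log T ^ 2) hTlog.le
    calc T * Real.log T = T * Real.log T * 1 := by ring
      _ ≤ T * Real.log T * Real.log T ^ 2 := h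
      _ = T * Real.log T ^ 3 := by ring
  set F : zstarOffDiag → ℝ := fun p ↦
    truncWeight T p.1.1 * truncWeight T p.1.2 /
      |deBruijnZeroZ t p.1.1 - deBruijnZeroZ t p.1.2| with hF
  show Summable F ∧ |∑' p, F p| ≤ (1 + Ci + K) * X
  have hψ0 : ∀ j : ℤ, 0 ≤ truncWeight T j := fun j ↦ (truncWeight_pos hTlog j).le
  have hψ1 : ∀ j : ℤ, truncWeight T j ≤ 1 := fun j ↦ truncWeight_le_one hTlog j
  have hF0 : ∀ p, 0 ≤ F p := fun p ↦ by
    simp only [hF]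
    exact div_nonneg (mul_nonneg (hψ0 _) (hψ0 _)) (abs_nonneg _)
  have h50Z : ∀ j : ℤ, j ≠ 0 →
      |deBruijnZeroZ t j - classicalLocationZ j| ≤ B' * logPlus (classicalLocationZ j) := by
    refine fun j hj ↦ location_zstar_of_nat (fun m hm ↦ ?_) hj
    exact (H2 t ⟨ht1, ht2⟩ m hm).trans
      (mul_le_mul_of_nonneg_right hBB' (logPlus_nonneg _))
  -- log-versus-linear for the far comparison in the regime `|k| > 2|j|`, `|k| ≥ T_D`
  have hfarA : ∀ x : ℝ, Td' ≤ x → D * logPlus (2 * x) ^ 2 ≤ x / 2 := by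
    intro x hx
    have hx3 : 3 ≤ x := hTd'3.trans hx
    have hlp : logPlus (2 * x) ≤ 2 * Real.log x := by
      rw [logPlus_eq, abs_of_nonneg (by linarith only [hx3]), ← Real.log_rpow (by linarith only [hx3]),
        Real.rpow_two]
      exact Real.log_le_log (by linarith only [hx3]) (by nlinarith only [hx3])
    have h1 := hTd x (hTd'd.trans hx)
    rw [Real.rpow_one] at h1
    have h2 : logPlus (2 * x) ^ 2 ≤ 4 * Real.log x ^ 2 := by
      have := pow_le_pow_left₀ (logPlus_nonneg _) hlp 2; nlinarith only [this]
    have h3 : D * (4 * (1 / (8 * D + 1) * x)) ≤ x / 2 := by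
      rw [show D * (4 * (1 / (8 * D + 1) * x)) = x * (4 * D / (8 * D + 1)) by ring]
      have : 4 * D / (8 * D + 1) ≤ 1 / 2 := by
        rw [div_le_div_iff₀ (by positivity) (by norm_num)]; linarith only [hD0]
      nlinarith only [this, hx3]
    calc D * logPlus (2 * x) ^ 2 ≤ D * (4 * Real.log x ^ 2) := mul_le_mul_of_nonneg_left h2 hD0
      _ ≤ D * (4 * (1 / (8 * D + 1) * x)) := by
          refine mul_le_mul_of_nonneg_left (mul_le_mul_of_nonneg_left h1 (by norm_num)) hD0
      _ ≤ x / 2 := h3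
  -- the majorant `G` on `ℤ × ℤ`
  obtain ⟨G, hG⟩ : ∃ G : ℤ × ℤ → ℝ, G = fun q ↦ if (1 : ℝ) ≤ |(q.1 : ℝ)| then
      ((if |(q.2 : ℝ)| ≤ 2 * |(q.1 : ℝ)| ∧ |(q.1 : ℝ) - q.2| < D * logPlus (3 * |(q.1 : ℝ)|) ^ 2
          then (1 : ℝ) else 0) + (if |(q.2 : ℝ)| < Td' then (1 : ℝ) else 0)) *
          truncWeight T q.1 / 4 +
        2 * C₁ * truncWeight T q.1 * (truncWeight T q.2 * (1 / |(q.1 : ℝ) - q.2|)) *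
          logPlus q.1 +
        2 * C₁ * truncWeight T q.1 * (truncWeight T q.2 * logPlus q.2 * (1 / |(q.1 : ℝ) - q.2|))
      else 0 := ⟨_, rfl⟩
  have hind0 : ∀ q : ℤ × ℤ, (0 : ℝ) ≤
      (if |(q.2 : ℝ)| ≤ 2 * |(q.1 : ℝ)| ∧ |(q.1 : ℝ) - q.2| < D * logPlus (3 * |(q.1 : ℝ)|) ^ 2
        then (1 : ℝ) else 0) + (if |(q.2 : ℝ)| < Td' then (1 : ℝ) else 0) := fun q ↦
    add_nonneg (by split_ifs <;> norm_num) (by split_ifs <;> norm_num)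
  have hG0 : ∀ q, 0 ≤ G q := fun q ↦ by
    have h1 : 0 ≤ logPlus (q.1 : ℝ) := logPlus_nonneg _
    have h2 : 0 ≤ logPlus (q.2 : ℝ) := logPlus_nonneg _
    have h3 := hψ0 q.1
    have h4 := hψ0 q.2
    have h5 : 0 ≤ 1 / |(q.1 : ℝ) - q.2| := by positivity
    have h6 : (0 : ℝ) ≤ 2 * C₁ := by positivity
    have h7 := hind0 q
    rw [hG]; dsimp only
    by_cases h : (1 : ℝ) ≤ |(q.1 : ℝ)|
    · rw [if_pos h]
      exact add_nonneg (add_nonneg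
        (div_nonneg (mul_nonneg h7 h3) (by norm_num))
        (mul_nonneg (mul_nonneg (mul_nonneg h6 h3) (mul_nonneg h4 h5)) h1))
        (mul_nonneg (mul_nonneg h6 h3) (mul_nonneg (mul_nonneg h4 h2) h5))
    · rw [if_neg h]
  -- pointwise comparison on the subtype
  have hpt : ∀ p : zstarOffDiag, F p ≤
      truncWeight T p.1.1 * truncWeight T p.1.2 * interactionEnergy t p.1.1 p.1.2 + G p.1 := by
    intro p
    obtain ⟨hj, hk, hjk⟩ := mem_zstarOffDiag.1 p.2
    have hj1 : (1 : ℝ) ≤ |(p.1.1 : ℝ)| := by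
      have := Int.one_le_abs hj
      rw [← Int.cast_abs]; exact_mod_cast this
    have hW0 : 0 ≤ truncWeight T p.1.1 * truncWeight T p.1.2 * interactionEnergy t p.1.1 p.1.2 :=
      mul_nonneg (mul_nonneg (hψ0 _) (hψ0 _)) (interactionEnergy_nonneg _ _ _)
    simp only [hF]
    obtain ⟨g, hg⟩ : ∃ g : ℝ, g = deBruijnZeroZ t p.1.1 - deBruijnZeroZ t p.1.2 := ⟨_, rfl⟩
    rw [← hg]
    have hψψ0 : 0 ≤ truncWeight T p.1.1 * truncWeight T p.1.2 := mul_nonneg (hψ0 _) (hψ0 _)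
    have hEg : interactionEnergy t p.1.1 p.1.2 = 1 / g ^ 2 := by rw [interactionEnergy_eq, hg]
    have hlp1 : 0 ≤ logPlus (p.1.1 : ℝ) := logPlus_nonneg _
    have hlp2 : 0 ≤ logPlus (p.1.2 : ℝ) := logPlus_nonneg _
    obtain ⟨ind, hind⟩ : ∃ ind : ℝ, ind =
        (if |(p.1.2 : ℝ)| ≤ 2 * |(p.1.1 : ℝ)| ∧
            |(p.1.1 : ℝ) - p.1.2| < D * logPlus (3 * |(p.1.1 : ℝ)|) ^ 2 then (1 : ℝ) else 0) +
          (if |(p.1.2 : ℝ)| < Td' then (1 : ℝ) else 0) := ⟨_, rfl⟩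
    have hind0' : 0 ≤ ind := by rw [hind]; exact hind0 p.1
    obtain ⟨Rfar, hRfar⟩ : ∃ Rfar : ℝ, Rfar =
        2 * C₁ * truncWeight T p.1.1 * (truncWeight T p.1.2 *
            (1 / |(p.1.1 : ℝ) - p.1.2|)) * logPlus (p.1.1 : ℝ) +
          2 * C₁ * truncWeight T p.1.1 * (truncWeight T p.1.2 * logPlus (p.1.2 : ℝ) *
            (1 / |(p.1.1 : ℝ) - p.1.2|)) := ⟨_, rfl⟩
    have hψj := hψ0 p.1.1
    have hψk := hψ0 p.1.2
    have hRfar0 : 0 ≤ Rfar := by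
      have h5 : 0 ≤ 1 / |(p.1.1 : ℝ) - p.1.2| := by positivity
      have h6 : (0 : ℝ) ≤ 2 * C₁ := by positivity
      rw [hRfar]
      exact add_nonneg (mul_nonneg (mul_nonneg (mul_nonneg h6 hψj) (mul_nonneg hψk h5)) hlp1)
        (mul_nonneg (mul_nonneg h6 hψj) (mul_nonneg (mul_nonneg hψk hlp2) h5))
    have hRfar_eq : Rfar = 2 * C₁ * (truncWeight T p.1.1 * truncWeight T p.1.2) *
        (logPlus (p.1.1 : ℝ) + logPlus (p.1.2 : ℝ)) / |(p.1.1 : ℝ) - p.1.2| := by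
      rw [hRfar]; ring
    have hGp : G p.1 = ind * truncWeight T p.1.1 / 4 + Rfar := by
      rw [hG, hind, hRfar]; dsimp only; rw [if_pos hj1]; ring
    rw [hGp]
    -- the near bound, valid whenever the indicator is `≥ 1`
    have hnear : 1 ≤ ind → truncWeight T p.1.1 * truncWeight T p.1.2 / |g| ≤
        truncWeight T p.1.1 * truncWeight T p.1.2 * interactionEnergy t p.1.1 p.1.2 +
          (ind * truncWeight T p.1.1 / 4 + Rfar) := by
      intro h1ind
      have h1 := one_div_abs_le_eta g one_pos
      have h2 : truncWeight T p.1.1 * truncWeight T p.1.2 / |g| ≤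
          truncWeight T p.1.1 * truncWeight T p.1.2 * (1 / g ^ 2) + truncWeight T p.1.1 / 4 := by
        calc truncWeight T p.1.1 * truncWeight T p.1.2 / |g|
            = (truncWeight T p.1.1 * truncWeight T p.1.2) * (1 / |g|) := by ring
          _ ≤ (truncWeight T p.1.1 * truncWeight T p.1.2) * (1 * (1 / g ^ 2) + 1 / (4 * 1)) :=
              mul_le_mul_of_nonneg_left h1 hψψ0
          _ = truncWeight T p.1.1 * truncWeight T p.1.2 * (1 / g ^ 2) +
                truncWeight T p.1.1 * (truncWeight T p.1.2 * (1 / 4)) := by ring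
          _ ≤ truncWeight T p.1.1 * truncWeight T p.1.2 * (1 / g ^ 2) +
                truncWeight T p.1.1 * (1 * (1 / 4)) := by
              have : truncWeight T p.1.2 * (1 / 4 : ℝ) ≤ 1 * (1 / 4) :=
                mul_le_mul_of_nonneg_right (hψ1 _) (by norm_num)
              have := mul_le_mul_of_nonneg_left this (hψ0 p.1.1)
              linarith only [this]
          _ = _ := by ring
      have h3 : truncWeight T p.1.1 / 4 ≤ ind * truncWeight T p.1.1 / 4 := by
        have := mul_le_mul_of_nonneg_right h1ind hψj
        rw [one_mul] at this
        linarith only [this]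
      rw [hEg]
      linarith only [h2, h3, hRfar0]
    by_cases hA : |(p.1.2 : ℝ)| ≤ 2 * |(p.1.1 : ℝ)| ∧
        |(p.1.1 : ℝ) - p.1.2| < D * logPlus (3 * |(p.1.1 : ℝ)|) ^ 2
    · refine hnear ?_
      rw [hind, if_pos hA]
      have : (0 : ℝ) ≤ (if |(p.1.2 : ℝ)| < Td' then (1 : ℝ) else 0) := by split_ifs <;> norm_num
      linarith only [this]
    · by_cases hsm : |(p.1.2 : ℝ)| < Td'
      · refine hnear ?_
        rw [hind, if_neg hA, if_pos hsm]; norm_num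
      · -- far pair
        have hkT : Td' ≤ |(p.1.2 : ℝ)| := not_lt.1 hsm
        have hfar : 4 * B' * Cξ * C₁ * logPlus (|(p.1.1 : ℝ)| + |(p.1.2 : ℝ)|) ^ 2 ≤
            |(p.1.1 : ℝ) - p.1.2| := by
          rw [← hD]
          by_cases h2j : |(p.1.2 : ℝ)| ≤ 2 * |(p.1.1 : ℝ)|
          · have hnot : ¬ |(p.1.1 : ℝ) - p.1.2| < D * logPlus (3 * |(p.1.1 : ℝ)|) ^ 2 :=
              fun h ↦ hA ⟨h2j, h⟩
            have hΛ : logPlus (|(p.1.1 : ℝ)| + |(p.1.2 : ℝ)|) ≤ logPlus (3 * |(p.1.1 : ℝ)|) := by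
              refine logPlus_mono ?_
              rw [abs_of_nonneg (by positivity : (0 : ℝ) ≤ |(p.1.1 : ℝ)| + |(p.1.2 : ℝ)|),
                abs_of_nonneg (by positivity : (0 : ℝ) ≤ 3 * |(p.1.1 : ℝ)|)]
              linarith only [h2j]
            calc D * logPlus (|(p.1.1 : ℝ)| + |(p.1.2 : ℝ)|) ^ 2 ≤ D * logPlus (3 * |(p.1.1 : ℝ)|) ^ 2 :=
                  mul_le_mul_of_nonneg_left (pow_le_pow_left₀ (logPlus_nonneg _) hΛ 2) hD0
              _ ≤ |(p.1.1 : ℝ) - p.1.2| := not_lt.1 hnot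
          · have h2j' : 2 * |(p.1.1 : ℝ)| < |(p.1.2 : ℝ)| := not_le.1 h2j
            have hΛ : logPlus (|(p.1.1 : ℝ)| + |(p.1.2 : ℝ)|) ≤ logPlus (2 * |(p.1.2 : ℝ)|) := by
              refine logPlus_mono ?_
              rw [abs_of_nonneg (by positivity : (0 : ℝ) ≤ |(p.1.1 : ℝ)| + |(p.1.2 : ℝ)|),
                abs_of_nonneg (by positivity : (0 : ℝ) ≤ 2 * |(p.1.2 : ℝ)|)]
              linarith only [h2j', abs_nonneg (p.1.1 : ℝ)]
            have hdist : |(p.1.2 : ℝ)| / 2 ≤ |(p.1.1 : ℝ) - p.1.2| := by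
              have := abs_sub_abs_le_abs_sub (p.1.2 : ℝ) (p.1.1 : ℝ)
              rw [abs_sub_comm (p.1.2 : ℝ)] at this
              linarith only [this, h2j', abs_nonneg (p.1.1 : ℝ)]
            calc D * logPlus (|(p.1.1 : ℝ)| + |(p.1.2 : ℝ)|) ^ 2 ≤ D * logPlus (2 * |(p.1.2 : ℝ)|) ^ 2 :=
                  mul_le_mul_of_nonneg_left (pow_le_pow_left₀ (logPlus_nonneg _) hΛ 2) hD0
              _ ≤ |(p.1.2 : ℝ)| / 2 := hfarA _ hkT
              _ ≤ |(p.1.1 : ℝ) - p.1.2| := hdist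
        have h1 := one_div_abs_sub_deBruijnZeroZ_le_of_far hB'0 hCξ0 hC₁ h50Z hCξ hgap hj hk hjk hfar
        have hΛle : logPlus (|(p.1.1 : ℝ)| + |(p.1.2 : ℝ)|) ≤
            logPlus (p.1.1 : ℝ) + logPlus (p.1.2 : ℝ) := by
          rw [logPlus_eq, logPlus_eq, logPlus_eq,
            abs_of_nonneg (by positivity : (0 : ℝ) ≤ |(p.1.1 : ℝ)| + |(p.1.2 : ℝ)|),
            ← Real.log_mul (by positivity) (by positivity)]
          exact Real.log_le_log (by positivity)
            (by nlinarith only [abs_nonneg (p.1.1 : ℝ), abs_nonneg (p.1.2 : ℝ)])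
        have h2 : 1 / |g| ≤ 2 * C₁ * (logPlus (p.1.1 : ℝ) + logPlus (p.1.2 : ℝ)) /
            |(p.1.1 : ℝ) - p.1.2| := by
          rw [hg]
          refine h1.trans (div_le_div_of_nonneg_right ?_ (abs_nonneg _))
          exact mul_le_mul_of_nonneg_left hΛle (by positivity)
        have h3 : truncWeight T p.1.1 * truncWeight T p.1.2 / |g| ≤ Rfar := by
          rw [hRfar_eq]
          calc truncWeight T p.1.1 * truncWeight T p.1.2 / |g|
              = (truncWeight T p.1.1 * truncWeight T p.1.2) * (1 / |g|) := by ring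
            _ ≤ (truncWeight T p.1.1 * truncWeight T p.1.2) *
                  (2 * C₁ * (logPlus (p.1.1 : ℝ) + logPlus (p.1.2 : ℝ)) / |(p.1.1 : ℝ) - p.1.2|) :=
                mul_le_mul_of_nonneg_left h2 hψψ0
            _ = _ := by ring
        have h4 : 0 ≤ ind * truncWeight T p.1.1 / 4 := div_nonneg (mul_nonneg hind0' hψj) (by norm_num)
        linarith only [h3, h4, hW0]
  -- ### rows of `G`
  have ha' : Real.log (2 + T * Real.log T) + 1 ≤ 4 * Real.log T := by
    have h1 : 2 + T * Real.log T ≤ T ^ 3 := by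
      have : Real.log T ≤ T := (Real.log_le_sub_one_of_pos hT0).trans (by linarith only [hT3])
      have hTT : T * Real.log T ≤ T * T := mul_le_mul_of_nonneg_left this hT0.le
      have h9 : (9 : ℝ) ≤ T * T := by nlinarith only [hT3]
      have h18 : (9 : ℝ) * 2 ≤ T * T * (T - 1) :=
        mul_le_mul h9 (by linarith only [hT3]) (by norm_num) (by positivity)
      nlinarith only [hTT, h18]
    have h2 : Real.log (2 + T * Real.log T) ≤ 3 * Real.log T := by
      have := Real.log_le_log (by positivity) h1
      rw [Real.log_pow] at this; push_cast at this; linarith only [this]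
    linarith only [h2, hlog1]
  have ha'0 : 0 ≤ Real.log (2 + T * Real.log T) + 1 := by
    have : 0 ≤ Real.log (2 + T * Real.log T) := Real.log_nonneg (by linarith only [hTlog])
    linarith only [this]
  have hlog2 : (1 : ℝ) / 2 ≤ Real.log 2 := by have := Real.log_two_gt_d9; linarith
  obtain ⟨Φ, hΦ⟩ : ∃ Φ : ℤ → ℝ, Φ = fun j : ℤ ↦
      (2 * D + 1) * (truncWeight T j * logPlus (j : ℝ) ^ 2) +
        (2 * Td' + 1) / 4 * (truncWeight T j * logPlus (j : ℝ) ^ 0) +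
        2 * C₁ * (18 * (truncWeight T j * logPlus (j : ℝ) ^ 2) +
          10 * (T * Real.log T) * (truncWeight T j * logPlus (j : ℝ) ^ 1 / |(j : ℝ)|) +
          10 * ((Real.log (2 + T * Real.log T) + 1) * (T * Real.log T)) *
            (truncWeight T j * logPlus (j : ℝ) ^ 0 / |(j : ℝ)|)) := ⟨_, rfl⟩
  have hΦ0 : ∀ j, 0 ≤ Φ j := fun j ↦ by
    have h1 : 0 ≤ logPlus (j : ℝ) := logPlus_nonneg _
    have h3 := hψ0 j
    rw [hΦ]; dsimp only
    exact add_nonneg (add_nonneg (mul_nonneg (by positivity) (mul_nonneg h3 (sq_nonneg _)))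
      (mul_nonneg (by positivity) (mul_nonneg h3 (pow_nonneg h1 _))))
      (mul_nonneg (by positivity) (add_nonneg (add_nonneg
        (mul_nonneg (by norm_num) (mul_nonneg h3 (sq_nonneg _)))
        (mul_nonneg (by positivity) (div_nonneg (mul_nonneg h3 (pow_nonneg h1 _)) (abs_nonneg _))))
        (mul_nonneg (by positivity) (div_nonneg (mul_nonneg h3 (pow_nonneg h1 _)) (abs_nonneg _)))))
  have hrow : ∀ j : ℤ, Summable (fun k : ℤ ↦ G (j, k)) ∧ ∑' k : ℤ, G (j, k) ≤ Φ j := by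
    intro j
    by_cases hj1 : (1 : ℝ) ≤ |(j : ℝ)|
    · have hj : j ≠ 0 := by
        intro h; rw [h] at hj1; norm_num at hj1
      have hψj := hψ0 j
      have hlpj : Real.log 2 ≤ logPlus (j : ℝ) := by
        rw [logPlus_eq]; exact Real.log_le_log two_pos (by linarith only [abs_nonneg (j : ℝ)])
      have hlp0 : 0 < logPlus (j : ℝ) := logPlus_pos _
      -- the four pieces
      obtain ⟨hsI, hI⟩ := tsum_nearInd_le j (L := D * logPlus (3 * |(j : ℝ)|) ^ 2) (by positivity)
      obtain ⟨hsS, hSm⟩ := tsum_ite_abs_lt_le hTd'0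
      obtain ⟨hs0, hB0⟩ := tsum_truncWeight_logPlus_pow_div_le hT3 (a := 0) (by norm_num) hj
      obtain ⟨hs1, hB1⟩ := tsum_truncWeight_logPlus_pow_div_le hT3 (a := 1) (by norm_num) hj
      simp only [pow_zero, mul_one, one_mul] at hs0 hB0
      simp only [pow_one] at hs1 hB1
      obtain ⟨a₁, ha₁⟩ : ∃ a₁ : ℝ, a₁ = truncWeight T j / 4 := ⟨_, rfl⟩
      obtain ⟨a₂, ha₂⟩ : ∃ a₂ : ℝ, a₂ = 2 * C₁ * truncWeight T j * logPlus (j : ℝ) := ⟨_, rfl⟩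
      obtain ⟨a₃, ha₃⟩ : ∃ a₃ : ℝ, a₃ = 2 * C₁ * truncWeight T j := ⟨_, rfl⟩
      have ha₁0 : 0 ≤ a₁ := by rw [ha₁]; exact div_nonneg hψj (by norm_num)
      have ha₂0 : 0 ≤ a₂ := by rw [ha₂]; exact mul_nonneg (mul_nonneg (by positivity) hψj) hlp0.le
      have ha₃0 : 0 ≤ a₃ := by rw [ha₃]; exact mul_nonneg (by positivity) hψj
      have hGjk : ∀ k : ℤ, G (j, k) =
          a₁ * (if |(k : ℝ)| ≤ 2 * |(j : ℝ)| ∧ |(j : ℝ) - k| < D * logPlus (3 * |(j : ℝ)|) ^ 2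
                then (1 : ℝ) else 0) +
            a₁ * (if |(k : ℝ)| < Td' then (1 : ℝ) else 0) +
            a₂ * (truncWeight T k * (1 / |(j : ℝ) - k|)) +
            a₃ * (truncWeight T k * logPlus k * (1 / |(j : ℝ) - k|)) := by
        intro k
        rw [hG, ha₁, ha₂, ha₃]; dsimp only; rw [if_pos hj1]; ring
      have hsum : Summable (fun k : ℤ ↦ G (j, k)) :=
        ((((hsI.mul_left a₁).add (hsS.mul_left a₁)).add (hs0.mul_left a₂)).add
          (hs1.mul_left a₃)).congr fun k ↦ (hGjk k).symm
      refine ⟨hsum, ?_⟩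
      have htsum : ∑' k : ℤ, G (j, k) =
          a₁ * ∑' k : ℤ, (if |(k : ℝ)| ≤ 2 * |(j : ℝ)| ∧ |(j : ℝ) - k| < D * logPlus (3 * |(j : ℝ)|) ^ 2
                then (1 : ℝ) else 0) +
            a₁ * ∑' k : ℤ, (if |(k : ℝ)| < Td' then (1 : ℝ) else 0) +
            a₂ * ∑' k : ℤ, truncWeight T k * (1 / |(j : ℝ) - k|) +
            a₃ * ∑' k : ℤ, truncWeight T k * logPlus k * (1 / |(j : ℝ) - k|) := by
        rw [tsum_congr hGjk,
          ((((hsI.mul_left a₁).add (hsS.mul_left a₁)).add (hs0.mul_left a₂))).tsum_add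
            (hs1.mul_left a₃),
          ((hsI.mul_left a₁).add (hsS.mul_left a₁)).tsum_add (hs0.mul_left a₂),
          (hsI.mul_left a₁).tsum_add (hsS.mul_left a₁),
          tsum_mul_left, tsum_mul_left, tsum_mul_left, tsum_mul_left]
      rw [htsum, hΦ]; dsimp only
      -- elementary comparisons, all in terms of `lp := log₊ j`
      have hloglp : Real.log |(j : ℝ)| ≤ logPlus (j : ℝ) := by
        rw [logPlus_eq]; exact Real.log_le_log (by linarith only [hj1]) (by linarith only [hj1])
      have hlog0j : 0 ≤ Real.log |(j : ℝ)| := Real.log_nonneg hj1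
      have hlp3 : logPlus (3 * |(j : ℝ)|) ≤ 2 * logPlus (j : ℝ) := by
        rw [logPlus_eq, logPlus_eq, abs_of_nonneg (by positivity : (0:ℝ) ≤ 3 * |(j : ℝ)|),
          ← Real.log_rpow (by positivity), Real.rpow_two]
        exact Real.log_le_log (by positivity) (by nlinarith only [abs_nonneg (j : ℝ)])
      have hlp2j : logPlus (2 * |(j : ℝ)|) ≤ 2 * logPlus (j : ℝ) := by
        have := logPlus_two_mul_le (abs_nonneg (j : ℝ)); rwa [logPlus_abs] at this
      have h1log : 2 * (1 + Real.log |(j : ℝ)|) ≤ 6 * logPlus (j : ℝ) := by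
        linarith only [hloglp, hlpj, hlog2]
      have hI' : ∑' k : ℤ, (if |(k : ℝ)| ≤ 2 * |(j : ℝ)| ∧ |(j : ℝ) - k| < D * logPlus (3 * |(j : ℝ)|) ^ 2
          then (1 : ℝ) else 0) ≤ (8 * D + 4) * logPlus (j : ℝ) ^ 2 := by
        refine hI.trans ?_
        have h1 : logPlus (3 * |(j : ℝ)|) ^ 2 ≤ (2 * logPlus (j : ℝ)) ^ 2 :=
          pow_le_pow_left₀ (logPlus_nonneg _) hlp3 2
        nlinarith only [h1, hD0, hlpj, hlog2]
      have hB0' : ∑' k : ℤ, truncWeight T k * (1 / |(j : ℝ) - k|) ≤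
          6 * logPlus (j : ℝ) + 1 / |(j : ℝ)| * (10 * (T * Real.log T)) :=
        hB0.trans (by linarith only [h1log])
      have hB1' : ∑' k : ℤ, truncWeight T k * logPlus k * (1 / |(j : ℝ) - k|) ≤
          12 * logPlus (j : ℝ) ^ 2 +
            1 / |(j : ℝ)| * ((Real.log (2 + T * Real.log T) + 1) * (10 * (T * Real.log T))) := by
        refine hB1.trans ?_
        have h1 : logPlus (2 * |(j : ℝ)|) * (2 * (1 + Real.log |(j : ℝ)|)) ≤
            (2 * logPlus (j : ℝ)) * (6 * logPlus (j : ℝ)) :=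
          mul_le_mul hlp2j h1log (by linarith only [hlog0j]) (by linarith only [hlp0])
        linarith only [h1]
      -- assemble
      calc a₁ * ∑' k : ℤ, (if |(k : ℝ)| ≤ 2 * |(j : ℝ)| ∧ |(j : ℝ) - k| < D * logPlus (3 * |(j : ℝ)|) ^ 2
                then (1 : ℝ) else 0) +
            a₁ * ∑' k : ℤ, (if |(k : ℝ)| < Td' then (1 : ℝ) else 0) +
            a₂ * ∑' k : ℤ, truncWeight T k * (1 / |(j : ℝ) - k|) +
            a₃ * ∑' k : ℤ, truncWeight T k * logPlus k * (1 / |(j : ℝ) - k|)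
          ≤ a₁ * ((8 * D + 4) * logPlus (j : ℝ) ^ 2) + a₁ * (2 * Td' + 1) +
            a₂ * (6 * logPlus (j : ℝ) + 1 / |(j : ℝ)| * (10 * (T * Real.log T))) +
            a₃ * (12 * logPlus (j : ℝ) ^ 2 +
              1 / |(j : ℝ)| * ((Real.log (2 + T * Real.log T) + 1) * (10 * (T * Real.log T)))) :=
            add_le_add (add_le_add (add_le_add (mul_le_mul_of_nonneg_left hI' ha₁0)
              (mul_le_mul_of_nonneg_left hSm ha₁0)) (mul_le_mul_of_nonneg_left hB0' ha₂0))
              (mul_le_mul_of_nonneg_left hB1' ha₃0)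
        _ = (2 * D + 1) * (truncWeight T j * logPlus (j : ℝ) ^ 2) +
              (2 * Td' + 1) / 4 * (truncWeight T j * logPlus (j : ℝ) ^ 0) +
              2 * C₁ * (18 * (truncWeight T j * logPlus (j : ℝ) ^ 2) +
                10 * (T * Real.log T) * (truncWeight T j * logPlus (j : ℝ) ^ 1 / |(j : ℝ)|) +
                10 * ((Real.log (2 + T * Real.log T) + 1) * (T * Real.log T)) *
                  (truncWeight T j * logPlus (j : ℝ) ^ 0 / |(j : ℝ)|)) := by
            rw [ha₁, ha₂, ha₃]; ring
    · have hGz : ∀ k : ℤ, G (j, k) = 0 := fun k ↦ by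
        rw [hG]; dsimp only; rw [if_neg hj1]
      refine ⟨(summable_zero).congr fun k ↦ (hGz k).symm, ?_⟩
      rw [tsum_congr hGz, tsum_zero]
      exact hΦ0 j
  -- ### the profile sums
  obtain ⟨hsψ2, -⟩ := RodgersTaoTruncEnergyExpansion.tsum_truncWeight_mul_logPlus_pow_le hT3
    (p := 2) (by norm_num)
  obtain ⟨hsψ0', -⟩ := RodgersTaoTruncEnergyExpansion.tsum_truncWeight_mul_logPlus_pow_le hT3
    (p := 0) (by norm_num)
  have hB2 := RodgersTaoTruncEnergyExpansion.tsum_truncWeight_mul_logPlus_pow_le' hT3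
    (p := 2) (by norm_num)
  have hBψ0 := RodgersTaoTruncEnergyExpansion.tsum_truncWeight_mul_logPlus_pow_le' hT3
    (p := 0) (by norm_num)
  obtain ⟨hsd1, hBd1⟩ := RodgersTaoTruncEnergyExpansion.tsum_truncWeight_mul_logPlus_pow_div_le hT3
    (p := 1) (by norm_num)
  obtain ⟨hsd0, hBd0⟩ := RodgersTaoTruncEnergyExpansion.tsum_truncWeight_mul_logPlus_pow_div_le hT3
    (p := 0) (by norm_num)
  have hinnerS : Summable (fun j : ℤ ↦ 18 * (truncWeight T j * logPlus (j : ℝ) ^ 2) +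
      10 * (T * Real.log T) * (truncWeight T j * logPlus (j : ℝ) ^ 1 / |(j : ℝ)|) +
      10 * ((Real.log (2 + T * Real.log T) + 1) * (T * Real.log T)) *
        (truncWeight T j * logPlus (j : ℝ) ^ 0 / |(j : ℝ)|)) :=
    ((hsψ2.mul_left 18).add (hsd1.mul_left _)).add (hsd0.mul_left _)
  have hΦS : Summable Φ := by
    rw [hΦ]
    exact ((hsψ2.mul_left _).add (hsψ0'.mul_left _)).add (hinnerS.mul_left (2 * C₁))
  have hinner_sum : ∑' j : ℤ, (18 * (truncWeight T j * logPlus (j : ℝ) ^ 2) +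
      10 * (T * Real.log T) * (truncWeight T j * logPlus (j : ℝ) ^ 1 / |(j : ℝ)|) +
      10 * ((Real.log (2 + T * Real.log T) + 1) * (T * Real.log T)) *
        (truncWeight T j * logPlus (j : ℝ) ^ 0 / |(j : ℝ)|)) =
      18 * ∑' j : ℤ, truncWeight T j * logPlus (j : ℝ) ^ 2 +
      10 * (T * Real.log T) * ∑' j : ℤ, truncWeight T j * logPlus (j : ℝ) ^ 1 / |(j : ℝ)| +
      10 * ((Real.log (2 + T * Real.log T) + 1) * (T * Real.log T)) *
        ∑' j : ℤ, truncWeight T j * logPlus (j : ℝ) ^ 0 / |(j : ℝ)| := by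
    rw [((hsψ2.mul_left 18).add (hsd1.mul_left _)).tsum_add (hsd0.mul_left _),
      (hsψ2.mul_left 18).tsum_add (hsd1.mul_left _), tsum_mul_left, tsum_mul_left, tsum_mul_left]
  have hinner_le : ∑' j : ℤ, (18 * (truncWeight T j * logPlus (j : ℝ) ^ 2) +
      10 * (T * Real.log T) * (truncWeight T j * logPlus (j : ℝ) ^ 1 / |(j : ℝ)|) +
      10 * ((Real.log (2 + T * Real.log T) + 1) * (T * Real.log T)) *
        (truncWeight T j * logPlus (j : ℝ) ^ 0 / |(j : ℝ)|)) ≤ 2740 * (T * Real.log T ^ 3) := by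
    rw [hinner_sum]
    have e1 : 18 * ∑' j : ℤ, truncWeight T j * logPlus (j : ℝ) ^ 2 ≤
        18 * (10 * 3 ^ 2 * (T * Real.log T) * Real.log T ^ 2) :=
      mul_le_mul_of_nonneg_left hB2 (by norm_num)
    have e2 : 10 * (T * Real.log T) * ∑' j : ℤ, truncWeight T j * logPlus (j : ℝ) ^ 1 / |(j : ℝ)| ≤
        10 * (T * Real.log T) * (16 * 3 ^ 1 * Real.log T ^ (1 + 1)) :=
      mul_le_mul_of_nonneg_left hBd1 (by positivity)
    have e3 : 10 * ((Real.log (2 + T * Real.log T) + 1) * (T * Real.log T)) *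
        ∑' j : ℤ, truncWeight T j * logPlus (j : ℝ) ^ 0 / |(j : ℝ)| ≤
        10 * ((4 * Real.log T) * (T * Real.log T)) * (16 * 3 ^ 0 * Real.log T ^ (0 + 1)) :=
      mul_le_mul (mul_le_mul_of_nonneg_left (mul_le_mul_of_nonneg_right ha' hTlog.le) (by norm_num))
        hBd0 (tsum_nonneg fun j ↦ div_nonneg (mul_nonneg (hψ0 j) (pow_nonneg (logPlus_nonneg _) _))
          (abs_nonneg _)) (by positivity)
    have e4 : 18 * (10 * 3 ^ 2 * (T * Real.log T) * Real.log T ^ 2) +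
        10 * (T * Real.log T) * (16 * 3 ^ 1 * Real.log T ^ (1 + 1)) +
        10 * ((4 * Real.log T) * (T * Real.log T)) * (16 * 3 ^ 0 * Real.log T ^ (0 + 1)) =
        2740 * (T * Real.log T ^ 3) := by ring
    linarith only [e1, e2, e3, e4]
  have hΦsum : ∑' j : ℤ, Φ j = (2 * D + 1) * ∑' j : ℤ, truncWeight T j * logPlus (j : ℝ) ^ 2 +
      (2 * Td' + 1) / 4 * ∑' j : ℤ, truncWeight T j * logPlus (j : ℝ) ^ 0 +
      2 * C₁ * ∑' j : ℤ, (18 * (truncWeight T j * logPlus (j : ℝ) ^ 2) +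
        10 * (T * Real.log T) * (truncWeight T j * logPlus (j : ℝ) ^ 1 / |(j : ℝ)|) +
        10 * ((Real.log (2 + T * Real.log T) + 1) * (T * Real.log T)) *
          (truncWeight T j * logPlus (j : ℝ) ^ 0 / |(j : ℝ)|)) := by
    rw [hΦ]; dsimp only
    rw [((hsψ2.mul_left _).add (hsψ0'.mul_left _)).tsum_add (hinnerS.mul_left (2 * C₁)),
      (hsψ2.mul_left _).tsum_add (hsψ0'.mul_left _), tsum_mul_left, tsum_mul_left, tsum_mul_left]
  have hΦle : ∑' j : ℤ, Φ j ≤ K * (T * Real.log T ^ 3) := by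
    rw [hΦsum, hK]
    have e1 : (2 * D + 1) * ∑' j : ℤ, truncWeight T j * logPlus (j : ℝ) ^ 2 ≤
        (2 * D + 1) * (10 * 3 ^ 2 * (T * Real.log T) * Real.log T ^ 2) :=
      mul_le_mul_of_nonneg_left hB2 (by positivity)
    have e2 : (2 * Td' + 1) / 4 * ∑' j : ℤ, truncWeight T j * logPlus (j : ℝ) ^ 0 ≤
        (2 * Td' + 1) / 4 * (10 * 3 ^ 0 * (T * Real.log T) * Real.log T ^ 0) :=
      mul_le_mul_of_nonneg_left hBψ0 (by positivity)
    have e3 : 2 * C₁ * ∑' j : ℤ, (18 * (truncWeight T j * logPlus (j : ℝ) ^ 2) +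
        10 * (T * Real.log T) * (truncWeight T j * logPlus (j : ℝ) ^ 1 / |(j : ℝ)|) +
        10 * ((Real.log (2 + T * Real.log T) + 1) * (T * Real.log T)) *
          (truncWeight T j * logPlus (j : ℝ) ^ 0 / |(j : ℝ)|)) ≤ 2 * C₁ * (2740 * (T * Real.log T ^ 3)) :=
      mul_le_mul_of_nonneg_left hinner_le (by positivity)
    have e5 : (2 * D + 1) * (10 * 3 ^ 2 * (T * Real.log T) * Real.log T ^ 2) =
        90 * (2 * D + 1) * (T * Real.log T ^ 3) := by ring
    have e6 : (2 * Td' + 1) / 4 * (10 * 3 ^ 0 * (T * Real.log T) * Real.log T ^ 0) ≤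
        10 * (2 * Td' + 1) * (T * Real.log T ^ 3) := by
      have h1 : (2 * Td' + 1) / 4 * (10 * 3 ^ 0 * (T * Real.log T) * Real.log T ^ 0) =
          (10 * (2 * Td' + 1)) * ((T * Real.log T) / 4) := by ring
      rw [h1]
      refine mul_le_mul_of_nonneg_left ?_ (by positivity)
      linarith only [hNL, hTlog]
    have e7 : 2 * C₁ * (2740 * (T * Real.log T ^ 3)) = 5480 * C₁ * (T * Real.log T ^ 3) := by ring
    have e8 : (90 * (2 * D + 1) + 10 * (2 * Td' + 1) + 5480 * C₁) * (T * Real.log T ^ 3) =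
        90 * (2 * D + 1) * (T * Real.log T ^ 3) + 10 * (2 * Td' + 1) * (T * Real.log T ^ 3) +
          5480 * C₁ * (T * Real.log T ^ 3) := by ring
    linarith only [e1, e2, e3, e5, e6, e7, e8]
  -- ### summability of `G` on `ℤ × ℤ`, of `F`, and the bound
  have hrows : Summable (fun j : ℤ ↦ ∑' k : ℤ, G (j, k)) :=
    hΦS.of_nonneg_of_le (fun j ↦ tsum_nonneg fun k ↦ hG0 _) fun j ↦ (hrow j).2
  have hGS : Summable G := (summable_prod_of_nonneg hG0).2 ⟨fun j ↦ (hrow j).1, hrows⟩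
  have hGle : ∑' q : ℤ × ℤ, G q ≤ K * (T * Real.log T ^ 3) :=
    calc ∑' q : ℤ × ℤ, G q = ∑' j : ℤ, ∑' k : ℤ, G (j, k) := hGS.tsum_prod' fun j ↦ (hrow j).1
      _ ≤ ∑' j : ℤ, Φ j := hrows.tsum_le_tsum (fun j ↦ (hrow j).2) hΦS
      _ ≤ _ := hΦle
  obtain ⟨hWs, hWle⟩ := hEi T hTi t hs
  have hGS' : Summable (fun p : zstarOffDiag ↦ G p.1) := hGS.subtype _
  have hmajS : Summable (fun p : zstarOffDiag ↦
      truncWeight T p.1.1 * truncWeight T p.1.2 * interactionEnergy t p.1.1 p.1.2 + G p.1) :=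
    hWs.add hGS'
  have hFS : Summable F := hmajS.of_nonneg_of_le hF0 hpt
  refine ⟨hFS, ?_⟩
  rw [abs_of_nonneg (tsum_nonneg hF0)]
  have h1 : ∑' p, F p ≤ ∑' p : zstarOffDiag,
      (truncWeight T p.1.1 * truncWeight T p.1.2 * interactionEnergy t p.1.1 p.1.2) +
        ∑' p : zstarOffDiag, G p.1 := by
    have e1 := hWs.tsum_add hGS'
    have e3 := hFS.tsum_le_tsum hpt hmajS
    linarith only [e1, e3]
  have h2 : ∑' p : zstarOffDiag, G p.1 ≤ ∑' q : ℤ × ℤ, G q :=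
    Summable.tsum_subtype_le G zstarOffDiag hG0 hGS
  have h3 : truncEnergy T t + Ci * (T * Real.log T ^ 3) + K * (T * Real.log T ^ 3) ≤
      (1 + Ci + K) * X := by
    rw [hX]
    nlinarith only [hCi0, hK0, hE0, hTL0]
  linarith only [h1, hWle, h2, hGle, h3]

/-- **Rodgers–Tao 2020, Lemma 21 (ii) without `log₊ T`, `x_i(t)`-version, printed witness form —
CONTENT proof from the as-printed location law.** `RodgersTao2020.cor33_location` (CONTENT-proved in
the tree as `RodgersTao2020.cor33_location_content`) implies, for every `t₀ < 0` with `H_{t₀}`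
real-rooted, that `Σ_{j ≠ k} ψ_T(j)ψ_T(k)/|x_j(t) − x_k(t)|` is moderately sized in the window of `t₀`.
(The printed (ii), with the factor `log₊ T`, is false as stated — erratum E-d — and is not typed; the
ex-falso record `rodgers_tao_moderatelySized_holds` is untouched.)
[cite: RodgersTaoFMP2020, Lemma 21 (ii) p. 47, proof p. 48 (first two displays); Cor. 10 (50) p. 23] -/
theorem rodgers_tao_moderatelySized_ii_logFree_of_cor33_location
    (h50 : RodgersTao2020.cor33_location) :
    ∀ t₀ : ℝ, t₀ < 0 → HasOnlyRealZeros (deBruijnH t₀) →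
      IsModeratelySized t₀ (fun T t p ↦
        truncWeight T p.1.1 * truncWeight T p.1.2 /
          |deBruijnZeroZ t p.1.1 - deBruijnZeroZ t p.1.2|) := by
  intro t₀ ht₀ hreal
  obtain ⟨A50, hA50⟩ := h50
  have H2 : ∀ t ∈ Icc (t₀ / 2) 0, ∀ n : ℕ, 1 ≤ n →
      |deBruijnZero t n - classicalLocation (n : ℝ)| ≤ A50 * logPlus (classicalLocation (n : ℝ)) :=
    fun t ht n hn ↦ hA50 t ⟨t₀, by linarith [ht.1], hreal⟩ ht.2 n hn
  exact rodgers_tao_moderatelySized_ii_logFree_of_location ⟨t₀, by linarith, hreal⟩ H2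

end Literature.NumberTheory.LFunctions


end
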